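import Literature.MathematicalPhysics.QuantumFieldTheory.Balaban1983to89.B6Prop25L2LocTwoScaleV1
import Literature.MathematicalPhysics.QuantumFieldTheory.Balaban1983to89.B6Prop25GradDecayTwoScaleV1
import Literature.MathematicalPhysics.QuantumFieldTheory.Balaban1983to89.B6Prop25GDivDecayTwoScaleV1
import Literature.MathematicalPhysics.QuantumFieldTheory.Balaban1983to89.B6Prop25L2LocGradTwoScaleV1
import Literature.MathematicalPhysics.QuantumFieldTheory.Balaban1983to89.B6Prop25HolderTwoScaleV1
import Literature.MathematicalPhysics.QuantumFieldTheory.Balaban1983to89.B6Prop25HolderGDivTwoScaleV1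
import Literature.MathematicalPhysics.QuantumFieldTheory.Balaban1983to89.B6Prop25HolderRateFreeV1
import Literature.MathematicalPhysics.QuantumFieldTheory.Balaban1983to89.B6Prop25Eq112TwoScaleV1
import Literature.MathematicalPhysics.QuantumFieldTheory.Balaban1983to89.B6Prop25Eq113TwoScaleV1
import Literature.MathematicalPhysics.QuantumFieldTheory.Balaban1983to89.B6Prop25Grad2DecayTwoScaleV1
import Literature.MathematicalPhysics.QuantumFieldTheory.Balaban1983to89.B6Prop25GradGDivDecayTwoScaleV1
import Literature.MathematicalPhysics.QuantumFieldTheory.Balaban1983to89.B6Prop25LapDecayTwoScaleV1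
import Literature.MathematicalPhysics.QuantumFieldTheory.Balaban1983to89.B6Eq2129TwoScaleV1
import Literature.MathematicalPhysics.QuantumFieldTheory.Balaban1983to89.B6

/-!
# `Balaban1983to89.B6Prop25TwoScaleCensus` — T. Bałaban, *Propagators and renormalization transformations for lattice gauge theories. II*,
# Commun. Math. Phys. **96** (1984) 223–250 [Balaban1984PropagatorsII], **Proposition 2.5** p. 246 — THE CENSUS CARRIER OF PROP. 2.5 FOR THE
# GENUINE TWO-SCALE FAMILY of local operators `G_□` of (2.90) (p22's concrete data `tsV1`, `Λ′ ⊂ T^{(j+1)}` ARBITRARY, `c = L^j`, weights in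
# [4]'s window): the `B5.Setting` with EVERY (1.110)–(1.114) functional a genuine quantity in `(tsV1 hc Λ′ w).G`, the `B6.LocalOp` family
# `locTS`, the FIRST CONJUNCT of `B6.Prop25Printed locTS` ((2.129) for every member) PROVED, and the clauses of `B5.Ineq110_114` landed so far
# ((1.110)₁ `|GJ|`, (1.110)₂ `|∇GJ|`, (1.114)₁ `‖ζGJ‖`) in census shape with constants chosen BEFORE the member

statement-level skeleton of published theorems with citation tags; proofs where landed; nothing here is a claim about the Yang–Mills mass gap

PDF held: `paper:balaban1984-cmp96-propagators-rt-ii` (journal page = PDF page + 222), p. 246 [PDF 24], p. 239 [PDF 17]; `paper:balaban1984-cmp95-propagators-rt-i`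
([4], journal page = PDF page + 16), pp. 35–36 [PDF 19–20].

PRINT (verbatim, p. 246): *"Proposition 2.5. The operator G_□ defined by (2.90) on the torus T_□ (or on the whole lattice ξZ^d) has the representation
(2.129) and satisfies all the inequalities (1.110)–(1.114) of the Proposition 1.2 with a positive constant δ₂ instead of δ₀. This constant depends
on d and L only."*  [4] Prop. 1.2 pp. 35–36 is quoted verbatim in the tree's `B5.Prop12Printed`; its predicate `B5.Ineq110_114 S C Cα Cε Cαε δ` over
a `B5.Setting S` is the second conjunct of the census Prop `B6.Prop25Printed` (b06, `B6.lean`).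

CITATION HEADER (lean-in-tree rule) — WHAT IS REPRODUCED.  Phase-2 file of the `lit-balaban` typed skeleton (HOME `run/shared/lean/pub/lit-balaban/`),
seat **r03 gen 14** (B6 fold owner; own lane, TAKING HOME/STATUS 2026-08-22T11:58:46Z; p22 g15's GEN15-PLAN item 4 «ask r03 which Prop shape the row
wants» answered by this file); SKELETON row **B6.Prop2.5** — a MEMBER/CARRIER cell (decl of record `B6.Prop25Printed` untouched; head = the one-level
instance `B6Prop25OneLevelFamG.prop25Printed_oneLevel_famG` p327418 / p310856, bracket ref-4 g44).  INPUTS BY NAME, nothing restated: p22's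
`B6SectCTwoScaleV1Lattice.tsV1` (the (2.90)/(2.95)–(2.104) data) with `B6Eq2129TwoScaleV1.eq2129_V1` ((2.129), any `Λ′`, positive weights), and
p22 g14/g15's decay members for THE SAME operator: `B6Prop25DecayTwoScaleV1.prop25_ineq110_0` (|GJ|, p323702),
`B6Prop25GradDecayTwoScaleV1.prop25_ineq110_grad` (|∇_λGJ|, p325489), `B6Prop25L2LocTwoScaleV1.prop25_ineq114_0_sqrt` (‖ζGJ‖, p326686) — each stated
by p22 for blocks within a radius `r` of `y`, `y′`; the census reads them at `r = 1` (print's enlarged cubes `Δ̃(y)` = the `3^{d+1}` blocks `B(y″)`,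
`|y″ − y|_∞ ≤ 1`, of the unit lattice `T^{(j)}`).

WHAT THIS FILE DEFINES (bodies displayed; pattern = r03's `B6Prop22TwoLevelCensus` / `B6Prop25OneLevelFamG.locG`).
* `TSIdx d L hd hL a₀ a₁` — the index of the genuine two-scale family: volume `(m, K)`, scale `j` with `j + 1 ≤ m + K`, `Λ′ ⊂ T^{(j+1)}` arbitrary,
  weights `w` on `𝔅 = Λ^c ∪ Λ′` in [4]'s window `a₀(L^j)^{d+1} ≤ w ≤ a₁(L^j)^{d+1}` — exactly p22's quantifier block, as a structure; `P i`, `D i := tsV1 …`.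
* the THREE SOURCE KINDS `LocTS` (as r02's `B5SettingP12Real.LocR`): `vec J` (a fine bond field — for `GJ`, `∇GJ`, `ΔGJ`, `∇∇GJ`), `ten J`
  (`J_λ` a bond field for each `λ` — for `G∇*J = Σ_λ G∇_λ*J_λ`, `∇G∇*J`), `ten2 J` (for `G∇*∇*J`); `∇_λ = L^j(S_λ − I)`, `∇_λ* = L^j(S_λ⁻¹ − I)` are
  p22's (`Dop_comp_apply`, `adjoint_Dop`); `Δ := Σ_λ ∇_λ*∇_λ` componentwise (print's `−Δ`; every functional takes `|·|`).
* `settingTS i : B5.Setting` — `Site := T^{(j)}`, `dist := |·−·|_T` (sup torus distance, p22's), `suppIn J y′ ⇔` every component bond of `J` lies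
  in a block within distance `1` of `y′` (`supp J ⊂ Δ̃(y′)`), `supNorm = |J|` (max over bonds/components), `l2Norm = ‖J‖`, `holder ε J = ‖J‖_ε`
  (Hölder seminorm, distances in `T^{(j)}` units), cut-offs `ζ : T^{(0)}-sites → ℝ` with `cutIn`/`cutH = ‖ζ‖_α + |ζ|`/`cutSup = |ζ|`, and the
  functionals `e` ((1.110): cube-sups of `|GJ|`, `|∇GJ|`, `|G∇*J|`, `|ΔGJ|` on their source kinds, `0` on the other kinds — r02's device),
  `h1` ((1.111)), `e4` ((1.112)), `h2` ((1.113)), `l2loc` ((1.114), six cut `ℓ²` norms), `l2op` ((1.89)), `formΔa`/`formΔI` ((1.90), `Δ_a` = p22's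
  `deltaA`) — ALL GENUINE.
* `locTS i : B6.LocalOp := ⟨settingTS i, (2.129) for D i⟩` (the `Repr2129` FIELD is p22's identity for `tsV1`, exactly the field of
  `B6Prop25OneLevelV1.loc` with `Λ′` arbitrary).

WHAT IS PROVED (kernel-checked, 0 sorry, standard axioms; `d`, odd `L > 1`, `0 < a₀ ≤ a₁`).
* **`repr2129_TS : ∀ i, (locTS … i).Repr2129`** — the FIRST CONJUNCT of `B6.Prop25Printed (locTS …)` in full (p22's `eq2129_V1`).
* **`ineq110_zero_TS`** — the (1.110)₁ clause of `B5.Ineq110_114` for every member with ONE `(δ₂, C)`: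
  `∀ i J y y′, suppIn J y′ → e 0 J y ≤ C·e^{−δ₂|y−y′|}·|J|` (p22's `prop25_ineq110_0` at `r = 1`);
  **`ineq110_one_TS`** — the (1.110)₂ clause (`prop25_ineq110_grad` at `r = 1`, max over `λ`);
  **`ineq114_zero_TS`** — the (1.114)₁ clause `l2loc 0 J ζ ≤ C·e^{−δ₂|y−y′|}·|ζ|·‖J‖` (`prop25_ineq114_0_sqrt` at `r = 1`).
* `tsIdx_nonempty` — non-vacuity of the index (any `(m, K)` with `m + K ≥ 1`, `j = 0`, `Λ′ = ∅`, `w ≡ a₀`).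
HONEST SCOPE.  `B6.Prop25Printed (locTS …)` is **NOT** inhabited here and is NOT claimed: of the fifteen clause families of `B5.Ineq110_114` the
tree has, for the genuine two-scale `G`, (1.110)₁,₂ and (1.114)₁ (this file), (1.110)₃ `|G∇*J|` and (1.114)₂,₃ from p22 g15 files 14–15 (§§9–10,
v1.1 of this file), (1.111) in flight (p38 g21), and (1.110)₄ `|ΔGJ|`, (1.112), (1.113), (1.114)₄₋₆ NOT in the tree (p22 GEN15-PLAN).  No slot of
`settingTS` is the constant `0` except r02's source-kind device (each operator on the kind it acts on).  Conventions: cubes `Δ̃(y)` = blocks within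
sup-distance `1` on `T^{(j)}` (p22's radius `r = 1`); `∇_λ`, `∇_λ*` with the factor `L^j` (the `ξ`-lattice of `T_□`, `c = L^j`); Hölder distances in
`T^{(j)}` units (`|x − x′|_{T^{(0)}}/L^j`); `ℓ²` norms unweighted on both sides ((1.114) is normalisation-free, p22 file 11 HONEST SCOPE (2)); `Δ` on
vector fields := `Σ_λ ∇_λ*∇_λ` componentwise (print's `−Δ`); constants depend on `d, L, a₀, a₁` (print: «d and L only» at `a = 1`).  Value = the
census carrier on which the genuine two-scale Prop. 2.5 will be assembled clause by clause, with the first conjunct and three clauses in place;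
NOT summit progress.  Unit `lit-balaban-r03` (gen 14), 2026-08-22.

v1.1 (APPEND-ONLY, same seat): §9 **`ineq110_two_TS`** — the (1.110)₃ clause `e 2 J y = sup_{Δ̃(y)}|G∇*J| ≤ C·e^{−δ₂|y−y′|}·|J|` on the `ten` kind
(`G∇*J = Σ_λ G∇_λ*J_λ`), from p22 g15 file 14 `B6Prop25GDivDecayTwoScaleV1.prop25_ineq110_Gdiv` (p328268; per `λ`, at `r = 1`) by linearity and the
triangle inequality (constant `×(d+1)`); so THREE of the four (1.110) sup members are clauses on this carrier ((1.110)₄ `|ΔGJ|` is not in the tree);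
§10 **`ineq114_one_TS`**, **`ineq114_two_TS`** — the (1.114)₂,₃ clauses `l2loc 1 J ζ = (Σ_λ‖ζ∇_λGJ‖²)^{1/2}`, `l2loc 2 J ζ = ‖ζG∇*J‖ ≤ C·e^{−δ₂|y−y′|}·|ζ|·‖J‖`
from p22 g15 file 15 `B6Prop25L2LocGradTwoScaleV1.prop25_ineq114_grad` / `prop25_ineq114_Gdiv` (p329389; per `λ`, squared block Schur bounds at `r = 1`,
`Z = |ζ|`) by taking square roots, summing over the `d + 1` directions (`√(d+1) ≤ d + 1`) resp. the triangle inequality and `‖J_λ‖ ≤ ‖J‖`; so THREE of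
the six (1.114) members are clauses on this carrier; §11 **`clauses_settingTS_six`** — the six clauses read on `settingTS` with ONE `(δ₂, C)` in
`B5.Ineq110_114`'s own shape (its first conjunct at `n ≤ 2` = (1.110)₁,₂,₃ and its fifth conjunct at `n ≤ 2` = (1.114)₁,₂,₃).  `B6.Prop25Printed
(locTS …)` is still NOT inhabited (missing (1.110)₄, (1.111), (1.112), (1.113), (1.114)₄₋₆) and is NOT claimed.

v1.2 (APPEND-ONLY, unit `lit-balaban-r03` gen 15; one new import `B6Prop25HolderTwoScaleV1`): §12 **`ineq111_vec_TS`** — the (1.111)₁ member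
`h1 (vec J) α ζ = max_λ ‖ζ∇_λG_□J‖_α ≤ C_α·e^{−δ₂(1−α)|y−y′|}·(‖ζ‖_α + |ζ|)·|J|` for every member, every `0 ≤ α < 1` (`δ₂` on `d, L, a₀, a₁`, `C_α`
chosen before the member), read from p38 g21's `B6Prop25HolderTwoScaleV1.prop25_ineq111_grad` (p329819: the cut pair differences of `∇_λG_□J` for
same-direction pairs at `t = |x − x′|_∞/L^j ≤ 1`, with `Z_h = ‖ζ‖_α`, `Z₀ = |ζ|`, `X = |J|`, `r = 1`) and, for the pairs at `t > 1` that the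
seminorm `hqB` also ranges over, from the (1.110)₂ sup bound `prop25_ineq110_grad` (p22) — `|ζ(x)(∇_λG_□J)(b₁)| + |ζ(x′)(∇_λG_□J)(b₂)| ≤
2|ζ|·O(1)e^{−δ₂|y−y′|}|J|` and `t^α ≥ 1`; small API `h1TS_vec`, `fdist_eq`/`fdist_pos` (`t` = the lattice sup distance over `L^j`), `hqB_le`,
`abs_sub_le_hqS` (`|ζ(x) − ζ(x′)| ≤ ‖ζ‖_α t^α`), `smulB_Dl_G_apply`; and **`ineq111_vec_settingTS_upto`** — the same clause on `settingTS i` in the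
shape of `B5.Ineq110_114`'s second conjunct (`… ≤ C_α·e^{−δ·dist}·cutH α ζ·supNorm J`) for the `vec` kind on every range `0 ≤ α ≤ α₀ < 1`, with
`δ = δ₂(1 − α₀)` chosen before `α`.  DIVERGENCE DECLARED (= p38's HONEST SCOPE (1), HOME/GAPS.md G-B6-p38-01): the rate is `δ₂(1−α)` — the print
has ONE `δ₂(d, L)` for all `α < 1` — because the only Hölder input for `H_j` in the tree (b05's reading of [4] (1.63)) decays at an `α`-dependent
rate; so the second conjunct of `B5.Ineq110_114` on `settingTS` is NOT inhabited (it also needs the `ten`-kind member `‖ζG_□∇*J‖_α`, not in the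
tree for `G_□`), and `clauses_settingTS_six` is unchanged.  `B6.Prop25Printed (locTS …)` is still NOT inhabited and NOT claimed; in the tree for the
genuine two-scale `G_□` now: (2.129); (1.110)₁,₂,₃; (1.111)₁ at the rate `δ₂(1−α)`; (1.114)₁,₂,₃.

v1.3 (APPEND-ONLY, unit `lit-balaban-r03` gen 15; one new import `B6Prop25HolderGDivTwoScaleV1`): §13 **`ineq111_ten_TS`** — the (1.111)₂ member
`h1 (ten J) α ζ = ‖ζG_□∇*J‖_α ≤ C_α·e^{−δ₂|y−y′|}·(‖ζ‖_α + |ζ|)·|J|` for every member and every `0 ≤ α < 1`, RATE `α`-FREE AS PRINTED, read from p38 g21's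
`B6Prop25HolderGDivTwoScaleV1.prop25_ineq111_div` (p331063; per direction `λ`, near pairs `t ≤ 1`, `Z_h = ‖ζ‖_α`, `Z₀ = |ζ|`, `X = |J|`, `r = 1`) and
p22's `prop25_ineq110_Gdiv` (the sup values), summed over `λ` (`G_□∇*J = Σ_λ G_□∇_λ*J_λ`, constant `×(d+1)`) and assembled over all same-direction
pairs by the new lemma `cut_quotient_le` (far pairs `t > 1`: `t^α ≥ 1`); **`ineq111_ten_settingTS`** — its reading on `settingTS i` in the PRINTED
quantifier order (one `δ₂` and one constant function `C_α` before the member, all `α < 1`); §14 **`ineq111_TS`** — the (1.111) clause on ALL source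
kinds with the common rate `δ(1−α)` (`vec` §12, `ten` §13, `ten2` is `0`), and **`ineq111_settingTS_upto`** — VERBATIM THE SECOND CONJUNCT OF
`B5.Ineq110_114` ON `settingTS i` for every member, with `α < 1` replaced by `α ≤ α₀` (any `α₀ < 1`; `δ = δ(1−α₀)` and `C_α` chosen before the
member).  HONEST SCOPE: the printed order for the `vec` member (one `δ₂` for all `α < 1`) is NOT reached (GAPS G-B6-p38-01), so the second conjunct of
`B5.Ineq110_114` itself is NOT inhabited and `clauses_settingTS_six` is unchanged; `B6.Prop25Printed (locTS …)` is still NOT inhabited and NOT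
claimed.  In the tree for the genuine two-scale `G_□` now: (2.129); (1.110)₁,₂,₃; (1.111)₁ (rate `δ₂(1−α)`) and (1.111)₂ (rate `δ₂`); (1.114)₁,₂,₃ —
missing (1.110)₄ `|ΔGJ|`, (1.112), (1.113), (1.114)₄₋₆ and the `α`-free rate of (1.111)₁.

v1.4 (APPEND-ONLY, unit `lit-balaban-r03` gen 16; two new imports `B6Prop25HolderRateFreeV1` (r03, p334746) and `B6Prop25Eq112TwoScaleV1` (p38 g22 M3,
p333858)): §15 **`ineq111_vec_TS_rateFree`** — the (1.111)₁ member on the `vec` kind AT THE PRINTED `α`-FREE RATE (one `δ₂(d, L, a₀, a₁)` for all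
`α < 1`), read from r03's `B6Prop25HolderRateFreeV1.prop25_ineq111_grad_rateFree` (the `_rateFree` twin of p38's `prop25_ineq111_grad`: the `∇H_j`
factor through (2.130) = [4] (1.103) and [BalabanImbrieJaffe1985] (7.2.2), r03's `B6HjOneLevelBridgeV1.holderBound_DHj_rateFree` p333936) exactly as
§12 read p38's, assembled by §13's `cut_quotient_le`; **`ineq111_TS_rateFree`** (all source kinds, rate `α`-free) and **`ineq111_settingTS`** = VERBATIM
THE SECOND CONJUNCT OF `B5.Ineq110_114` ON `settingTS i` IN THE PRINTED QUANTIFIER ORDER (one `δ` and one `C_α : ℝ → ℝ` before the member, ALL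
`0 ≤ α < 1`) — the divergence declared in §12/§14 (HOME/GAPS.md G-B6-p38-01) is REMOVED.  §16 **`ineq112_TS`** — the (1.112) member
`e4 (ten J) y = max_μ sup_{Δ̃(y)}|∇_μG_□∇*J| ≤ C_ε·e^{−δ₂|y−y′|}·(‖J‖_ε + |J|)` for every member and every `0 < ε < 1`, RATE `ε`-FREE AS PRINTED, read
from p38 g22's `B6Prop25Eq112TwoScaleV1.prop25_ineq112` (p333858; per pair of directions `(μ, λ)` at `r = 1`, `X = |J|`, `X_ε = ‖J‖_ε` through the new
`abs_sub_le_holderTS_ten`, summed over `λ` — constant `×(d+1)`); **`ineq112_settingTS`** = VERBATIM THE THIRD CONJUNCT OF `B5.Ineq110_114` ON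
`settingTS i` in the printed order.  §17 **`clauses_settingTS_eight`** — the first conjunct at `n ≤ 2`, THE SECOND AND THIRD CONJUNCTS IN FULL, and
the fifth conjunct at `n ≤ 2` of `B5.Ineq110_114 (settingTS i) C C_α C_ε · δ` with ONE `δ > 0`, `C`, `C_α`, `C_ε` chosen before the member.  HONEST
SCOPE: `B5.Ineq110_114 (settingTS i)` itself (hence `B6.Prop25Printed (locTS …)`) is still NOT inhabited and NOT claimed — missing for the genuine
two-scale `G_□`: the first conjunct at `n = 3` ((1.110)₄ `|ΔGJ|`; p22 g16's `B6Prop25LapDecayTwoScaleV1.prop25_ineq110_Lap` filed p334578), the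
fourth conjunct ((1.113); p38 g22 M4–M6 in flight) and the fifth at `n = 3, 4, 5` ((1.114)₄₋₆).  In the tree for the genuine two-scale `G_□` now:
(2.129); (1.110)₁,₂,₃; (1.111) (both members, `α`-free); (1.112); (1.114)₁,₂,₃.

v1.5 (APPEND-ONLY, unit `lit-balaban-r03` gen 16; one new import `B6Prop25LapDecayTwoScaleV1` (p22 g16 F22, p334578)): §18 `eTS_three_vec`/`eTS_three_ten`,
`lapTS_apply` (p22's `Lap_apply` read on `lapTS`), **`ineq110_three_TS`** — the (1.110)₄ member `e 3 (vec J) y = sup_{Δ̃(y)}|ΔG_□J| ≤ C·e^{−δ₂|y−y′|}·|J|` for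
every member, read from p22 g16's `B6Prop25LapDecayTwoScaleV1.prop25_ineq110_Lap` (p334578; `r = 1`, `X = |J|`), and **`ineq110_settingTS`** = VERBATIM THE
FIRST CONJUNCT OF `B5.Ineq110_114` ON `settingTS i` FOR ALL `n : Fin 4` (one `δ`, one `C` before the member).  With §15–§17: the first, second and third
conjuncts of `B5.Ineq110_114 (settingTS i)` are inhabited in full and the fifth at `n ≤ 2`; still missing for the genuine two-scale `G_□`: the fourth
conjunct ((1.113); p38 g22 M4–M6) and the fifth at `n = 3, 4, 5` ((1.114)₄₋₆; p22 g16's `B6L2BlockCalculus` p335258 is the tooling) — hence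
`B5.Ineq110_114 (settingTS i)` / `B6.Prop25Printed (locTS …)` still NOT inhabited, NOT claimed.

v1.6 (APPEND-ONLY, unit `lit-balaban-r03` gen 17; one new import `B6Prop25Eq113TwoScaleV1` (p38 g22 M6 p336032, v1.1 p337449)): §20 `h2TS_ten/vec/ten2`,
`abs_sub_le_holderTS_ten'`, **`ineq113_TS`** — the (1.113) member `h2 (ten J) α ζ = max_μ ‖ζ∇_μG_□∇*J‖_α ≤ C_{αε}·e^{−δ₂|y−y′|}·(‖ζ‖_α + |ζ|)·(‖J‖_{α+ε} + |J|)`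
for every member and every `0 ≤ α`, `0 < ε`, `α + ε < 1`, RATE `α`-FREE AS PRINTED (one `δ₂(d, L, a₀, a₁)` before `∀ α, ε`), read from p38 g22's
`B6Prop25Eq113TwoScaleV1.prop25_ineq113_rateFree` (p337449; per pair of directions `(μ, λ)` at `r = 1`, near pairs `t ≤ 1`, `Z_h = ‖ζ‖_α`, `Z₀ = |ζ|`,
`X = |J|`, `X_θ = ‖J‖_{α+ε}`; the `∇H_j` factors through r03's `B6HjOneLevelBridgeV1.holderBound_DHj_rateFree`) and, for the sup values `|(∇_μG_□∇*J)(b)|`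
on `supp ζ` that the seminorm `hqB` also needs (far pairs), from p38's (1.112) member `prop25_ineq112` at the exponent `α + ε`, summed over `λ` (constant
`×(d+1)`) and assembled by §13's `cut_quotient_le`; **`ineq113_settingTS`** = VERBATIM THE FOURTH CONJUNCT OF `B5.Ineq110_114` ON `settingTS i` IN THE PRINTED
QUANTIFIER ORDER (one `δ` and one `C_{αε} : ℝ → ℝ → ℝ` before the member) — exactly the hypothesis `h4` of §19's `prop25Printed_locTS_of`.  §21 the slots
`l2locTS_three/four/five_*` (definitional) and `G_div2TS_apply`, **`clauses_settingTS_twelve`** (the first four conjuncts in full and the fifth at `n ≤ 2`,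
ONE `δ`), and **`prop25Printed_locTS_of114`** = the assembly edge with ONLY the fifth conjunct at `n = 3, 4, 5` ((1.114)₄₋₆: `(Σ_λ‖ζ∇_λG_□∇*J‖²)^{1/2}`,
`(Σ_{λμ}‖ζ∇_λ∇_μG_□J‖²)^{1/2}`, `‖ζG_□∇*∇*J‖`; p22's two-scale `ℓ²`-block files to come, one-level inputs `B6L2Block114GEV1` p336105) left as a hypothesis.
HONEST SCOPE: `B5.Ineq110_114 (settingTS i)` / `B6.Prop25Printed (locTS …)` are still NOT inhabited and NOT claimed (missing (1.114)₄₋₆ for the genuine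
two-scale `G_□`).  In the tree for the genuine two-scale `G_□` now: (2.129); (1.110)₁₋₄; (1.111)₁,₂ (`α`-free); (1.112); (1.113) (`α`-free); (1.114)₁,₂,₃.

v1.7 (APPEND-ONLY, unit `lit-balaban-r03` gen 17; two new imports `B6Prop25Grad2DecayTwoScaleV1` (p22 g16 F27, p338193) and `B6Prop25GradGDivDecayTwoScaleV1`
(p22 g16 F28b)): §22 `norm_le_l2NormTS_ten2`, `norm_smulB_sq`, `smulB_Dl_G_divTS`, `smulB_G_div2TS`, **`ineq114_three_TS`** (`l2loc 3 (ten J) ζ =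
(Σ_μ‖ζ∇_μG_□∇*J‖²)^{1/2} ≤ C·e^{−δ₂|y−y′|}·|ζ|·‖J‖`, from p22's `prop25_ineq114_gradGdiv` per `(μ, λ)` at `r = 1`, `Z = |ζ|`, square roots, `Σ_λ` with
`‖J_λ‖ ≤ ‖J‖`, `Σ_μ`), **`ineq114_four_TS`** (`l2loc 4 (vec J) ζ = (Σ_{λμ}‖ζ∇_λ∇_μG_□J‖²)^{1/2}`, from `prop25_ineq114_gradgrad` summed over the `(d+1)²` pairs),
**`ineq114_five_TS`** (`l2loc 5 (ten2 J) ζ = ‖ζG_□∇*∇*J‖`, from `prop25_ineq114_GDadjDadj`, triangle inequality over `(λ, μ)`, `‖J_{λμ}‖ ≤ ‖J‖`),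
**`ineq114_settingTS`** = VERBATIM THE FIFTH CONJUNCT OF `B5.Ineq110_114` ON `settingTS i` FOR ALL `n : Fin 6` (one `δ`, one `C` before the member), and
**`prop25Printed_TS : B6.Prop25Printed (fun i => locTS i)`** — PROPOSITION 2.5 ON THE CENSUS CARRIER OF THE GENUINE TWO-SCALE FAMILY: (2.129) for every
member AND `B5.Ineq110_114 (settingTS i) C C_α C_ε C_αε δ₂` — ALL of (1.110)–(1.114) — with ONE `δ₂ > 0`, `C > 0`, `C_α`, `C_ε`, `C_αε` chosen before the
member (by §21's `prop25Printed_locTS_of114` and `ineq114_settingTS`); `ineq110_114_settingTS` (its second conjunct alone) and `prop12Printed_TS :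
B5.Prop12Printed (fun i => settingTS i)` (the DAG edge `B6.prop12Shape_of_prop25`).  HONEST SCOPE: an inhabitation of the census Prop `B6.Prop25Printed`
on the GENUINE TWO-SCALE family (p22's `tsV1`: ONE pair of adjacent scales `j, j+1`, `Λ′ ⊂ T^{(j+1)}` arbitrary, the torus `T_η`, weights in [4]'s window
`a₀(L^j)^{d+1} ≤ w ≤ a₁(L^j)^{d+1}`; constants on `d, L, a₀, a₁` where print says «d and L only» at `a = 1`); every functional of the setting genuine (r02's
source-kind device: each operator on the kind it acts on); cubes `Δ̃(y)` = blocks within sup-distance `1` on `T^{(j)}`; Hölder distances in `T^{(j)}` units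
over all same-direction pairs; `Δ := Σ_λ∇_λ*∇_λ` componentwise.  NOT the k-level `G_□` of a general sequence of domains (one two-scale step only), NOT
the whole-lattice `ξℤ^d` variant, NOT summit progress.
-/

noncomputable section

open scoped InnerProductSpace BigOperators
open Finset

namespace Literature.MathematicalPhysics.QuantumFieldTheory.Balaban1983to89.B6Prop25TwoScaleCensus

open LatticeFieldCalculus B5Eq117TorusCarriers B6SectAOperatorsV1 B6SectCOperators B6SectCTwoScaleV1 B6SectCTwoScaleV1Lattice
open BalabanImbrieJaffe1984to88.BIJ85AxialPropagator411 (BondSpace)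
open B4TorusKernel.MultiPeriod (torusSupNorm torusSupNorm_nonneg)
open B6LowerBound2153Torus (rep)
open B5Eq118OneStroke (iterBlockOf)
open B6Eq2129TwoScaleV1 (eq2129_V1)
open B6Prop25DecayTwoScaleV1 (prop25_ineq110_0)
open B6Prop25GradDecayTwoScaleV1 (prop25_ineq110_grad)
open B6Prop25L2LocTwoScaleV1 (prop25_ineq114_0_sqrt)
open B6Prop25GDivDecayTwoScaleV1 (prop25_ineq110_Gdiv)
open B6Prop25L2LocGradTwoScaleV1 (prop25_ineq114_grad prop25_ineq114_Gdiv)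

/-! ## §0  The index of the genuine two-scale family -/

/-- **the index of the genuine two-scale family of local operators `G_□` of (2.90)**: the torus `T_η` of volume `(m, K)` with `d + 1` dimensions
and block size `L`, the scale `j` (`j + 1 ≤ m + K`, so that the unit lattices `T^{(j)}`, `T^{(j+1)}` exist), the region `Λ′ ⊂ T^{(j+1)}` of the
second averaging (ARBITRARY), and the weights `w` on the constraint index `𝔅 = Λ^c ∪ Λ′` in [4]'s window `a₀(L^j)^{d+1} ≤ w ≤ a₁(L^j)^{d+1}`
— p22's quantifier block of `prop25_ineq110_0` as a structure. [cite: Balaban1984PropagatorsII, (2.89)–(2.90) p.239, Prop. 2.5 p.246] -/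
structure TSIdx (d L : ℕ) (hd : 1 ≤ d + 1) (hL : Odd L ∧ 1 < L) (a₀ a₁ : ℝ) where
  m : ℕ
  K : ℕ
  j : ℕ
  hj : j + 1 ≤ m + K
  Λ' : Finset (Site (⟨d + 1, L, m, K, hd, hL⟩ : Params) (j + 1))
  w : CIdx j Λ' → ℝ
  hw0 : ∀ c, a₀ * ((L : ℝ) ^ j) ^ (d + 1) ≤ w c
  hw1 : ∀ c, w c ≤ a₁ * ((L : ℝ) ^ j) ^ (d + 1)

namespace TSIdx

variable {d L : ℕ} {hd : 1 ≤ d + 1} {hL : Odd L ∧ 1 < L} {a₀ a₁ : ℝ} (i : TSIdx d L hd hL a₀ a₁)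

/-- the torus parameters of the member. [cite: Balaban1984PropagatorsII, (2.89) p.239, dictionary] -/
abbrev P : Params := ⟨d + 1, L, i.m, i.K, hd, hL⟩

/-- the fine lattice factor `c = L^j ≠ 0`. [cite: Balaban1984PropagatorsII, (2.104) p.241, dictionary] -/
theorem hc : ((L : ℝ) ^ i.j) ≠ 0 :=
  pow_ne_zero _ (Nat.cast_ne_zero.2 (by have := hL.2; omega))

/-- `j + 1 ≤ m + K` read on `P i`. [cite: Balaban1984PropagatorsII, (2.89) p.239, dictionary] -/
theorem hjP : i.j + 1 ≤ i.P.m + i.P.K := i.hj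

/-- **the concrete two-scale data of the member** (p22's `tsV1`: `Δ`, `∂`, `∂*`, `Q′_j`, `ω`, `H′_j`, `Q_j`, `∂₁`, the axial `B`, `Q″`, `a = diag w`).
[cite: Balaban1984PropagatorsII, (2.90) p.239, (2.95)–(2.104) pp.240–241] -/
def D : TwoScaleData (BondSpace i.P) (ScalarSpace i.P) (USite i.P i.j) (BalabanImbrieJaffe1984to88.BIJ85AxialPropagator411.PlaqSpace i.P)
    (UBond i.P i.j) (CSpace i.j i.Λ') :=
  tsV1 (P := i.P) i.hc i.Λ' i.w

/-- the weights are positive when `a₀ > 0`. [cite: Balaban1984PropagatorsII, (2.94) p.239] -/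
theorem w_pos (ha₀ : 0 < a₀) (c : CIdx i.j i.Λ') : 0 < i.w c :=
  lt_of_lt_of_le (mul_pos ha₀ (pow_pos (pow_pos (Nat.cast_pos.2 (by have := hL.2; omega)) _) _)) (i.hw0 c)

/-! ## §1  Geometry: unit sites, torus distance, blocks, fine distances -/

/-- the unit-lattice torus distance `|y − y′|_T` on `T^{(j)}` (sup norm; p22's). [cite: Balaban1984PropagatorsI, Prop. 1.2 p.35 («e^{−δ₀|y−y′|}»), dictionary] -/
def tdist (y y' : Site i.P i.j) : ℝ := torusSupNorm (Mk i.P i.j) (rep (Mk i.P i.j) y - rep (Mk i.P i.j) y')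

/-- the `j`-block `y(x) ∈ T^{(j)}` of a fine site `x ∈ T^{(0)}`. [cite: Balaban1984PropagatorsI, (1.18) p.20, dictionary] -/
def blk (x : Site i.P 0) : Site i.P i.j := iterBlockOf i.j x

/-- `x ∈ Δ̃(y)`: the block of `x` is within sup-distance `1` of `y` (the `3^{d+1}` blocks around `B(y)`). [cite: Balaban1984PropagatorsI, Prop. 1.2 p.35 («x ∈ Δ̃(y)»), dictionary] -/
def InCube (y : Site i.P i.j) (x : Site i.P 0) : Prop := i.tdist (i.blk x) y ≤ 1

/-- the fine distance in `T^{(j)}` units: `|x − x′|_{T^{(0)}}/L^j` (the `ξ`-lattice of `T_□` has spacing `L^{−j}` relative to `T^{(j)}`).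
[cite: Balaban1984PropagatorsI, (1.109) p.35 (Hölder norms), dictionary] -/
def fdist (x x' : Site i.P 0) : ℝ := torusSupNorm (Mk i.P 0) (rep (Mk i.P 0) x - rep (Mk i.P 0) x') / (L : ℝ) ^ i.j

/-! ## §2  Sources, norms, cut-offs -/

/-- **the three source kinds of (1.89)/(1.110)–(1.114)** (as r02's `LocR`): a fine bond field `J` (for `GJ`, `∇GJ`, `ΔGJ`, `∇∇GJ`), a family
`(J_λ)_λ` of bond fields (for `G∇*J = Σ_λ G∇_λ*J_λ`, `∇G∇*J`), a family `(J_{λμ})` (for `G∇*∇*J`). [cite: Balaban1984PropagatorsI, Prop. 1.2 (1.110)–(1.114) pp.35–36] -/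
inductive LocTS : Type
  | vec (J : BondSpace i.P)
  | ten (J : Fin i.P.d → BondSpace i.P)
  | ten2 (J : Fin i.P.d → Fin i.P.d → BondSpace i.P)

/-- `supp J ⊂ Δ̃(y′)`: every component bond of the source starts in `Δ̃(y′)`. [cite: Balaban1984PropagatorsI, Prop. 1.2 p.35 («supp J ⊂ Δ̃(y′)»)] -/
def suppInTS : i.LocTS → Site i.P i.j → Prop
  | .vec J, y' => ∀ b, J b ≠ 0 → i.InCube y' b.src
  | .ten J, y' => ∀ lam b, J lam b ≠ 0 → i.InCube y' b.src
  | .ten2 J, y' => ∀ lam mu b, J lam mu b ≠ 0 → i.InCube y' b.src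

/-- `|J|` = the sup over bonds (and components) of `|J|`. [cite: Balaban1984PropagatorsI, (1.108) p.35] -/
def supNormTS : i.LocTS → ℝ
  | .vec J => LatticeNorms.supNorm univ (fun b : PBond i.P 0 => J b)
  | .ten J => LatticeNorms.supNorm univ (fun p : Fin i.P.d × PBond i.P 0 => J p.1 p.2)
  | .ten2 J => LatticeNorms.supNorm univ (fun p : Fin i.P.d × Fin i.P.d × PBond i.P 0 => J p.1 p.2.1 p.2.2)

/-- `‖J‖` = the `ℓ²` norm (sum of the component norms squared). [cite: Balaban1984PropagatorsI, (1.21) p.21, (1.114) p.36] -/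
def l2NormTS : i.LocTS → ℝ
  | .vec J => ‖J‖
  | .ten J => Real.sqrt (∑ lam, ‖J lam‖ ^ 2)
  | .ten2 J => Real.sqrt (∑ lam, ∑ mu, ‖J lam mu‖ ^ 2)

open Classical in
/-- the Hölder seminorm `sup_{b ≠ b′, same direction} |f(b′) − f(b)|/|b₋′ − b₋|^ε` of a fine bond field, distances in `T^{(j)}` units.
[cite: Balaban1984PropagatorsI, (1.109) p.35] -/
def hqB (ε : ℝ) (f : BondSpace i.P) : ℝ :=
  LatticeNorms.supNorm (univ.filter fun p : PBond i.P 0 × PBond i.P 0 => p.1.src ≠ p.2.src ∧ p.1.dir = p.2.dir)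
    (fun p => (f p.2 - f p.1) / i.fdist p.1.src p.2.src ^ ε)

/-- `‖J‖_ε` for the three source kinds (max over components). [cite: Balaban1984PropagatorsI, (1.109) p.35, (1.112) p.36] -/
def holderTS (ε : ℝ) : i.LocTS → ℝ
  | .vec J => i.hqB ε J
  | .ten J => LatticeNorms.supNorm univ (fun lam => i.hqB ε (J lam))
  | .ten2 J => LatticeNorms.supNorm univ (fun p : Fin i.P.d × Fin i.P.d => i.hqB ε (J p.1 p.2))

/-- `supp ζ ⊂ Δ̃(y)` for a fine cut-off `ζ`. [cite: Balaban1984PropagatorsI, Prop. 1.2 (1.111) p.35 («ζ ∈ C₀^∞(Δ̃(y))»)] -/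
def cutInTS (ζ : Site i.P 0 → ℝ) (y : Site i.P i.j) : Prop := ∀ x, ζ x ≠ 0 → i.InCube y x

open Classical in
/-- `‖ζ‖_α` = the Hölder seminorm of the cut-off (distances in `T^{(j)}` units). [cite: Balaban1984PropagatorsI, Prop. 1.2 (1.111) p.35 («‖ζ‖_α»)] -/
def hqS (α : ℝ) (ζ : Site i.P 0 → ℝ) : ℝ :=
  LatticeNorms.supNorm (univ.filter fun p : Site i.P 0 × Site i.P 0 => p.1 ≠ p.2) (fun p => (ζ p.2 - ζ p.1) / i.fdist p.1 p.2 ^ α)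

/-- `|ζ|`. [cite: Balaban1984PropagatorsI, Prop. 1.2 (1.114) p.36 («|ζ|»)] -/
def cutSupTS (ζ : Site i.P 0 → ℝ) : ℝ := LatticeNorms.supNorm univ ζ

/-! ## §3  The difference operators on fine bond fields (p22's `∇_λ`, `∇_λ*`) -/

/-- **`∇_λ = L^j(S_λ − I)`** on fine bond fields (p22's `Dop`, [4] (1.4) with `η⁻¹ = L^j`). [cite: Balaban1984PropagatorsI, (1.4) p.18] -/
def Dl (lam : Fin i.P.d) : BondSpace i.P →ₗ[ℝ] BondSpace i.P :=
  ((L : ℝ) ^ i.j) • (onE (LinearMap.funLeft ℝ ℝ (fun b : PBond i.P 0 => (⟨b.src.shift lam, b.dir⟩ : PBond i.P 0))) - LinearMap.id)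

/-- **`∇_λ* = L^j(S_λ⁻¹ − I)`**, the `ℓ²`-adjoint of `∇_λ` (p22's `adjoint_Dop`). [cite: Balaban1984PropagatorsI, (1.89) p.33 («G∇*J»), (1.4) p.18] -/
def Dla (lam : Fin i.P.d) : BondSpace i.P →ₗ[ℝ] BondSpace i.P :=
  ((L : ℝ) ^ i.j) • (onE (LinearMap.funLeft ℝ ℝ (fun b : PBond i.P 0 => (⟨b.src.unshift lam, b.dir⟩ : PBond i.P 0))) - LinearMap.id)

/-- `∇*J = Σ_λ ∇_λ*J_λ` for a family source. [cite: Balaban1984PropagatorsI, (1.89) p.33 («G∇*J»)] -/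
def divTS (J : Fin i.P.d → BondSpace i.P) : BondSpace i.P := ∑ lam, i.Dla lam (J lam)

/-- `∇*∇*J = Σ_{λ,μ} ∇_λ*∇_μ*J_{λμ}`. [cite: Balaban1984PropagatorsI, (1.89) p.33 («G∇*∇*J»)] -/
def div2TS (J : Fin i.P.d → Fin i.P.d → BondSpace i.P) : BondSpace i.P := ∑ lam, ∑ mu, i.Dla lam (i.Dla mu (J lam mu))

/-- `Δ := Σ_λ ∇_λ*∇_λ` componentwise on bond fields (print's `−Δ`; all functionals below take absolute values).
[cite: Balaban1984PropagatorsI, Prop. 1.2 (1.110) p.35 («|(ΔGJ)(x)|»)] -/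
def lapTS : BondSpace i.P →ₗ[ℝ] BondSpace i.P := ∑ lam, i.Dla lam ∘ₗ i.Dl lam

/-- the operator `G_□` of the member. [cite: Balaban1984PropagatorsII, (2.90) p.239] -/
def G : BondSpace i.P →ₗ[ℝ] BondSpace i.P := i.D.G

/-! ## §4  The functionals of (1.110)–(1.114) and (1.89)–(1.90) for `G_□` -/

open Classical in
/-- the cube-sup `sup_{b : b₋ ∈ Δ̃(y)} |A(b)|` of a bond field. [cite: Balaban1984PropagatorsI, Prop. 1.2 (1.110) p.35 («x ∈ Δ̃(y)»)] -/
def cubeSup (y : Site i.P i.j) (A : BondSpace i.P) : ℝ :=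
  LatticeNorms.supNorm (univ.filter fun b : PBond i.P 0 => i.InCube y b.src) (fun b => A b)

/-- **(1.110)**: `m = 0, 1, 2, 3 ↔ sup_{Δ̃(y)}` of `|GJ|`, `max_λ|∇_λGJ|`, `|G∇*J|`, `|ΔGJ|` — the first, second, fourth on the `vec` kind, the third
on the `ten` kind; `0` on the other kinds (r02's device). [cite: Balaban1984PropagatorsI, Prop. 1.2 (1.110) p.35; Balaban1984PropagatorsII, Prop. 2.5 p.246] -/
def eTS (n : Fin 4) : i.LocTS → Site i.P i.j → ℝ
  | .vec J, y => (![i.cubeSup y (i.G J), LatticeNorms.supNorm univ (fun lam => i.cubeSup y (i.Dl lam (i.G J))), 0,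
      i.cubeSup y (i.lapTS (i.G J))] : Fin 4 → ℝ) n
  | .ten J, y => (![0, 0, i.cubeSup y (i.G (i.divTS J)), 0] : Fin 4 → ℝ) n
  | .ten2 _, _ => 0

/-- the cut-off multiplication `(ζA)(b) = ζ(b₋)A(b)`. [cite: Balaban1984PropagatorsI, Prop. 1.2 (1.111) p.35 («ζ∇GJ»)] -/
def smulB (ζ : Site i.P 0 → ℝ) (A : BondSpace i.P) : BondSpace i.P :=
  WithLp.toLp 2 fun b : PBond i.P 0 => ζ b.src * A b

/-- **(1.111)**: `max_λ ‖ζ∇_λGJ‖_α` (`vec` kind) and `‖ζG∇*J‖_α` (`ten` kind). [cite: Balaban1984PropagatorsI, Prop. 1.2 (1.111) p.35; Balaban1984PropagatorsII, Prop. 2.5 p.246] -/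
def h1TS : i.LocTS → ℝ → (Site i.P 0 → ℝ) → ℝ
  | .vec J, α, ζ => LatticeNorms.supNorm univ (fun lam => i.hqB α (i.smulB ζ (i.Dl lam (i.G J))))
  | .ten J, α, ζ => i.hqB α (i.smulB ζ (i.G (i.divTS J)))
  | .ten2 _, _, _ => 0

/-- **(1.112)**: `max_λ sup_{Δ̃(y)} |∇_λG∇*J|` (`ten` kind). [cite: Balaban1984PropagatorsI, Prop. 1.2 (1.112) p.36; Balaban1984PropagatorsII, Prop. 2.5 p.246] -/
def e4TS : i.LocTS → Site i.P i.j → ℝ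
  | .ten J, y => LatticeNorms.supNorm univ (fun lam => i.cubeSup y (i.Dl lam (i.G (i.divTS J))))
  | .vec _, _ => 0
  | .ten2 _, _ => 0

/-- **(1.113)**: `max_λ ‖ζ∇_λG∇*J‖_α` (`ten` kind). [cite: Balaban1984PropagatorsI, Prop. 1.2 (1.113) p.36; Balaban1984PropagatorsII, Prop. 2.5 p.246] -/
def h2TS : i.LocTS → ℝ → (Site i.P 0 → ℝ) → ℝ
  | .ten J, α, ζ => LatticeNorms.supNorm univ (fun lam => i.hqB α (i.smulB ζ (i.Dl lam (i.G (i.divTS J)))))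
  | .vec _, _, _ => 0
  | .ten2 _, _, _ => 0

/-- **(1.114)**: the six cut `ℓ²` norms `‖ζGJ‖`, `(Σ_λ‖ζ∇_λGJ‖²)^{1/2}`, `‖ζG∇*J‖`, `(Σ_λ‖ζ∇_λG∇*J‖²)^{1/2}`, `(Σ_{λμ}‖ζ∇_λ∇_μGJ‖²)^{1/2}`, `‖ζG∇*∇*J‖`, each on
the kind its operator acts on. [cite: Balaban1984PropagatorsI, Prop. 1.2 (1.114) p.36; Balaban1984PropagatorsII, Prop. 2.5 p.246] -/
def l2locTS (n : Fin 6) : i.LocTS → (Site i.P 0 → ℝ) → ℝ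
  | .vec J, ζ => (![‖i.smulB ζ (i.G J)‖, Real.sqrt (∑ lam, ‖i.smulB ζ (i.Dl lam (i.G J))‖ ^ 2), 0, 0,
      Real.sqrt (∑ lam, ∑ mu, ‖i.smulB ζ (i.Dl lam (i.Dl mu (i.G J)))‖ ^ 2), 0] : Fin 6 → ℝ) n
  | .ten J, ζ => (![0, 0, ‖i.smulB ζ (i.G (i.divTS J))‖, Real.sqrt (∑ lam, ‖i.smulB ζ (i.Dl lam (i.G (i.divTS J)))‖ ^ 2), 0, 0] :
      Fin 6 → ℝ) n
  | .ten2 J, ζ => (![0, 0, 0, 0, 0, ‖i.smulB ζ (i.G (i.div2TS J))‖] : Fin 6 → ℝ) n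

/-- **(1.89)**: the six global `ℓ²` norms `‖GJ‖`, `(Σ‖∇_λGJ‖²)^{1/2}`, `‖G∇*J‖`, `(Σ‖∇_λG∇*J‖²)^{1/2}`, `(Σ‖∇_λ∇_μGJ‖²)^{1/2}`, `‖G∇*∇*J‖` (the (1.114)
functionals at `ζ ≡ 1`). [cite: Balaban1984PropagatorsI, Prop. 1.1 (1.89) p.33] -/
def l2opTS (n : Fin 6) (J : i.LocTS) : ℝ := i.l2locTS n J (fun _ => 1)

/-- **THE CENSUS SETTING OF THE MEMBER** in [4]'s record `B5.Setting`: every functional of (1.89)–(1.90) and (1.110)–(1.114) for `G_□ = (D i).G`.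
[cite: Balaban1984PropagatorsII, Prop. 2.5 p.246; Balaban1984PropagatorsI, Prop. 1.2 (1.110)–(1.114) pp.35–36] -/
def settingTS : B5.Setting where
  Site := Site i.P i.j
  dist := i.tdist
  k := i.j
  Loc := i.LocTS
  suppIn := i.suppInTS
  supNorm := i.supNormTS
  l2Norm := i.l2NormTS
  holder := i.holderTS
  Cut := Site i.P 0 → ℝ
  cutIn := i.cutInTS
  cutH := fun α ζ => i.hqS α ζ + i.cutSupTS ζ
  cutSup := i.cutSupTS
  l2op := i.l2opTS
  e := i.eTS
  h1 := i.h1TS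
  e4 := i.e4TS
  h2 := i.h2TS
  l2loc := i.l2locTS
  Vec := BondSpace i.P
  formΔa := fun A => ⟪A, i.D.deltaA A⟫_ℝ
  formΔI := fun A => ⟪A, i.D.lapV A + A⟫_ℝ

/-- **THE MEMBER AS A `B6.LocalOp`**: its census setting and the representation (2.129) for ITS data `D i` (statement verbatim the field of
`B6Prop25OneLevelV1.loc`, now with `Λ′` arbitrary). [cite: Balaban1984PropagatorsII, Prop. 2.5 p.246, (2.129) p.246] -/
def locTS : B6.LocalOp where
  S := i.settingTS
  Repr2129 := ∀ J : BondSpace i.P,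
    ⟪J, i.D.G J⟫_ℝ = ⟪J, i.D.K1 J⟫_ℝ +
      ⟪J - i.D.K2 J, (i.D.Gt + i.D.Hj ∘ₗ i.D.Ct ∘ₗ LinearMap.adjoint i.D.Hj) (J - i.D.K2 J)⟫_ℝ

/-! ## §5  The first conjunct of Prop. 2.5: (2.129) for every member -/

-- `maxRecDepth`: matching the field against p22's `eq2129_V1` unfolds the (large) structure term `tsV1 …` behind `D`.
set_option maxRecDepth 65536 in
/-- **(2.129) HOLDS FOR EVERY MEMBER OF THE GENUINE TWO-SCALE FAMILY** (p22's `eq2129_V1`: any `Λ′`, positive weights).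
[cite: Balaban1984PropagatorsII, (2.129) p.246, Prop. 2.5 p.246] -/
theorem repr2129_TS (ha₀ : 0 < a₀) : (i.locTS).Repr2129 := by
  intro J
  exact eq2129_V1 i.hc i.hjP i.Λ' (i.w_pos ha₀) J

/-- **the first conjunct of `B6.Prop25Printed` for the family.** [cite: Balaban1984PropagatorsII, Prop. 2.5 p.246] -/
theorem prop25_first_TS (ha₀ : 0 < a₀) : ∀ i : TSIdx d L hd hL a₀ a₁, (locTS i).Repr2129 :=
  fun i => repr2129_TS i ha₀

/-! ## §6  Unfolding lemmas -/

/-- `(∇_λA)(b) = L^j·(A(b + e_λ) − A(b))`. [cite: Balaban1984PropagatorsI, (1.4) p.18] -/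
theorem Dl_apply (lam : Fin i.P.d) (A : BondSpace i.P) (b : PBond i.P 0) :
    i.Dl lam A b = ((L : ℝ) ^ i.j) * (A ⟨b.src.shift lam, b.dir⟩ - A b) := by
  unfold Dl
  rw [LinearMap.smul_apply, LinearMap.sub_apply, LinearMap.id_apply, PiLp.smul_apply, PiLp.sub_apply, smul_eq_mul]
  rfl

/-- `(∇_λ*A)(b) = L^j·(A(b − e_λ) − A(b))`. [cite: Balaban1984PropagatorsI, (1.4) p.18, (1.89) p.33] -/
theorem Dla_apply (lam : Fin i.P.d) (A : BondSpace i.P) (b : PBond i.P 0) :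
    i.Dla lam A b = ((L : ℝ) ^ i.j) * (A ⟨b.src.unshift lam, b.dir⟩ - A b) := by
  unfold Dla
  rw [LinearMap.smul_apply, LinearMap.sub_apply, LinearMap.id_apply, PiLp.smul_apply, PiLp.sub_apply, smul_eq_mul]
  rfl

/-- `(ζA)(b) = ζ(b₋)A(b)`. [cite: Balaban1984PropagatorsI, Prop. 1.2 (1.111) p.35, dictionary] -/
@[simp] theorem smulB_apply (ζ : Site i.P 0 → ℝ) (A : BondSpace i.P) (b : PBond i.P 0) : i.smulB ζ A b = ζ b.src * A b := rfl

/-- `‖ζA‖ = (Σ_b (ζ(b₋)A(b))²)^{1/2}`. [cite: Balaban1984PropagatorsI, (1.114) p.36, dictionary] -/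
theorem norm_smulB (ζ : Site i.P 0 → ℝ) (A : BondSpace i.P) :
    ‖i.smulB ζ A‖ = Real.sqrt (∑ b : PBond i.P 0, (ζ b.src * A b) ^ 2) := by
  rw [← Real.sqrt_sq (norm_nonneg _), B5WalkCarrierTorus.normSq_eq]
  rfl

/-- `|J(b)| ≤ |J|` for a bond-field source. [cite: Balaban1984PropagatorsI, (1.108) p.35] -/
theorem abs_le_supNormTS_vec (J : BondSpace i.P) (b : PBond i.P 0) : |J b| ≤ i.supNormTS (.vec J) := by
  have h := LatticeNorms.norm_le_supNorm (fun b : PBond i.P 0 => J b) (Finset.mem_univ b)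
  rwa [Real.norm_eq_abs] at h

/-- `|ζ(x)| ≤ |ζ|`. [cite: Balaban1984PropagatorsI, (1.114) p.36 («|ζ|»)] -/
theorem abs_le_cutSupTS (ζ : Site i.P 0 → ℝ) (x : Site i.P 0) : |ζ x| ≤ i.cutSupTS ζ := by
  have h := LatticeNorms.norm_le_supNorm ζ (Finset.mem_univ x)
  rwa [Real.norm_eq_abs] at h

/-- `0 ≤ |J|`. [cite: Balaban1984PropagatorsI, (1.108) p.35] -/
theorem supNormTS_nonneg (J : i.LocTS) : 0 ≤ i.supNormTS J := by
  cases J <;> exact LatticeNorms.supNorm_nonneg _ _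

/-- `0 ≤ |ζ|`. [cite: Balaban1984PropagatorsI, (1.114) p.36] -/
theorem cutSupTS_nonneg (ζ : Site i.P 0 → ℝ) : 0 ≤ i.cutSupTS ζ := LatticeNorms.supNorm_nonneg _ _

/-- `0 ≤ ‖J‖`. [cite: Balaban1984PropagatorsI, (1.21) p.21] -/
theorem l2NormTS_nonneg (J : i.LocTS) : 0 ≤ i.l2NormTS J := by
  cases J
  · exact norm_nonneg _
  · exact Real.sqrt_nonneg _
  · exact Real.sqrt_nonneg _

/-- `0 ≤ |y − y′|_T`. [cite: Balaban1984PropagatorsI, Prop. 1.2 p.35, dictionary] -/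
theorem tdist_nonneg (y y' : Site i.P i.j) : 0 ≤ i.tdist y y' :=
  torusSupNorm_nonneg (fun μ => le_trans (by norm_num) (BalabanImbrieJaffe1984to88.BIJ85Prop12BridgeGeometry.two_le_Mk i.P i.j μ)) _

/-- the (1.110) entries on the `vec` kind (definitional). [cite: Balaban1984PropagatorsI, Prop. 1.2 (1.110) p.35, dictionary] -/
@[simp] theorem eTS_zero_vec (J : BondSpace i.P) (y : Site i.P i.j) : i.eTS 0 (.vec J) y = i.cubeSup y (i.G J) := rfl
/-- the (1.110) entries on the `vec` kind (definitional). [cite: Balaban1984PropagatorsI, Prop. 1.2 (1.110) p.35, dictionary] -/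
@[simp] theorem eTS_one_vec (J : BondSpace i.P) (y : Site i.P i.j) :
    i.eTS 1 (.vec J) y = LatticeNorms.supNorm univ (fun lam => i.cubeSup y (i.Dl lam (i.G J))) := rfl
/-- the (1.110) entries on the `ten`/`ten2` kinds at `m = 0, 1` vanish (source-kind device). [cite: Balaban1984PropagatorsI, Prop. 1.2 (1.110) p.35, dictionary] -/
@[simp] theorem eTS_zero_ten (J : Fin i.P.d → BondSpace i.P) (y : Site i.P i.j) : i.eTS 0 (.ten J) y = 0 := rfl
/-- idem. [cite: Balaban1984PropagatorsI, Prop. 1.2 (1.110) p.35, dictionary] -/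
@[simp] theorem eTS_one_ten (J : Fin i.P.d → BondSpace i.P) (y : Site i.P i.j) : i.eTS 1 (.ten J) y = 0 := rfl
/-- idem. [cite: Balaban1984PropagatorsI, Prop. 1.2 (1.110) p.35, dictionary] -/
@[simp] theorem eTS_ten2 (n : Fin 4) (J : Fin i.P.d → Fin i.P.d → BondSpace i.P) (y : Site i.P i.j) : i.eTS n (.ten2 J) y = 0 := rfl
/-- the (1.114)₁ entry on the `vec` kind (definitional). [cite: Balaban1984PropagatorsI, Prop. 1.2 (1.114) p.36, dictionary] -/
@[simp] theorem l2locTS_zero_vec (J : BondSpace i.P) (ζ : Site i.P 0 → ℝ) : i.l2locTS 0 (.vec J) ζ = ‖i.smulB ζ (i.G J)‖ := rfl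
/-- idem, `ten`/`ten2` kinds. [cite: Balaban1984PropagatorsI, Prop. 1.2 (1.114) p.36, dictionary] -/
@[simp] theorem l2locTS_zero_ten (J : Fin i.P.d → BondSpace i.P) (ζ : Site i.P 0 → ℝ) : i.l2locTS 0 (.ten J) ζ = 0 := rfl
/-- idem. [cite: Balaban1984PropagatorsI, Prop. 1.2 (1.114) p.36, dictionary] -/
@[simp] theorem l2locTS_zero_ten2 (J : Fin i.P.d → Fin i.P.d → BondSpace i.P) (ζ : Site i.P 0 → ℝ) : i.l2locTS 0 (.ten2 J) ζ = 0 := rfl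

end TSIdx

/-! ## §7  The clauses of `B5.Ineq110_114` landed so far, with constants chosen before the member -/

section Clauses

variable {d L : ℕ} {hd : 1 ≤ d + 1} {hL : Odd L ∧ 1 < L} {a₀ a₁ : ℝ}

open TSIdx

/-- **THE (1.110)₁ CLAUSE FOR THE GENUINE TWO-SCALE FAMILY**: there are `δ₂ > 0`, `C ≥ 0` (on `d, L, a₀, a₁`) such that for EVERY member, every
source `J` with `supp J ⊂ Δ̃(y′)` and every `y`, `e 0 J y = sup_{Δ̃(y)}|G_□J| ≤ C·e^{−δ₂|y−y′|}·|J|` — p22's `prop25_ineq110_0` at `r = 1`, `X = |J|`.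
[cite: Balaban1984PropagatorsII, Prop. 2.5 p.246; Balaban1984PropagatorsI, Prop. 1.2 (1.110) p.35] -/
theorem ineq110_zero_TS (ha₀ : 0 < a₀) (ha₁ : a₀ ≤ a₁) :
    ∃ δ : ℝ, 0 < δ ∧ ∃ C : ℝ, 0 ≤ C ∧ ∀ (i : TSIdx d L hd hL a₀ a₁) (J : i.LocTS) (y y' : Site i.P i.j),
      i.suppInTS J y' → i.eTS 0 J y ≤ C * Real.exp (-(δ * i.tdist y y')) * i.supNormTS J := by
  classical
  obtain ⟨δ, hδ, C, hC, h⟩ := prop25_ineq110_0 d L hd hL ha₀ ha₁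
  refine ⟨δ, hδ, C * Real.exp ((1 + 2 * δ) * 1), by positivity, ?_⟩
  intro i J y y' hsupp
  have hRHS : 0 ≤ C * Real.exp ((1 + 2 * δ) * 1) * Real.exp (-(δ * i.tdist y y')) * i.supNormTS J :=
    mul_nonneg (by positivity) (i.supNormTS_nonneg J)
  cases J with
  | vec J =>
    rw [eTS_zero_vec]
    refine LatticeNorms.supNorm_le hRHS fun b hb => ?_
    rw [Finset.mem_filter] at hb
    rw [Real.norm_eq_abs]
    have hb' := h i.m i.K i.j i.hc i.hj i.Λ' i.w i.hw0 i.hw1 1 zero_le_one J (i.supNormTS (.vec J)) (i.supNormTS_nonneg _) y y'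
      hsupp (fun b' => i.abs_le_supNormTS_vec J b') b hb.2
    calc |i.G J b| = |(tsV1 i.hc i.Λ' i.w).G J b| := rfl
      _ ≤ _ := hb'
      _ = C * Real.exp ((1 + 2 * δ) * 1) * Real.exp (-(δ * i.tdist y y')) * i.supNormTS (.vec J) := rfl
  | ten J => rw [eTS_zero_ten]; exact hRHS
  | ten2 J => rw [eTS_ten2]; exact hRHS

/-- **THE (1.110)₂ CLAUSE FOR THE GENUINE TWO-SCALE FAMILY**: `e 1 J y = max_λ sup_{Δ̃(y)}|∇_λG_□J| ≤ C·e^{−δ₂|y−y′|}·|J|` for `supp J ⊂ Δ̃(y′)` —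
p22's `prop25_ineq110_grad` at `r = 1`. [cite: Balaban1984PropagatorsII, Prop. 2.5 p.246; Balaban1984PropagatorsI, Prop. 1.2 (1.110) p.35] -/
theorem ineq110_one_TS (ha₀ : 0 < a₀) (ha₁ : a₀ ≤ a₁) :
    ∃ δ : ℝ, 0 < δ ∧ ∃ C : ℝ, 0 ≤ C ∧ ∀ (i : TSIdx d L hd hL a₀ a₁) (J : i.LocTS) (y y' : Site i.P i.j),
      i.suppInTS J y' → i.eTS 1 J y ≤ C * Real.exp (-(δ * i.tdist y y')) * i.supNormTS J := by
  classical
  obtain ⟨δ, hδ, C, hC, h⟩ := prop25_ineq110_grad d L hd hL ha₀ ha₁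
  refine ⟨δ, hδ, C * Real.exp ((1 + 2 * δ) * 1), by positivity, ?_⟩
  intro i J y y' hsupp
  have hRHS : 0 ≤ C * Real.exp ((1 + 2 * δ) * 1) * Real.exp (-(δ * i.tdist y y')) * i.supNormTS J :=
    mul_nonneg (by positivity) (i.supNormTS_nonneg J)
  cases J with
  | vec J =>
    rw [eTS_one_vec]
    refine LatticeNorms.supNorm_le hRHS fun lam _ => ?_
    rw [Real.norm_eq_abs, abs_of_nonneg (show 0 ≤ i.cubeSup y (i.Dl lam (i.G J)) from LatticeNorms.supNorm_nonneg _ _)]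
    refine LatticeNorms.supNorm_le hRHS fun b hb => ?_
    rw [Finset.mem_filter] at hb
    rw [Real.norm_eq_abs, Dl_apply]
    have hb' := h i.m i.K i.j i.hc i.hj i.Λ' i.w i.hw0 i.hw1 lam 1 zero_le_one J (i.supNormTS (.vec J)) (i.supNormTS_nonneg _) y y'
      hsupp (fun b' => i.abs_le_supNormTS_vec J b') b hb.2
    calc |((L : ℝ) ^ i.j) * (i.G J ⟨b.src.shift lam, b.dir⟩ - i.G J b)|
        = |((L : ℝ) ^ i.j) * ((tsV1 i.hc i.Λ' i.w).G J ⟨b.src.shift lam, b.dir⟩ - (tsV1 i.hc i.Λ' i.w).G J b)| := rfl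
      _ ≤ _ := hb'
      _ = C * Real.exp ((1 + 2 * δ) * 1) * Real.exp (-(δ * i.tdist y y')) * i.supNormTS (.vec J) := rfl
  | ten J => rw [eTS_one_ten]; exact hRHS
  | ten2 J => rw [eTS_ten2]; exact hRHS

/-- **THE (1.114)₁ CLAUSE FOR THE GENUINE TWO-SCALE FAMILY**: `‖ζG_□J‖ ≤ C·e^{−δ₂|y−y′|}·|ζ|·‖J‖` for `supp ζ ⊂ Δ̃(y)`, `supp J ⊂ Δ̃(y′)` —
p22's `prop25_ineq114_0_sqrt` (block Schur test) at `r = 1`, `Z = |ζ|`. [cite: Balaban1984PropagatorsII, Prop. 2.5 p.246; Balaban1984PropagatorsI, Prop. 1.2 (1.114) p.36] -/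
theorem ineq114_zero_TS (ha₀ : 0 < a₀) (ha₁ : a₀ ≤ a₁) :
    ∃ δ : ℝ, 0 < δ ∧ ∃ C : ℝ, 0 ≤ C ∧ ∀ (i : TSIdx d L hd hL a₀ a₁) (J : i.LocTS) (ζ : Site i.P 0 → ℝ) (y y' : Site i.P i.j),
      i.cutInTS ζ y → i.suppInTS J y' → i.l2locTS 0 J ζ ≤ C * Real.exp (-(δ * i.tdist y y')) * i.cutSupTS ζ * i.l2NormTS J := by
  classical
  obtain ⟨δ, hδ, C, hC, h⟩ := prop25_ineq114_0_sqrt d L hd hL ha₀ ha₁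
  refine ⟨δ, hδ, C * Real.exp ((1 + 2 * δ) * 1), by positivity, ?_⟩
  intro i J ζ y y' hζ hsupp
  have hRHS : 0 ≤ C * Real.exp ((1 + 2 * δ) * 1) * Real.exp (-(δ * i.tdist y y')) * i.cutSupTS ζ * i.l2NormTS J :=
    mul_nonneg (mul_nonneg (by positivity) (i.cutSupTS_nonneg ζ)) (i.l2NormTS_nonneg J)
  cases J with
  | vec J =>
    rw [l2locTS_zero_vec, norm_smulB]
    have h1 := h i.m i.K i.j i.hc i.hj i.Λ' i.w i.hw0 i.hw1 1 zero_le_one J ζ (i.cutSupTS ζ) (i.cutSupTS_nonneg ζ) y y'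
      hsupp hζ (fun x => i.abs_le_cutSupTS ζ x)
    calc Real.sqrt (∑ b : PBond i.P 0, (ζ b.src * i.G J b) ^ 2)
        = Real.sqrt (∑ b : PBond i.P 0, (ζ b.src * (tsV1 i.hc i.Λ' i.w).G J b) ^ 2) := rfl
      _ ≤ _ := h1
      _ = C * Real.exp ((1 + 2 * δ) * 1) * Real.exp (-(δ * i.tdist y y')) * i.cutSupTS ζ * i.l2NormTS (.vec J) := rfl
  | ten J => rw [l2locTS_zero_ten]; exact hRHS
  | ten2 J => rw [l2locTS_zero_ten2]; exact hRHS

/-- **the three clauses read on the census setting** (the shapes of `B5.Ineq110_114`'s first and fifth conjuncts at `n = 0, 1` resp. `n = 0`).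
[cite: Balaban1984PropagatorsII, Prop. 2.5 p.246; Balaban1984PropagatorsI, Prop. 1.2 (1.110), (1.114) pp.35–36] -/
theorem clauses_settingTS (ha₀ : 0 < a₀) (ha₁ : a₀ ≤ a₁) :
    ∃ δ : ℝ, 0 < δ ∧ ∃ C : ℝ, 0 ≤ C ∧ ∀ i : TSIdx d L hd hL a₀ a₁,
      (∀ (J : (settingTS i).Loc) (y y' : (settingTS i).Site), (settingTS i).suppIn J y' →
          (settingTS i).e 0 J y ≤ C * Real.exp (-(δ * (settingTS i).dist y y')) * (settingTS i).supNorm J) ∧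
      (∀ (J : (settingTS i).Loc) (y y' : (settingTS i).Site), (settingTS i).suppIn J y' →
          (settingTS i).e 1 J y ≤ C * Real.exp (-(δ * (settingTS i).dist y y')) * (settingTS i).supNorm J) ∧
      (∀ (J : (settingTS i).Loc) (ζ : (settingTS i).Cut) (y y' : (settingTS i).Site), (settingTS i).cutIn ζ y → (settingTS i).suppIn J y' →
          (settingTS i).l2loc 0 J ζ ≤ C * Real.exp (-(δ * (settingTS i).dist y y')) * (settingTS i).cutSup ζ * (settingTS i).l2Norm J) := by
  obtain ⟨δ₁, hδ₁, C₁, hC₁, h₁⟩ := ineq110_zero_TS (d := d) (L := L) (hd := hd) (hL := hL) ha₀ ha₁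
  obtain ⟨δ₂, hδ₂, C₂, hC₂, h₂⟩ := ineq110_one_TS (d := d) (L := L) (hd := hd) (hL := hL) ha₀ ha₁
  obtain ⟨δ₃, hδ₃, C₃, hC₃, h₃⟩ := ineq114_zero_TS (d := d) (L := L) (hd := hd) (hL := hL) ha₀ ha₁
  set δ := min δ₁ (min δ₂ δ₃) with hδdef
  set C := max C₁ (max C₂ C₃) with hCdef
  have hδ0 : 0 < δ := lt_min hδ₁ (lt_min hδ₂ hδ₃)
  have hC0 : 0 ≤ C := le_max_of_le_left hC₁
  -- weakening the rate and enlarging the constant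
  have mono : ∀ {δ' C' : ℝ} (_ : δ ≤ δ') (_ : C' ≤ C) {t X : ℝ} (_ : 0 ≤ t) (_ : 0 ≤ X),
      C' * Real.exp (-(δ' * t)) * X ≤ C * Real.exp (-(δ * t)) * X := by
    intro δ' C' hδ' hC' t X ht hX
    have hC'0 : C' * Real.exp (-(δ' * t)) * X ≤ C * Real.exp (-(δ' * t)) * X :=
      mul_le_mul_of_nonneg_right (mul_le_mul_of_nonneg_right hC' (Real.exp_nonneg _)) hX
    refine hC'0.trans (mul_le_mul_of_nonneg_right (mul_le_mul_of_nonneg_left ?_ hC0) hX)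
    exact Real.exp_le_exp.2 (by nlinarith)
  refine ⟨δ, hδ0, C, hC0, fun i => ⟨?_, ?_, ?_⟩⟩
  · intro J y y' hJ
    change i.eTS 0 J y ≤ C * Real.exp (-(δ * i.tdist y y')) * i.supNormTS J
    exact (h₁ i J y y' hJ).trans (mono (min_le_left _ _) (le_max_left _ _) (i.tdist_nonneg y y') (i.supNormTS_nonneg J))
  · intro J y y' hJ
    change i.eTS 1 J y ≤ C * Real.exp (-(δ * i.tdist y y')) * i.supNormTS J
    have hC₂ : C₂ ≤ C := (le_max_left C₂ C₃).trans (le_max_right C₁ _)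
    exact (h₂ i J y y' hJ).trans (mono ((min_le_right _ _).trans (min_le_left _ _)) hC₂ (i.tdist_nonneg y y') (i.supNormTS_nonneg J))
  · intro J ζ y y' hζ hJ
    change i.l2locTS 0 J ζ ≤ C * Real.exp (-(δ * i.tdist y y')) * i.cutSupTS ζ * i.l2NormTS J
    have hC₃ : C₃ ≤ C := (le_max_right C₂ C₃).trans (le_max_right C₁ _)
    have hX : 0 ≤ i.cutSupTS ζ * i.l2NormTS J := mul_nonneg (i.cutSupTS_nonneg ζ) (i.l2NormTS_nonneg J)
    have hm := mono ((min_le_right _ _).trans (min_le_right _ _)) hC₃ (i.tdist_nonneg y y') hX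
    have h3 := h₃ i J ζ y y' hζ hJ
    rw [mul_assoc] at h3
    rw [mul_assoc]
    exact h3.trans hm

end Clauses

/-! ## §8  Non-vacuity of the index -/

/-- the index is inhabited: any torus with `m + K ≥ 1`, scale `j = 0`, `Λ′ = ∅`, constant weights `w ≡ a₀` (in the window when `a₀ ≤ a₁`).
[cite: Balaban1984PropagatorsII, Prop. 2.5 p.246] -/
theorem tsIdx_nonempty {d L : ℕ} (hd : 1 ≤ d + 1) (hL : Odd L ∧ 1 < L) {a₀ a₁ : ℝ} (ha₁ : a₀ ≤ a₁) (m K : ℕ) (hmK : 1 ≤ m + K) :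
    Nonempty (TSIdx d L hd hL a₀ a₁) :=
  ⟨{ m := m, K := K, j := 0, hj := hmK, Λ' := ∅, w := fun _ => a₀ * ((L : ℝ) ^ 0) ^ (d + 1),
     hw0 := fun _ => le_rfl, hw1 := fun _ => mul_le_mul_of_nonneg_right ha₁ (by positivity) }⟩

/-! ## §9  (v1.1) The (1.110)₃ clause `|G∇*J|` from p22's file 14 -/

namespace TSIdx

variable {d L : ℕ} {hd : 1 ≤ d + 1} {hL : Odd L ∧ 1 < L} {a₀ a₁ : ℝ} (i : TSIdx d L hd hL a₀ a₁)

/-- the (1.110)₃ entry on the `ten` kind (definitional). [cite: Balaban1984PropagatorsI, Prop. 1.2 (1.110) p.35, dictionary] -/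
@[simp] theorem eTS_two_ten (J : Fin i.P.d → BondSpace i.P) (y : Site i.P i.j) : i.eTS 2 (.ten J) y = i.cubeSup y (i.G (i.divTS J)) := rfl
/-- the (1.110)₃ entry vanishes on the `vec` kind (source-kind device). [cite: Balaban1984PropagatorsI, Prop. 1.2 (1.110) p.35, dictionary] -/
@[simp] theorem eTS_two_vec (J : BondSpace i.P) (y : Site i.P i.j) : i.eTS 2 (.vec J) y = 0 := rfl

/-- `|J_λ(b)| ≤ |J|` for a family source. [cite: Balaban1984PropagatorsI, (1.108) p.35] -/
theorem abs_le_supNormTS_ten (J : Fin i.P.d → BondSpace i.P) (lam : Fin i.P.d) (b : PBond i.P 0) : |J lam b| ≤ i.supNormTS (.ten J) := by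
  have h := LatticeNorms.norm_le_supNorm (fun p : Fin i.P.d × PBond i.P 0 => J p.1 p.2) (Finset.mem_univ (lam, b))
  rwa [Real.norm_eq_abs] at h

/-- `(G∇*J)(b) = Σ_λ (G∇_λ*J_λ)(b)` (linearity). [cite: Balaban1984PropagatorsI, (1.89) p.33 («G∇*J»), dictionary] -/
theorem G_divTS_apply (J : Fin i.P.d → BondSpace i.P) (b : PBond i.P 0) :
    i.G (i.divTS J) b = ∑ lam, i.G (i.Dla lam (J lam)) b := by
  unfold divTS
  rw [map_sum, WithLp.ofLp_sum, Finset.sum_apply]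

end TSIdx

section ClauseGDiv

variable {d L : ℕ} {hd : 1 ≤ d + 1} {hL : Odd L ∧ 1 < L} {a₀ a₁ : ℝ}

open TSIdx

/-- **THE (1.110)₃ CLAUSE FOR THE GENUINE TWO-SCALE FAMILY** (v1.1): there are `δ₂ > 0`, `C ≥ 0` (on `d, L, a₀, a₁`) such that for EVERY member,
every family source `J = (J_λ)` with `supp J ⊂ Δ̃(y′)` and every `y`, `e 2 J y = sup_{Δ̃(y)}|G_□∇*J| ≤ C·e^{−δ₂|y−y′|}·|J|` — p22's `prop25_ineq110_Gdiv`
(per `λ`, at `r = 1`, `X = |J|`) summed over the `d + 1` directions. [cite: Balaban1984PropagatorsII, Prop. 2.5 p.246; Balaban1984PropagatorsI, Prop. 1.2 (1.110) p.35] -/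
theorem ineq110_two_TS (ha₀ : 0 < a₀) (ha₁ : a₀ ≤ a₁) :
    ∃ δ : ℝ, 0 < δ ∧ ∃ C : ℝ, 0 ≤ C ∧ ∀ (i : TSIdx d L hd hL a₀ a₁) (J : i.LocTS) (y y' : Site i.P i.j),
      i.suppInTS J y' → i.eTS 2 J y ≤ C * Real.exp (-(δ * i.tdist y y')) * i.supNormTS J := by
  classical
  obtain ⟨δ, hδ, C, hC, h⟩ := prop25_ineq110_Gdiv d L hd hL ha₀ ha₁
  refine ⟨δ, hδ, ((d : ℝ) + 1) * (C * Real.exp ((1 + 2 * δ) * 1)), by positivity, ?_⟩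
  intro i J y y' hsupp
  have hRHS : 0 ≤ ((d : ℝ) + 1) * (C * Real.exp ((1 + 2 * δ) * 1)) * Real.exp (-(δ * i.tdist y y')) * i.supNormTS J :=
    mul_nonneg (by positivity) (i.supNormTS_nonneg J)
  cases J with
  | vec J => rw [eTS_two_vec]; exact hRHS
  | ten2 J => rw [eTS_ten2]; exact hRHS
  | ten J =>
    rw [eTS_two_ten]
    refine LatticeNorms.supNorm_le hRHS fun b hb => ?_
    rw [Finset.mem_filter] at hb
    rw [Real.norm_eq_abs, G_divTS_apply]
    have hterm : ∀ lam : Fin i.P.d, |i.G (i.Dla lam (J lam)) b| ≤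
        C * Real.exp ((1 + 2 * δ) * 1) * Real.exp (-(δ * i.tdist y y')) * i.supNormTS (.ten J) := by
      intro lam
      exact h i.m i.K i.j i.hc i.hj i.Λ' i.w i.hw0 i.hw1 lam 1 zero_le_one (J lam) (i.supNormTS (.ten J)) (i.supNormTS_nonneg _) y y'
        (hsupp lam) (fun b' => i.abs_le_supNormTS_ten J lam b') b hb.2
    calc |∑ lam, i.G (i.Dla lam (J lam)) b|
        ≤ ∑ lam, |i.G (i.Dla lam (J lam)) b| := Finset.abs_sum_le_sum_abs _ _
      _ ≤ ∑ _lam : Fin i.P.d, C * Real.exp ((1 + 2 * δ) * 1) * Real.exp (-(δ * i.tdist y y')) * i.supNormTS (.ten J) :=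
          Finset.sum_le_sum fun lam _ => hterm lam
      _ = ((d : ℝ) + 1) * (C * Real.exp ((1 + 2 * δ) * 1)) * Real.exp (-(δ * i.tdist y y')) * i.supNormTS (.ten J) := by
          rw [Finset.sum_const, Finset.card_univ, Fintype.card_fin, nsmul_eq_mul]
          push_cast
          ring

end ClauseGDiv

/-! ## §10  (v1.1) The (1.114)₂,₃ clauses `‖ζ∇GJ‖`, `‖ζG∇*J‖` from p22's file 15 -/

namespace TSIdx

variable {d L : ℕ} {hd : 1 ≤ d + 1} {hL : Odd L ∧ 1 < L} {a₀ a₁ : ℝ} (i : TSIdx d L hd hL a₀ a₁)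

/-- the (1.114)₂ entry on the `vec` kind (definitional). [cite: Balaban1984PropagatorsI, Prop. 1.2 (1.114) p.36, dictionary] -/
@[simp] theorem l2locTS_one_vec (J : BondSpace i.P) (ζ : Site i.P 0 → ℝ) :
    i.l2locTS 1 (.vec J) ζ = Real.sqrt (∑ lam, ‖i.smulB ζ (i.Dl lam (i.G J))‖ ^ 2) := rfl
/-- idem, the `ten`/`ten2` kinds vanish at `n = 1` (source-kind device). [cite: Balaban1984PropagatorsI, Prop. 1.2 (1.114) p.36, dictionary] -/
@[simp] theorem l2locTS_one_ten (J : Fin i.P.d → BondSpace i.P) (ζ : Site i.P 0 → ℝ) : i.l2locTS 1 (.ten J) ζ = 0 := rfl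
/-- idem. [cite: Balaban1984PropagatorsI, Prop. 1.2 (1.114) p.36, dictionary] -/
@[simp] theorem l2locTS_one_ten2 (J : Fin i.P.d → Fin i.P.d → BondSpace i.P) (ζ : Site i.P 0 → ℝ) : i.l2locTS 1 (.ten2 J) ζ = 0 := rfl
/-- the (1.114)₃ entry on the `ten` kind (definitional). [cite: Balaban1984PropagatorsI, Prop. 1.2 (1.114) p.36, dictionary] -/
@[simp] theorem l2locTS_two_ten (J : Fin i.P.d → BondSpace i.P) (ζ : Site i.P 0 → ℝ) :
    i.l2locTS 2 (.ten J) ζ = ‖i.smulB ζ (i.G (i.divTS J))‖ := rfl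
/-- idem, the `vec`/`ten2` kinds vanish at `n = 2`. [cite: Balaban1984PropagatorsI, Prop. 1.2 (1.114) p.36, dictionary] -/
@[simp] theorem l2locTS_two_vec (J : BondSpace i.P) (ζ : Site i.P 0 → ℝ) : i.l2locTS 2 (.vec J) ζ = 0 := rfl
/-- idem. [cite: Balaban1984PropagatorsI, Prop. 1.2 (1.114) p.36, dictionary] -/
@[simp] theorem l2locTS_two_ten2 (J : Fin i.P.d → Fin i.P.d → BondSpace i.P) (ζ : Site i.P 0 → ℝ) : i.l2locTS 2 (.ten2 J) ζ = 0 := rfl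

/-- `‖J_λ‖ ≤ ‖J‖` for a family source. [cite: Balaban1984PropagatorsI, (1.21) p.21, (1.114) p.36] -/
theorem norm_le_l2NormTS_ten (J : Fin i.P.d → BondSpace i.P) (lam : Fin i.P.d) : ‖J lam‖ ≤ i.l2NormTS (.ten J) := by
  show ‖J lam‖ ≤ Real.sqrt (∑ mu, ‖J mu‖ ^ 2)
  rw [← Real.sqrt_sq (norm_nonneg (J lam))]
  exact Real.sqrt_le_sqrt (Finset.single_le_sum (fun mu _ => sq_nonneg ‖J mu‖) (Finset.mem_univ lam))

/-- `‖ζ∇_λA‖² = Σ_b (ζ(b₋)·L^j(A(b + e_λ) − A(b)))²`. [cite: Balaban1984PropagatorsI, (1.4) p.18, (1.114) p.36, dictionary] -/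
theorem norm_smulB_Dl_sq (ζ : Site i.P 0 → ℝ) (lam : Fin i.P.d) (A : BondSpace i.P) :
    ‖i.smulB ζ (i.Dl lam A)‖ ^ 2 = ∑ b : PBond i.P 0, (ζ b.src * (((L : ℝ) ^ i.j) * (A ⟨b.src.shift lam, b.dir⟩ - A b))) ^ 2 := by
  rw [norm_smulB, Real.sq_sqrt (Finset.sum_nonneg fun b _ => sq_nonneg _)]
  simp only [Dl_apply]

/-- `ζ·G_□∇*J = Σ_λ ζ·G_□∇_λ*J_λ` (additivity of `G_□` and of the cut-off multiplication). [cite: Balaban1984PropagatorsI, (1.89) p.33 («G∇*J»), dictionary] -/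
theorem smulB_G_divTS (ζ : Site i.P 0 → ℝ) (J : Fin i.P.d → BondSpace i.P) :
    i.smulB ζ (i.G (i.divTS J)) = ∑ lam, i.smulB ζ (i.G (i.Dla lam (J lam))) := by
  refine PiLp.ext fun b => ?_
  rw [smulB_apply, G_divTS_apply, Finset.mul_sum, WithLp.ofLp_sum, Finset.sum_apply]
  rfl

/-- `√s ≤ A·t` from `s ≤ (A)²·t²` for `A, t ≥ 0` (the square root of p22's squared Schur bounds). [folklore] -/
private theorem sqrt_le_of_sq_bound {s A t : ℝ} (hA : 0 ≤ A) (ht : 0 ≤ t) (h : s ≤ A ^ 2 * t ^ 2) : Real.sqrt s ≤ A * t := by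
  calc Real.sqrt s ≤ Real.sqrt (A ^ 2 * t ^ 2) := Real.sqrt_le_sqrt h
    _ = A * t := by rw [show A ^ 2 * t ^ 2 = (A * t) ^ 2 by ring, Real.sqrt_sq (mul_nonneg hA ht)]

end TSIdx

section ClausesL2Grad

variable {d L : ℕ} {hd : 1 ≤ d + 1} {hL : Odd L ∧ 1 < L} {a₀ a₁ : ℝ}

open TSIdx

/-- **THE (1.114)₂ CLAUSE FOR THE GENUINE TWO-SCALE FAMILY** (v1.1): there are `δ₂ > 0`, `C ≥ 0` (on `d, L, a₀, a₁`) such that for EVERY member, every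
`J` with `supp J ⊂ Δ̃(y′)` and every cut-off `ζ` with `supp ζ ⊂ Δ̃(y)`, `l2loc 1 J ζ = (Σ_λ‖ζ∇_λG_□J‖²)^{1/2} ≤ C·e^{−δ₂|y−y′|}·|ζ|·‖J‖` — p22's
`prop25_ineq114_grad` (per `λ`, at `r = 1`, `Z = |ζ|`) summed over the `d + 1` directions (`√(d+1) ≤ d + 1`).
[cite: Balaban1984PropagatorsII, Prop. 2.5 p.246; Balaban1984PropagatorsI, Prop. 1.2 (1.114) p.36] -/
theorem ineq114_one_TS (ha₀ : 0 < a₀) (ha₁ : a₀ ≤ a₁) :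
    ∃ δ : ℝ, 0 < δ ∧ ∃ C : ℝ, 0 ≤ C ∧ ∀ (i : TSIdx d L hd hL a₀ a₁) (J : i.LocTS) (ζ : Site i.P 0 → ℝ) (y y' : Site i.P i.j),
      i.cutInTS ζ y → i.suppInTS J y' → i.l2locTS 1 J ζ ≤ C * Real.exp (-(δ * i.tdist y y')) * i.cutSupTS ζ * i.l2NormTS J := by
  classical
  obtain ⟨δ, hδ, C, hC, h⟩ := prop25_ineq114_grad d L hd hL ha₀ ha₁
  refine ⟨δ, hδ, ((d : ℝ) + 1) * (C * Real.exp ((1 + 2 * δ) * 1)), by positivity, ?_⟩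
  intro i J ζ y y' hζ hsupp
  have hRHS : 0 ≤ ((d : ℝ) + 1) * (C * Real.exp ((1 + 2 * δ) * 1)) * Real.exp (-(δ * i.tdist y y')) * i.cutSupTS ζ * i.l2NormTS J :=
    mul_nonneg (mul_nonneg (by positivity) (i.cutSupTS_nonneg ζ)) (i.l2NormTS_nonneg J)
  cases J with
  | ten J => rw [l2locTS_one_ten]; exact hRHS
  | ten2 J => rw [l2locTS_one_ten2]; exact hRHS
  | vec J =>
    rw [l2locTS_one_vec]
    -- the per-direction bound `B`
    set B : ℝ := C * Real.exp ((1 + 2 * δ) * 1) * Real.exp (-(δ * i.tdist y y')) * i.cutSupTS ζ with hB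
    have hB0 : 0 ≤ B := by rw [hB]; exact mul_nonneg (by positivity) (i.cutSupTS_nonneg ζ)
    have hterm : ∀ lam : Fin i.P.d, ‖i.smulB ζ (i.Dl lam (i.G J))‖ ^ 2 ≤ B ^ 2 * ‖J‖ ^ 2 := by
      intro lam
      rw [norm_smulB_Dl_sq]
      exact h i.m i.K i.j i.hc i.hj i.Λ' i.w i.hw0 i.hw1 lam 1 zero_le_one J ζ (i.cutSupTS ζ) (i.cutSupTS_nonneg ζ) y y'
        hsupp hζ (fun x => i.abs_le_cutSupTS ζ x)
    have hsum : ∑ lam, ‖i.smulB ζ (i.Dl lam (i.G J))‖ ^ 2 ≤ (((d : ℝ) + 1) * B) ^ 2 * ‖J‖ ^ 2 := by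
      calc ∑ lam, ‖i.smulB ζ (i.Dl lam (i.G J))‖ ^ 2
          ≤ ∑ _lam : Fin i.P.d, B ^ 2 * ‖J‖ ^ 2 := Finset.sum_le_sum fun lam _ => hterm lam
        _ = ((d : ℝ) + 1) * (B ^ 2 * ‖J‖ ^ 2) := by
            rw [Finset.sum_const, Finset.card_univ, Fintype.card_fin, nsmul_eq_mul]
            push_cast
            ring
        _ ≤ ((d : ℝ) + 1) ^ 2 * (B ^ 2 * ‖J‖ ^ 2) := by
            refine mul_le_mul_of_nonneg_right ?_ (by positivity)
            nlinarith [show (0 : ℝ) ≤ (d : ℝ) from Nat.cast_nonneg d]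
        _ = (((d : ℝ) + 1) * B) ^ 2 * ‖J‖ ^ 2 := by ring
    calc Real.sqrt (∑ lam, ‖i.smulB ζ (i.Dl lam (i.G J))‖ ^ 2)
        ≤ ((d : ℝ) + 1) * B * ‖J‖ := sqrt_le_of_sq_bound (by positivity) (norm_nonneg J) hsum
      _ = ((d : ℝ) + 1) * (C * Real.exp ((1 + 2 * δ) * 1)) * Real.exp (-(δ * i.tdist y y')) * i.cutSupTS ζ * i.l2NormTS (.vec J) := by
          rw [hB]; show _ = _ * ‖J‖; ring

/-- **THE (1.114)₃ CLAUSE FOR THE GENUINE TWO-SCALE FAMILY** (v1.1): for EVERY member, every family source `J = (J_λ)` with `supp J ⊂ Δ̃(y′)` and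
every cut-off `ζ` with `supp ζ ⊂ Δ̃(y)`, `l2loc 2 J ζ = ‖ζG_□∇*J‖ ≤ C·e^{−δ₂|y−y′|}·|ζ|·‖J‖`, `‖J‖ = (Σ_λ‖J_λ‖²)^{1/2}` — p22's `prop25_ineq114_Gdiv`
(per `λ`, at `r = 1`, `Z = |ζ|`), the triangle inequality over the `d + 1` directions and `‖J_λ‖ ≤ ‖J‖`.
[cite: Balaban1984PropagatorsII, Prop. 2.5 p.246; Balaban1984PropagatorsI, Prop. 1.2 (1.114) p.36] -/
theorem ineq114_two_TS (ha₀ : 0 < a₀) (ha₁ : a₀ ≤ a₁) :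
    ∃ δ : ℝ, 0 < δ ∧ ∃ C : ℝ, 0 ≤ C ∧ ∀ (i : TSIdx d L hd hL a₀ a₁) (J : i.LocTS) (ζ : Site i.P 0 → ℝ) (y y' : Site i.P i.j),
      i.cutInTS ζ y → i.suppInTS J y' → i.l2locTS 2 J ζ ≤ C * Real.exp (-(δ * i.tdist y y')) * i.cutSupTS ζ * i.l2NormTS J := by
  classical
  obtain ⟨δ, hδ, C, hC, h⟩ := prop25_ineq114_Gdiv d L hd hL ha₀ ha₁
  refine ⟨δ, hδ, ((d : ℝ) + 1) * (C * Real.exp ((1 + 2 * δ) * 1)), by positivity, ?_⟩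
  intro i J ζ y y' hζ hsupp
  have hRHS : 0 ≤ ((d : ℝ) + 1) * (C * Real.exp ((1 + 2 * δ) * 1)) * Real.exp (-(δ * i.tdist y y')) * i.cutSupTS ζ * i.l2NormTS J :=
    mul_nonneg (mul_nonneg (by positivity) (i.cutSupTS_nonneg ζ)) (i.l2NormTS_nonneg J)
  cases J with
  | vec J => rw [l2locTS_two_vec]; exact hRHS
  | ten2 J => rw [l2locTS_two_ten2]; exact hRHS
  | ten J =>
    rw [l2locTS_two_ten, smulB_G_divTS]
    set B : ℝ := C * Real.exp ((1 + 2 * δ) * 1) * Real.exp (-(δ * i.tdist y y')) * i.cutSupTS ζ with hB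
    have hB0 : 0 ≤ B := by rw [hB]; exact mul_nonneg (by positivity) (i.cutSupTS_nonneg ζ)
    have hterm : ∀ lam : Fin i.P.d, ‖i.smulB ζ (i.G (i.Dla lam (J lam)))‖ ≤ B * i.l2NormTS (.ten J) := by
      intro lam
      have h1 := h i.m i.K i.j i.hc i.hj i.Λ' i.w i.hw0 i.hw1 lam 1 zero_le_one (J lam) ζ (i.cutSupTS ζ) (i.cutSupTS_nonneg ζ) y y'
        (hsupp lam) hζ (fun x => i.abs_le_cutSupTS ζ x)
      have h2 : ‖i.smulB ζ (i.G (i.Dla lam (J lam)))‖ ≤ B * ‖J lam‖ := by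
        rw [norm_smulB]
        exact sqrt_le_of_sq_bound hB0 (norm_nonneg _) h1
      exact h2.trans (mul_le_mul_of_nonneg_left (i.norm_le_l2NormTS_ten J lam) hB0)
    calc ‖∑ lam, i.smulB ζ (i.G (i.Dla lam (J lam)))‖
        ≤ ∑ lam, ‖i.smulB ζ (i.G (i.Dla lam (J lam)))‖ := norm_sum_le _ _
      _ ≤ ∑ _lam : Fin i.P.d, B * i.l2NormTS (.ten J) := Finset.sum_le_sum fun lam _ => hterm lam
      _ = ((d : ℝ) + 1) * (C * Real.exp ((1 + 2 * δ) * 1)) * Real.exp (-(δ * i.tdist y y')) * i.cutSupTS ζ * i.l2NormTS (.ten J) := by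
          rw [Finset.sum_const, Finset.card_univ, Fintype.card_fin, nsmul_eq_mul, hB]
          push_cast
          ring

end ClausesL2Grad

/-! ## §11  (v1.1) The six clauses read on the census setting with one `(δ₂, C)` -/

section SixClauses

variable {d L : ℕ} {hd : 1 ≤ d + 1} {hL : Odd L ∧ 1 < L} {a₀ a₁ : ℝ}

open TSIdx

/-- **SIX CLAUSES OF `B5.Ineq110_114` ON THE CENSUS SETTING WITH ONE `(δ₂, C)`** (v1.1): its first conjunct at `n = 0, 1, 2` ((1.110)₁,₂,₃: `|GJ|`,
`|∇GJ|`, `|G∇*J|`) and its fifth conjunct at `n = 0, 1, 2` ((1.114)₁,₂,₃: `‖ζGJ‖`, `‖ζ∇GJ‖`, `‖ζG∇*J‖`), for every member of the genuine two-scale family —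
the common rate is the minimum and the common constant the maximum of the six.  (The conjuncts at `n = 3` resp. `n = 3, 4, 5`, and the second, third,
fourth conjuncts, are NOT claimed.) [cite: Balaban1984PropagatorsII, Prop. 2.5 p.246; Balaban1984PropagatorsI, Prop. 1.2 (1.110), (1.114) pp.35–36] -/
theorem clauses_settingTS_six (ha₀ : 0 < a₀) (ha₁ : a₀ ≤ a₁) :
    ∃ δ : ℝ, 0 < δ ∧ ∃ C : ℝ, 0 ≤ C ∧ ∀ i : TSIdx d L hd hL a₀ a₁,
      (∀ n : Fin 4, n.val ≤ 2 → ∀ (J : (settingTS i).Loc) (y y' : (settingTS i).Site), (settingTS i).suppIn J y' →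
          (settingTS i).e n J y ≤ C * Real.exp (-(δ * (settingTS i).dist y y')) * (settingTS i).supNorm J) ∧
      (∀ n : Fin 6, n.val ≤ 2 → ∀ (J : (settingTS i).Loc) (ζ : (settingTS i).Cut) (y y' : (settingTS i).Site),
          (settingTS i).cutIn ζ y → (settingTS i).suppIn J y' →
          (settingTS i).l2loc n J ζ ≤ C * Real.exp (-(δ * (settingTS i).dist y y')) * (settingTS i).cutSup ζ * (settingTS i).l2Norm J) := by
  obtain ⟨δ₁, hδ₁, C₁, hC₁, h₁⟩ := ineq110_zero_TS (d := d) (L := L) (hd := hd) (hL := hL) ha₀ ha₁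
  obtain ⟨δ₂, hδ₂, C₂, hC₂, h₂⟩ := ineq110_one_TS (d := d) (L := L) (hd := hd) (hL := hL) ha₀ ha₁
  obtain ⟨δ₃, hδ₃, C₃, hC₃, h₃⟩ := ineq110_two_TS (d := d) (L := L) (hd := hd) (hL := hL) ha₀ ha₁
  obtain ⟨δ₄, hδ₄, C₄, hC₄, h₄⟩ := ineq114_zero_TS (d := d) (L := L) (hd := hd) (hL := hL) ha₀ ha₁
  obtain ⟨δ₅, hδ₅, C₅, hC₅, h₅⟩ := ineq114_one_TS (d := d) (L := L) (hd := hd) (hL := hL) ha₀ ha₁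
  obtain ⟨δ₆, hδ₆, C₆, hC₆, h₆⟩ := ineq114_two_TS (d := d) (L := L) (hd := hd) (hL := hL) ha₀ ha₁
  -- a common rate below the six rates and a common constant above the six constants
  set δ := min (min δ₁ (min δ₂ δ₃)) (min δ₄ (min δ₅ δ₆)) with hδdef
  set C := max (max C₁ (max C₂ C₃)) (max C₄ (max C₅ C₆)) with hCdef
  have hδ0 : 0 < δ := lt_min (lt_min hδ₁ (lt_min hδ₂ hδ₃)) (lt_min hδ₄ (lt_min hδ₅ hδ₆))
  have hC0 : 0 ≤ C := le_max_of_le_left (le_max_of_le_left hC₁)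
  have hδ₁' : δ ≤ δ₁ := (min_le_left _ _).trans (min_le_left _ _)
  have hδ₂' : δ ≤ δ₂ := (min_le_left _ _).trans ((min_le_right _ _).trans (min_le_left _ _))
  have hδ₃' : δ ≤ δ₃ := (min_le_left _ _).trans ((min_le_right _ _).trans (min_le_right _ _))
  have hδ₄' : δ ≤ δ₄ := (min_le_right _ _).trans (min_le_left _ _)
  have hδ₅' : δ ≤ δ₅ := (min_le_right _ _).trans ((min_le_right _ _).trans (min_le_left _ _))
  have hδ₆' : δ ≤ δ₆ := (min_le_right _ _).trans ((min_le_right _ _).trans (min_le_right _ _))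
  have hC₁' : C₁ ≤ C := (le_max_left C₁ (max C₂ C₃)).trans (le_max_left _ _)
  have hC₂' : C₂ ≤ C := ((le_max_left C₂ C₃).trans (le_max_right C₁ _)).trans (le_max_left _ _)
  have hC₃' : C₃ ≤ C := ((le_max_right C₂ C₃).trans (le_max_right C₁ _)).trans (le_max_left _ _)
  have hC₄' : C₄ ≤ C := (le_max_left C₄ (max C₅ C₆)).trans (le_max_right _ _)
  have hC₅' : C₅ ≤ C := ((le_max_left C₅ C₆).trans (le_max_right C₄ _)).trans (le_max_right _ _)
  have hC₆' : C₆ ≤ C := ((le_max_right C₅ C₆).trans (le_max_right C₄ _)).trans (le_max_right _ _)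
  -- weakening the rate and enlarging the constant
  have mono : ∀ {δ' C' : ℝ} (_ : δ ≤ δ') (_ : C' ≤ C) {t X : ℝ} (_ : 0 ≤ t) (_ : 0 ≤ X),
      C' * Real.exp (-(δ' * t)) * X ≤ C * Real.exp (-(δ * t)) * X := by
    intro δ' C' hδ' hC' t X ht hX
    have hC'0 : C' * Real.exp (-(δ' * t)) * X ≤ C * Real.exp (-(δ' * t)) * X :=
      mul_le_mul_of_nonneg_right (mul_le_mul_of_nonneg_right hC' (Real.exp_nonneg _)) hX
    refine hC'0.trans (mul_le_mul_of_nonneg_right (mul_le_mul_of_nonneg_left ?_ hC0) hX)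
    exact Real.exp_le_exp.2 (by nlinarith)
  have mono2 : ∀ {δ' C' : ℝ} (_ : δ ≤ δ') (_ : C' ≤ C) {t X Y : ℝ} (_ : 0 ≤ t) (_ : 0 ≤ X) (_ : 0 ≤ Y),
      C' * Real.exp (-(δ' * t)) * X * Y ≤ C * Real.exp (-(δ * t)) * X * Y := by
    intro δ' C' hδ' hC' t X Y ht hX hY
    have h := mono hδ' hC' ht (mul_nonneg hX hY)
    simpa only [mul_assoc] using h
  refine ⟨δ, hδ0, C, hC0, fun i => ⟨?_, ?_⟩⟩
  · intro n hn J y y' hJ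
    change i.eTS n J y ≤ C * Real.exp (-(δ * i.tdist y y')) * i.supNormTS J
    have hX := i.supNormTS_nonneg J
    have ht := i.tdist_nonneg y y'
    rcases n with ⟨_ | _ | _ | _ | k, hk⟩
    · exact (h₁ i J y y' hJ).trans (mono hδ₁' hC₁' ht hX)
    · exact (h₂ i J y y' hJ).trans (mono hδ₂' hC₂' ht hX)
    · exact (h₃ i J y y' hJ).trans (mono hδ₃' hC₃' ht hX)
    · simp at hn
    · omega
  · intro n hn J ζ y y' hζ hJ
    change i.l2locTS n J ζ ≤ C * Real.exp (-(δ * i.tdist y y')) * i.cutSupTS ζ * i.l2NormTS J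
    have hX := i.cutSupTS_nonneg ζ
    have hY := i.l2NormTS_nonneg J
    have ht := i.tdist_nonneg y y'
    rcases n with ⟨_ | _ | _ | _ | _ | _ | k, hk⟩
    · exact (h₄ i J ζ y y' hζ hJ).trans (mono2 hδ₄' hC₄' ht hX hY)
    · exact (h₅ i J ζ y y' hζ hJ).trans (mono2 hδ₅' hC₅' ht hX hY)
    · exact (h₆ i J ζ y y' hζ hJ).trans (mono2 hδ₆' hC₆' ht hX hY)
    · simp at hn
    · simp at hn
    · simp at hn
    · omega

end SixClauses

/-! ## §12  (v1.2) The (1.111)₁ clause `‖ζ∇GJ‖_α` on the `vec` kind from p38's file 5 (`B6Prop25HolderTwoScaleV1`) -/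

namespace TSIdx

variable {d L : ℕ} {hd : 1 ≤ d + 1} {hL : Odd L ∧ 1 < L} {a₀ a₁ : ℝ} (i : TSIdx d L hd hL a₀ a₁)

/-- the (1.111) entry on the `vec` kind (definitional): `max_λ ‖ζ∇_λG_□J‖_α`. [cite: Balaban1984PropagatorsI, Prop. 1.2 (1.111) p.35, dictionary] -/
@[simp] theorem h1TS_vec (J : BondSpace i.P) (α : ℝ) (ζ : Site i.P 0 → ℝ) :
    i.h1TS (.vec J) α ζ = LatticeNorms.supNorm univ (fun lam => i.hqB α (i.smulB ζ (i.Dl lam (i.G J)))) := rfl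

/-- the fine distance in `T^{(j)}` units is the `ℕ`-valued sup distance of the lattice calculus divided by `L^j` (p38's `t = |x − x′|_∞/n`).
[cite: Balaban1984PropagatorsI, (1.109) p.35, dictionary] -/
theorem fdist_eq (x x' : Site i.P 0) : i.fdist x x' = (supDist x x' : ℝ) / (L : ℝ) ^ i.j := by
  rw [B6BlockDecayHprimeCovV1.supDist_cast_eq_torusSupNorm]
  rfl

/-- `0 ≤ |x − x′|_∞/L^j`. [cite: Balaban1984PropagatorsI, (1.109) p.35, dictionary] -/
theorem fdist_nonneg (x x' : Site i.P 0) : 0 ≤ i.fdist x x' := by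
  rw [fdist_eq]; positivity

/-- `0 < |x − x′|_∞/L^j` for `x ≠ x′`. [cite: Balaban1984PropagatorsI, (1.109) p.35, dictionary] -/
theorem fdist_pos {x x' : Site i.P 0} (h : x ≠ x') : 0 < i.fdist x x' := by
  rw [fdist_eq]
  have hL0 : (0 : ℝ) < L := by have := hL.2; exact_mod_cast (show 0 < L by omega)
  have hD : 0 < supDist x x' := Nat.pos_of_ne_zero fun h0 => h ((B3TorusRadialSums.supDist_eq_zero_iff x x').1 h0)
  exact div_pos (by exact_mod_cast hD) (pow_pos hL0 _)

/-- `0 ≤ ‖f‖_ε`. [cite: Balaban1984PropagatorsI, (1.109) p.35] -/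
theorem hqB_nonneg (ε : ℝ) (f : BondSpace i.P) : 0 ≤ i.hqB ε f := by
  unfold hqB; exact LatticeNorms.supNorm_nonneg _ _

/-- `0 ≤ ‖ζ‖_α`. [cite: Balaban1984PropagatorsI, Prop. 1.2 (1.111) p.35 («‖ζ‖_α»)] -/
theorem hqS_nonneg (α : ℝ) (ζ : Site i.P 0 → ℝ) : 0 ≤ i.hqS α ζ := by
  unfold hqS; exact LatticeNorms.supNorm_nonneg _ _

/-- **the Hölder seminorm of a bond field is bounded by `C` as soon as every same-direction pair quotient is**:
`(∀ b₁ b₂, b₁₋ ≠ b₂₋ → ν₁ = ν₂ → |f(b₂) − f(b₁)|/t^ε ≤ C) → ‖f‖_ε ≤ C` (`C ≥ 0`). [cite: Balaban1984PropagatorsI, (1.109) p.35] -/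
theorem hqB_le {ε : ℝ} {f : BondSpace i.P} {C : ℝ} (hC : 0 ≤ C)
    (h : ∀ b₁ b₂ : PBond i.P 0, b₁.src ≠ b₂.src → b₁.dir = b₂.dir → |f b₂ - f b₁| / i.fdist b₁.src b₂.src ^ ε ≤ C) :
    i.hqB ε f ≤ C := by
  unfold hqB
  refine LatticeNorms.supNorm_le hC fun p hp => ?_
  rw [Finset.mem_filter] at hp
  rw [Real.norm_eq_abs, abs_div, abs_of_nonneg (Real.rpow_nonneg (i.fdist_nonneg _ _) _)]
  exact h p.1 p.2 hp.2.1 hp.2.2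

/-- **the Hölder hypothesis of p38's member theorem holds with `Z_h = ‖ζ‖_α`**: `|ζ(x) − ζ(x′)| ≤ ‖ζ‖_α·(|x − x′|_∞/L^j)^α` for `x ≠ x′`.
[cite: Balaban1984PropagatorsI, Prop. 1.2 (1.111) p.35 («‖ζ‖_α»), (1.109) p.35] -/
theorem abs_sub_le_hqS (α : ℝ) (ζ : Site i.P 0 → ℝ) {x x' : Site i.P 0} (h : x ≠ x') :
    |ζ x - ζ x'| ≤ i.hqS α ζ * i.fdist x x' ^ α := by
  have hpos : 0 < i.fdist x x' ^ α := Real.rpow_pos_of_pos (i.fdist_pos h) _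
  have h1 : ‖(ζ x' - ζ x) / i.fdist x x' ^ α‖ ≤ i.hqS α ζ := by
    unfold hqS
    exact LatticeNorms.norm_le_supNorm (fun p : Site i.P 0 × Site i.P 0 => (ζ p.2 - ζ p.1) / i.fdist p.1 p.2 ^ α)
      (Finset.mem_filter.2 ⟨Finset.mem_univ (x, x'), h⟩)
  rw [Real.norm_eq_abs, abs_div, abs_of_pos hpos, div_le_iff₀ hpos, abs_sub_comm] at h1
  exact h1

/-- the values of the cut fine-difference field: `(ζ∇_λG_□J)(b) = ζ(b₋)·L^j·((G_□J)(b + e_λ) − (G_□J)(b))` (p38's integrand).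
[cite: Balaban1984PropagatorsI, Prop. 1.2 (1.111) p.35 («ζ∇GJ»), (1.4) p.18, dictionary] -/
theorem smulB_Dl_G_apply (ζ : Site i.P 0 → ℝ) (lam : Fin i.P.d) (J : BondSpace i.P) (b : PBond i.P 0) :
    i.smulB ζ (i.Dl lam (i.G J)) b =
      ζ b.src * (((L : ℝ) ^ i.j) * ((tsV1 i.hc i.Λ' i.w).G J ⟨b.src.shift lam, b.dir⟩ - (tsV1 i.hc i.Λ' i.w).G J b)) := by
  rw [smulB_apply, Dl_apply]
  rfl

end TSIdx

section ClauseHolderGrad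

variable {d L : ℕ} {hd : 1 ≤ d + 1} {hL : Odd L ∧ 1 < L} {a₀ a₁ : ℝ}

open TSIdx
open B6Prop25HolderTwoScaleV1 (prop25_ineq111_grad)

/-- **THE (1.111)₁ CLAUSE `‖ζ∇G_□J‖_α` FOR THE GENUINE TWO-SCALE FAMILY ON THE `vec` KIND** (v1.2): there is `δ₂ > 0` (on `d, L, a₀, a₁`)
and for every `0 ≤ α < 1` a `C_α ≥ 0` such that for EVERY member, every fine bond field `J` with `supp J ⊂ Δ̃(y′)`, every cut-off `ζ` with
`supp ζ ⊂ Δ̃(y)`:  `h1 (vec J) α ζ = max_λ ‖ζ∇_λG_□J‖_α ≤ C_α·e^{−δ₂(1−α)|y−y′|}·(‖ζ‖_α + |ζ|)·|J|` — p38's `prop25_ineq111_grad` (p329819)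
for the same-direction pairs at distance `t = |x − x′|_∞/L^j ≤ 1` (with `Z_h = ‖ζ‖_α`, `Z₀ = |ζ|`, `X = |J|`, `r = 1`), and for the pairs at
`t > 1` the quotient is at most `|ζ(x)(∇_λG_□J)(b₁)| + |ζ(x′)(∇_λG_□J)(b₂)| ≤ 2|ζ|·O(1)e^{−δ₂|y−y′|}|J|` by p22's `prop25_ineq110_grad` (the
(1.110)₂ sup bound at `r = 1`).  DIVERGENCE (declared, = p38's HONEST SCOPE (1) / GAPS G-B6-p38-01): the RATE is `δ₂(1−α)`, not the print's
`α`-free `δ₂(d, L)`; so this is NOT the second conjunct of `B5.Ineq110_114` on `settingTS` (whose rate is `α`-free and which also covers the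
`ten` kind `‖ζG_□∇*J‖_α`, not in the tree for `G_□`).  The print's seminorm (1.109) only takes pairs `|x − x′| ≤ 1`; `hqB` takes all
same-direction pairs, the far ones being harmless as shown. [cite: Balaban1984PropagatorsII, Prop. 2.5 p.246; Balaban1984PropagatorsI, Prop. 1.2 (1.111) p.35] -/
theorem ineq111_vec_TS (ha₀ : 0 < a₀) (ha₁ : a₀ ≤ a₁) :
    ∃ δ : ℝ, 0 < δ ∧ ∀ α : ℝ, 0 ≤ α → α < 1 → ∃ C : ℝ, 0 ≤ C ∧
      ∀ (i : TSIdx d L hd hL a₀ a₁) (J : BondSpace i.P) (ζ : Site i.P 0 → ℝ) (y y' : Site i.P i.j),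
      i.cutInTS ζ y → i.suppInTS (.vec J) y' →
      i.h1TS (.vec J) α ζ ≤ C * Real.exp (-(δ * (1 - α) * i.tdist y y')) * (i.hqS α ζ + i.cutSupTS ζ) * i.supNormTS (.vec J) := by
  classical
  obtain ⟨δH, hδH, HH⟩ := prop25_ineq111_grad d L hd hL ha₀ ha₁
  obtain ⟨δS, hδS, CS, hCS, hS⟩ := prop25_ineq110_grad d L hd hL ha₀ ha₁
  refine ⟨min δH δS, lt_min hδH hδS, fun α hα0 hα1 => ?_⟩
  obtain ⟨CH, hCH, hH⟩ := HH α hα0 hα1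
  refine ⟨CH * Real.exp ((1 + 2 * (δH * (1 - α))) * (1 + 1)) + 2 * (CS * Real.exp ((1 + 2 * δS) * 1)), by positivity, ?_⟩
  intro i J ζ y y' hζ hJ
  have h1α : 0 ≤ 1 - α := by linarith
  have hmin0 : 0 ≤ min δH δS := (lt_min hδH hδS).le
  have hL0 : (0 : ℝ) < L := by have := hL.2; exact_mod_cast (show 0 < L by omega)
  have hLj : (0 : ℝ) < (L : ℝ) ^ i.j := pow_pos hL0 _
  -- the data of the bound: `Z_h = ‖ζ‖_α`, `Z₀ = |ζ|`, `X = |J|`, the common decay factor `E`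
  have hZh0 : 0 ≤ i.hqS α ζ := i.hqS_nonneg α ζ
  have hZ00 : 0 ≤ i.cutSupTS ζ := i.cutSupTS_nonneg ζ
  have hX0 : 0 ≤ i.supNormTS (.vec J) := i.supNormTS_nonneg _
  have ht0 : 0 ≤ i.tdist y y' := i.tdist_nonneg y y'
  have hEH : Real.exp (-(δH * (1 - α) * i.tdist y y')) ≤ Real.exp (-(min δH δS * (1 - α) * i.tdist y y')) :=
    Real.exp_le_exp.2 (neg_le_neg (mul_le_mul_of_nonneg_right (mul_le_mul_of_nonneg_right (min_le_left _ _) h1α) ht0))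
  have hES : Real.exp (-(δS * i.tdist y y')) ≤ Real.exp (-(min δH δS * (1 - α) * i.tdist y y')) := by
    refine Real.exp_le_exp.2 (neg_le_neg (mul_le_mul_of_nonneg_right ?_ ht0))
    calc min δH δS * (1 - α) ≤ min δH δS * 1 := mul_le_mul_of_nonneg_left (by linarith) hmin0
      _ ≤ δS := by rw [mul_one]; exact min_le_right _ _
  have hRHS : 0 ≤ (CH * Real.exp ((1 + 2 * (δH * (1 - α))) * (1 + 1)) + 2 * (CS * Real.exp ((1 + 2 * δS) * 1))) *
      Real.exp (-(min δH δS * (1 - α) * i.tdist y y')) * (i.hqS α ζ + i.cutSupTS ζ) * i.supNormTS (.vec J) := by positivity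
  rw [h1TS_vec]
  refine LatticeNorms.supNorm_le hRHS fun lam _ => ?_
  rw [Real.norm_eq_abs, abs_of_nonneg (i.hqB_nonneg _ _)]
  refine i.hqB_le hRHS fun b₁ b₂ hne hdir => ?_
  have htpos : 0 < i.fdist b₁.src b₂.src := i.fdist_pos hne
  have htα : 0 < i.fdist b₁.src b₂.src ^ α := Real.rpow_pos_of_pos htpos _
  rw [div_le_iff₀ htα, smulB_Dl_G_apply, smulB_Dl_G_apply, abs_sub_comm]
  -- the sup part: `|ζ(b₋)(∇_λG_□J)(b)| ≤ |ζ|·O(1)e^{−δ_S|y−y′|}|J|` for every fine bond (p22's (1.110)₂ at `r = 1` where `ζ(b₋) ≠ 0`)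
  have hsup : ∀ b : PBond i.P 0,
      |ζ b.src * (((L : ℝ) ^ i.j) * ((tsV1 i.hc i.Λ' i.w).G J ⟨b.src.shift lam, b.dir⟩ - (tsV1 i.hc i.Λ' i.w).G J b))| ≤
        i.cutSupTS ζ * (CS * Real.exp ((1 + 2 * δS) * 1) * Real.exp (-(δS * i.tdist y y')) * i.supNormTS (.vec J)) := by
    intro b
    by_cases hz : ζ b.src = 0
    · rw [hz, zero_mul, abs_zero]; exact mul_nonneg hZ00 (mul_nonneg (by positivity) hX0)
    · rw [abs_mul]
      exact mul_le_mul (i.abs_le_cutSupTS ζ _)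
        (hS i.m i.K i.j i.hc i.hj i.Λ' i.w i.hw0 i.hw1 lam 1 zero_le_one J (i.supNormTS (.vec J)) hX0 y y' hJ
          (fun b' => i.abs_le_supNormTS_vec J b') b (hζ _ hz))
        (abs_nonneg _) hZ00
  by_cases hle : supDist b₁.src b₂.src ≤ L ^ i.j
  · -- near pairs `t ≤ 1`: p38's member theorem with `Z_h = ‖ζ‖_α`, `Z₀ = |ζ|`, `X = |J|`, `r = 1`
    have hζh : |ζ b₁.src - ζ b₂.src| ≤ i.hqS α ζ * (((supDist b₁.src b₂.src : ℕ) : ℝ) / (L : ℝ) ^ i.j) ^ α := by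
      rw [← i.fdist_eq b₁.src b₂.src]; exact i.abs_sub_le_hqS α ζ hne
    have hnear := hH i.m i.K i.j i.hc i.hj i.Λ' i.w i.hw0 i.hw1 lam 1 zero_le_one J (i.supNormTS (.vec J)) hX0 y y' hJ
      (fun b' => i.abs_le_supNormTS_vec J b') ζ (i.hqS α ζ) (i.cutSupTS ζ) hZh0 hZ00 hζ (fun x => i.abs_le_cutSupTS ζ x)
      b₁ b₂ hdir hle hζh
    rw [← i.fdist_eq b₁.src b₂.src] at hnear
    refine hnear.trans ?_
    have hfac : CH * Real.exp ((1 + 2 * (δH * (1 - α))) * (1 + 1)) * Real.exp (-(δH * (1 - α) * i.tdist y y')) ≤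
        (CH * Real.exp ((1 + 2 * (δH * (1 - α))) * (1 + 1)) + 2 * (CS * Real.exp ((1 + 2 * δS) * 1))) *
          Real.exp (-(min δH δS * (1 - α) * i.tdist y y')) :=
      calc CH * Real.exp ((1 + 2 * (δH * (1 - α))) * (1 + 1)) * Real.exp (-(δH * (1 - α) * i.tdist y y'))
          ≤ CH * Real.exp ((1 + 2 * (δH * (1 - α))) * (1 + 1)) * Real.exp (-(min δH δS * (1 - α) * i.tdist y y')) :=
            mul_le_mul_of_nonneg_left hEH (by positivity)
        _ ≤ _ := mul_le_mul_of_nonneg_right (le_add_of_nonneg_right (by positivity)) (Real.exp_nonneg _)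
    exact mul_le_mul_of_nonneg_right (mul_le_mul_of_nonneg_right (mul_le_mul_of_nonneg_right hfac (add_nonneg hZh0 hZ00)) hX0) htα.le
  · -- far pairs `t > 1`: the two values separately by the sup bound, and `t^α ≥ 1`
    have ht1 : 1 ≤ i.fdist b₁.src b₂.src := by
      rw [i.fdist_eq b₁.src b₂.src, le_div_iff₀ hLj, one_mul]
      exact_mod_cast (not_le.1 hle).le
    have htα1 : 1 ≤ i.fdist b₁.src b₂.src ^ α := Real.one_le_rpow ht1 hα0
    have hfar : |ζ b₁.src * (((L : ℝ) ^ i.j) * ((tsV1 i.hc i.Λ' i.w).G J ⟨b₁.src.shift lam, b₁.dir⟩ - (tsV1 i.hc i.Λ' i.w).G J b₁)) -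
        ζ b₂.src * (((L : ℝ) ^ i.j) * ((tsV1 i.hc i.Λ' i.w).G J ⟨b₂.src.shift lam, b₂.dir⟩ - (tsV1 i.hc i.Λ' i.w).G J b₂))| ≤
        2 * (i.cutSupTS ζ * (CS * Real.exp ((1 + 2 * δS) * 1) * Real.exp (-(δS * i.tdist y y')) * i.supNormTS (.vec J))) :=
      calc _ ≤ |ζ b₁.src * (((L : ℝ) ^ i.j) * ((tsV1 i.hc i.Λ' i.w).G J ⟨b₁.src.shift lam, b₁.dir⟩ - (tsV1 i.hc i.Λ' i.w).G J b₁))| +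
            |ζ b₂.src * (((L : ℝ) ^ i.j) * ((tsV1 i.hc i.Λ' i.w).G J ⟨b₂.src.shift lam, b₂.dir⟩ - (tsV1 i.hc i.Λ' i.w).G J b₂))| :=
            abs_sub _ _
        _ ≤ _ := by rw [two_mul]; exact add_le_add (hsup b₁) (hsup b₂)
    refine hfar.trans ?_
    have hstep : 2 * (i.cutSupTS ζ * (CS * Real.exp ((1 + 2 * δS) * 1) * Real.exp (-(δS * i.tdist y y')) * i.supNormTS (.vec J))) ≤
        (CH * Real.exp ((1 + 2 * (δH * (1 - α))) * (1 + 1)) + 2 * (CS * Real.exp ((1 + 2 * δS) * 1))) *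
          Real.exp (-(min δH δS * (1 - α) * i.tdist y y')) * (i.hqS α ζ + i.cutSupTS ζ) * i.supNormTS (.vec J) :=
      calc 2 * (i.cutSupTS ζ * (CS * Real.exp ((1 + 2 * δS) * 1) * Real.exp (-(δS * i.tdist y y')) * i.supNormTS (.vec J)))
          = 2 * (CS * Real.exp ((1 + 2 * δS) * 1)) * Real.exp (-(δS * i.tdist y y')) * i.cutSupTS ζ * i.supNormTS (.vec J) := by ring
        _ ≤ 2 * (CS * Real.exp ((1 + 2 * δS) * 1)) * Real.exp (-(min δH δS * (1 - α) * i.tdist y y')) * (i.hqS α ζ + i.cutSupTS ζ) *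
              i.supNormTS (.vec J) := by
            refine mul_le_mul_of_nonneg_right ?_ hX0
            exact mul_le_mul (mul_le_mul_of_nonneg_left hES (by positivity)) (le_add_of_nonneg_left hZh0) hZ00 (by positivity)
        _ ≤ _ := by
            refine mul_le_mul_of_nonneg_right (mul_le_mul_of_nonneg_right (mul_le_mul_of_nonneg_right
              (le_add_of_nonneg_left (by positivity)) (Real.exp_nonneg _)) (add_nonneg hZh0 hZ00)) hX0
    calc _ ≤ (CH * Real.exp ((1 + 2 * (δH * (1 - α))) * (1 + 1)) + 2 * (CS * Real.exp ((1 + 2 * δS) * 1))) *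
          Real.exp (-(min δH δS * (1 - α) * i.tdist y y')) * (i.hqS α ζ + i.cutSupTS ζ) * i.supNormTS (.vec J) := hstep
      _ = (CH * Real.exp ((1 + 2 * (δH * (1 - α))) * (1 + 1)) + 2 * (CS * Real.exp ((1 + 2 * δS) * 1))) *
          Real.exp (-(min δH δS * (1 - α) * i.tdist y y')) * (i.hqS α ζ + i.cutSupTS ζ) * i.supNormTS (.vec J) * 1 := (mul_one _).symm
      _ ≤ _ := mul_le_mul_of_nonneg_left htα1 hRHS

/-- **the same clause read on the census setting, with `δ₂` chosen before `α` on every range `0 ≤ α ≤ α₀ < 1`**: for every `α₀ < 1` there are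
`δ > 0` and `C_α ≥ 0` such that the `vec`-kind instance of `B5.Ineq110_114`'s second conjunct holds on `settingTS i` for every member and every
`α ≤ α₀` — `(settingTS i).h1 (vec J) α ζ ≤ C_α·e^{−δ·dist(y,y′)}·cutH α ζ·supNorm (vec J)` (rate `δ = δ₂(1 − α₀)`).  The print's quantifier
order (one `δ₂` for all `α < 1`) is NOT reached: the rate degrades as `α → 1` (GAPS G-B6-p38-01); the `ten`-kind member `‖ζG_□∇*J‖_α` is not
in the tree. [cite: Balaban1984PropagatorsII, Prop. 2.5 p.246; Balaban1984PropagatorsI, Prop. 1.2 (1.111) p.35] -/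
theorem ineq111_vec_settingTS_upto (ha₀ : 0 < a₀) (ha₁ : a₀ ≤ a₁) {α₀ : ℝ} (hα₀ : α₀ < 1) :
    ∃ δ : ℝ, 0 < δ ∧ ∀ α : ℝ, 0 ≤ α → α ≤ α₀ → ∃ C : ℝ, 0 ≤ C ∧ ∀ (i : TSIdx d L hd hL a₀ a₁)
      (J : BondSpace i.P) (ζ : (settingTS i).Cut) (y y' : (settingTS i).Site), (settingTS i).cutIn ζ y → (settingTS i).suppIn (LocTS.vec J) y' →
      (settingTS i).h1 (LocTS.vec J) α ζ ≤
        C * Real.exp (-(δ * (settingTS i).dist y y')) * (settingTS i).cutH α ζ * (settingTS i).supNorm (LocTS.vec J) := by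
  obtain ⟨δ, hδ, h⟩ := ineq111_vec_TS (d := d) (L := L) (hd := hd) (hL := hL) ha₀ ha₁
  have h1α₀ : 0 < 1 - α₀ := by linarith
  refine ⟨δ * (1 - α₀), mul_pos hδ h1α₀, fun α hα0 hαle => ?_⟩
  obtain ⟨C, hC, hCb⟩ := h α hα0 (lt_of_le_of_lt hαle hα₀)
  refine ⟨C, hC, fun i J ζ y y' hζ hJ => ?_⟩
  change i.h1TS (.vec J) α ζ ≤ C * Real.exp (-(δ * (1 - α₀) * i.tdist y y')) * (i.hqS α ζ + i.cutSupTS ζ) * i.supNormTS (.vec J)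
  refine (hCb i J ζ y y' hζ hJ).trans ?_
  have hX : 0 ≤ (i.hqS α ζ + i.cutSupTS ζ) * i.supNormTS (.vec J) :=
    mul_nonneg (add_nonneg (i.hqS_nonneg α ζ) (i.cutSupTS_nonneg ζ)) (i.supNormTS_nonneg _)
  have hE : Real.exp (-(δ * (1 - α) * i.tdist y y')) ≤ Real.exp (-(δ * (1 - α₀) * i.tdist y y')) :=
    Real.exp_le_exp.2 (neg_le_neg (mul_le_mul_of_nonneg_right (mul_le_mul_of_nonneg_left (by linarith) hδ.le) (i.tdist_nonneg y y')))
  have h2 := mul_le_mul_of_nonneg_right (mul_le_mul_of_nonneg_left hE hC) hX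
  simpa only [mul_assoc] using h2

end ClauseHolderGrad

/-! ## §13  (v1.3) The (1.111)₂ clause `‖ζG∇*J‖_α` on the `ten` kind from p38's file 9 (`B6Prop25HolderGDivTwoScaleV1`), and the (1.111)
clause on all source kinds -/

namespace TSIdx

variable {d L : ℕ} {hd : 1 ≤ d + 1} {hL : Odd L ∧ 1 < L} {a₀ a₁ : ℝ} (i : TSIdx d L hd hL a₀ a₁)

/-- the (1.111) entry on the `ten` kind (definitional): `‖ζG_□∇*J‖_α`, `∇*J = Σ_λ ∇_λ*J_λ`. [cite: Balaban1984PropagatorsI, Prop. 1.2 (1.111) p.35, dictionary] -/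
@[simp] theorem h1TS_ten (J : Fin i.P.d → BondSpace i.P) (α : ℝ) (ζ : Site i.P 0 → ℝ) :
    i.h1TS (.ten J) α ζ = i.hqB α (i.smulB ζ (i.G (i.divTS J))) := rfl

/-- the (1.111) entry vanishes on the `ten2` kind (source-kind device). [cite: Balaban1984PropagatorsI, Prop. 1.2 (1.111) p.35, dictionary] -/
@[simp] theorem h1TS_ten2 (J : Fin i.P.d → Fin i.P.d → BondSpace i.P) (α : ℝ) (ζ : Site i.P 0 → ℝ) : i.h1TS (.ten2 J) α ζ = 0 := rfl

/-- **from a near-pair cut bound and a sup bound to every same-direction pair quotient** (the bookkeeping of §12 as a lemma): if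
`|ζ(x)F(b₁) − ζ(x′)F(b₂)| ≤ A·t^α` for the same-direction pairs at `t = |x − x′|_∞/L^j ≤ 1`, `x ≠ x′`, and `|F(b)| ≤ B_s` wherever `ζ(b₋) ≠ 0`,
`|ζ| ≤ Z₀`, then every same-direction pair quotient of `ζF` is at most `A + 2Z₀B_s` (far pairs: `t^α ≥ 1`).
[cite: Balaban1984PropagatorsI, (1.109) p.35 («|x − x′| ≤ 1»), Prop. 1.2 (1.111) p.35] -/
theorem cut_quotient_le {α : ℝ} (hα0 : 0 ≤ α) (F : BondSpace i.P) (ζ : Site i.P 0 → ℝ) {A Bs Z0 : ℝ}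
    (hA : 0 ≤ A) (hBs : 0 ≤ Bs) (hZ0 : 0 ≤ Z0) (hζ0 : ∀ x, |ζ x| ≤ Z0)
    (hnear : ∀ b₁ b₂ : PBond i.P 0, b₁.src ≠ b₂.src → b₁.dir = b₂.dir → supDist b₁.src b₂.src ≤ L ^ i.j →
      |ζ b₁.src * F b₁ - ζ b₂.src * F b₂| ≤ A * i.fdist b₁.src b₂.src ^ α)
    (hfar : ∀ b : PBond i.P 0, ζ b.src ≠ 0 → |F b| ≤ Bs)
    {b₁ b₂ : PBond i.P 0} (hne : b₁.src ≠ b₂.src) (hdir : b₁.dir = b₂.dir) :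
    |ζ b₂.src * F b₂ - ζ b₁.src * F b₁| / i.fdist b₁.src b₂.src ^ α ≤ A + 2 * (Z0 * Bs) := by
  have htα : 0 < i.fdist b₁.src b₂.src ^ α := Real.rpow_pos_of_pos (i.fdist_pos hne) _
  rw [div_le_iff₀ htα, abs_sub_comm]
  have hZB : 0 ≤ Z0 * Bs := mul_nonneg hZ0 hBs
  have hcut : ∀ b : PBond i.P 0, |ζ b.src * F b| ≤ Z0 * Bs := by
    intro b
    by_cases hz : ζ b.src = 0
    · rw [hz, zero_mul, abs_zero]; exact hZB
    · rw [abs_mul]; exact mul_le_mul (hζ0 _) (hfar b hz) (abs_nonneg _) hZ0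
  by_cases hle : supDist b₁.src b₂.src ≤ L ^ i.j
  · exact (hnear b₁ b₂ hne hdir hle).trans (mul_le_mul_of_nonneg_right (le_add_of_nonneg_right (by positivity)) htα.le)
  · have hL0 : (0 : ℝ) < L := by have := hL.2; exact_mod_cast (show 0 < L by omega)
    have ht1 : 1 ≤ i.fdist b₁.src b₂.src := by
      rw [i.fdist_eq b₁.src b₂.src, le_div_iff₀ (pow_pos hL0 _), one_mul]
      exact_mod_cast (not_le.1 hle).le
    have htα1 : 1 ≤ i.fdist b₁.src b₂.src ^ α := Real.one_le_rpow ht1 hα0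
    calc |ζ b₁.src * F b₁ - ζ b₂.src * F b₂| ≤ |ζ b₁.src * F b₁| + |ζ b₂.src * F b₂| := abs_sub _ _
      _ ≤ Z0 * Bs + Z0 * Bs := add_le_add (hcut b₁) (hcut b₂)
      _ = (0 + 2 * (Z0 * Bs)) * 1 := by ring
      _ ≤ (A + 2 * (Z0 * Bs)) * i.fdist b₁.src b₂.src ^ α := mul_le_mul (add_le_add hA le_rfl) htα1 zero_le_one (by positivity)

end TSIdx

section ClauseHolderGDiv

variable {d L : ℕ} {hd : 1 ≤ d + 1} {hL : Odd L ∧ 1 < L} {a₀ a₁ : ℝ}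

open TSIdx
open B6Prop25HolderGDivTwoScaleV1 (prop25_ineq111_div)

/-- **THE (1.111)₂ CLAUSE `‖ζG_□∇*J‖_α` FOR THE GENUINE TWO-SCALE FAMILY ON THE `ten` KIND** (v1.3): there are `δ₂ > 0` (on `d, L, a₀, a₁`) and for
every `0 ≤ α < 1` a `C_α ≥ 0` such that for EVERY member, every family source `J = (J_λ)` with `supp J ⊂ Δ̃(y′)`, every cut-off `ζ` with `supp ζ ⊂ Δ̃(y)`:
`h1 (ten J) α ζ = ‖ζG_□∇*J‖_α ≤ C_α·e^{−δ₂|y−y′|}·(‖ζ‖_α + |ζ|)·|J|` — RATE `α`-FREE AS PRINTED.  `G_□∇*J = Σ_λ G_□∇_λ*J_λ` (`G_divTS_apply`); per `λ`,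
the near pairs (`t ≤ 1`) are p38's `prop25_ineq111_div` (p331063; `Z_h = ‖ζ‖_α`, `Z₀ = |ζ|`, `X = |J|`, `r = 1`) and the sup values p22's
`prop25_ineq110_Gdiv` (the (1.110)₃ bound at `r = 1`), assembled by `cut_quotient_le` (far pairs `t > 1`: `t^α ≥ 1`); constant `×(d+1)`.
[cite: Balaban1984PropagatorsII, Prop. 2.5 p.246; Balaban1984PropagatorsI, Prop. 1.2 (1.111) p.35] -/
theorem ineq111_ten_TS (ha₀ : 0 < a₀) (ha₁ : a₀ ≤ a₁) :
    ∃ δ : ℝ, 0 < δ ∧ ∀ α : ℝ, 0 ≤ α → α < 1 → ∃ C : ℝ, 0 ≤ C ∧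
      ∀ (i : TSIdx d L hd hL a₀ a₁) (J : Fin i.P.d → BondSpace i.P) (ζ : Site i.P 0 → ℝ) (y y' : Site i.P i.j),
      i.cutInTS ζ y → i.suppInTS (.ten J) y' →
      i.h1TS (.ten J) α ζ ≤ C * Real.exp (-(δ * i.tdist y y')) * (i.hqS α ζ + i.cutSupTS ζ) * i.supNormTS (.ten J) := by
  classical
  obtain ⟨δH, hδH, HH⟩ := prop25_ineq111_div d L hd hL ha₀ ha₁
  obtain ⟨δS, hδS, CS, hCS, hS⟩ := prop25_ineq110_Gdiv d L hd hL ha₀ ha₁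
  refine ⟨min δH δS, lt_min hδH hδS, fun α hα0 hα1 => ?_⟩
  obtain ⟨CH, hCH, hH⟩ := HH α hα0 hα1
  refine ⟨((d : ℝ) + 1) * (CH * Real.exp ((1 + 2 * δH) * (1 + 1)) + 2 * (CS * Real.exp ((1 + 2 * δS) * 1))), by positivity, ?_⟩
  intro i J ζ y y' hζ hJ
  have hmin0 : 0 ≤ min δH δS := (lt_min hδH hδS).le
  have hZh0 : 0 ≤ i.hqS α ζ := i.hqS_nonneg α ζ
  have hZ00 : 0 ≤ i.cutSupTS ζ := i.cutSupTS_nonneg ζ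
  have hX0 : 0 ≤ i.supNormTS (.ten J) := i.supNormTS_nonneg _
  have ht0 : 0 ≤ i.tdist y y' := i.tdist_nonneg y y'
  have hEH : Real.exp (-(δH * i.tdist y y')) ≤ Real.exp (-(min δH δS * i.tdist y y')) :=
    Real.exp_le_exp.2 (neg_le_neg (mul_le_mul_of_nonneg_right (min_le_left _ _) ht0))
  have hES : Real.exp (-(δS * i.tdist y y')) ≤ Real.exp (-(min δH δS * i.tdist y y')) :=
    Real.exp_le_exp.2 (neg_le_neg (mul_le_mul_of_nonneg_right (min_le_right _ _) ht0))
  have hRHS : 0 ≤ ((d : ℝ) + 1) * (CH * Real.exp ((1 + 2 * δH) * (1 + 1)) + 2 * (CS * Real.exp ((1 + 2 * δS) * 1))) *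
      Real.exp (-(min δH δS * i.tdist y y')) * (i.hqS α ζ + i.cutSupTS ζ) * i.supNormTS (.ten J) := by positivity
  -- (a) the near-pair cut bound for `G_□∇*J = Σ_λ G_□∇_λ*J_λ`, per `λ` from p38's member theorem
  have hnear : ∀ b₁ b₂ : PBond i.P 0, b₁.src ≠ b₂.src → b₁.dir = b₂.dir → supDist b₁.src b₂.src ≤ L ^ i.j →
      |ζ b₁.src * i.G (i.divTS J) b₁ - ζ b₂.src * i.G (i.divTS J) b₂| ≤
        ((d : ℝ) + 1) * (CH * Real.exp ((1 + 2 * δH) * (1 + 1)) * Real.exp (-(δH * i.tdist y y')) * (i.hqS α ζ + i.cutSupTS ζ) *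
          i.supNormTS (.ten J)) * i.fdist b₁.src b₂.src ^ α := by
    intro b₁ b₂ hne hdir hle
    have hζh : |ζ b₁.src - ζ b₂.src| ≤ i.hqS α ζ * (((supDist b₁.src b₂.src : ℕ) : ℝ) / (L : ℝ) ^ i.j) ^ α := by
      rw [← i.fdist_eq b₁.src b₂.src]; exact i.abs_sub_le_hqS α ζ hne
    have hterm : ∀ lam : Fin i.P.d, |ζ b₁.src * i.G (i.Dla lam (J lam)) b₁ - ζ b₂.src * i.G (i.Dla lam (J lam)) b₂| ≤
        CH * Real.exp ((1 + 2 * δH) * (1 + 1)) * Real.exp (-(δH * i.tdist y y')) * (i.hqS α ζ + i.cutSupTS ζ) * i.supNormTS (.ten J) *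
          i.fdist b₁.src b₂.src ^ α := by
      intro lam
      have h1 := hH i.m i.K i.j i.hc i.hj i.Λ' i.w i.hw0 i.hw1 lam 1 zero_le_one (J lam) (i.supNormTS (.ten J)) hX0 y y' (hJ lam)
        (fun b' => i.abs_le_supNormTS_ten J lam b') ζ (i.hqS α ζ) (i.cutSupTS ζ) hZh0 hZ00 hζ (fun x => i.abs_le_cutSupTS ζ x)
        b₁ b₂ hdir hle hζh
      rw [← i.fdist_eq b₁.src b₂.src] at h1
      exact h1
    rw [G_divTS_apply, G_divTS_apply, Finset.mul_sum, Finset.mul_sum, ← Finset.sum_sub_distrib]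
    refine (Finset.abs_sum_le_sum_abs _ _).trans ?_
    calc ∑ lam, |ζ b₁.src * i.G (i.Dla lam (J lam)) b₁ - ζ b₂.src * i.G (i.Dla lam (J lam)) b₂|
        ≤ ∑ _lam : Fin i.P.d, CH * Real.exp ((1 + 2 * δH) * (1 + 1)) * Real.exp (-(δH * i.tdist y y')) * (i.hqS α ζ + i.cutSupTS ζ) *
            i.supNormTS (.ten J) * i.fdist b₁.src b₂.src ^ α := Finset.sum_le_sum fun lam _ => hterm lam
      _ = _ := by
          rw [Finset.sum_const, Finset.card_univ, Fintype.card_fin, nsmul_eq_mul]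
          push_cast
          ring
  -- (b) the sup values `|(G_□∇*J)(b)|` where `ζ(b₋) ≠ 0` (p22's (1.110)₃ bound at `r = 1`, summed over `λ`)
  have hfar : ∀ b : PBond i.P 0, ζ b.src ≠ 0 →
      |i.G (i.divTS J) b| ≤ ((d : ℝ) + 1) * (CS * Real.exp ((1 + 2 * δS) * 1) * Real.exp (-(δS * i.tdist y y')) * i.supNormTS (.ten J)) := by
    intro b hz
    rw [G_divTS_apply]
    refine (Finset.abs_sum_le_sum_abs _ _).trans ?_
    calc ∑ lam, |i.G (i.Dla lam (J lam)) b|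
        ≤ ∑ _lam : Fin i.P.d, CS * Real.exp ((1 + 2 * δS) * 1) * Real.exp (-(δS * i.tdist y y')) * i.supNormTS (.ten J) :=
          Finset.sum_le_sum fun lam _ => hS i.m i.K i.j i.hc i.hj i.Λ' i.w i.hw0 i.hw1 lam 1 zero_le_one (J lam) (i.supNormTS (.ten J)) hX0
            y y' (hJ lam) (fun b' => i.abs_le_supNormTS_ten J lam b') b (hζ _ hz)
      _ = _ := by
          rw [Finset.sum_const, Finset.card_univ, Fintype.card_fin, nsmul_eq_mul]
          push_cast
          ring
  -- (c) assembly over all same-direction pairs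
  rw [h1TS_ten]
  refine i.hqB_le hRHS fun b₁ b₂ hne hdir => ?_
  rw [smulB_apply, smulB_apply]
  have hA0 : 0 ≤ ((d : ℝ) + 1) * (CH * Real.exp ((1 + 2 * δH) * (1 + 1)) * Real.exp (-(δH * i.tdist y y')) * (i.hqS α ζ + i.cutSupTS ζ) *
      i.supNormTS (.ten J)) := by positivity
  have hB0 : 0 ≤ ((d : ℝ) + 1) * (CS * Real.exp ((1 + 2 * δS) * 1) * Real.exp (-(δS * i.tdist y y')) * i.supNormTS (.ten J)) := by positivity
  refine (i.cut_quotient_le hα0 (i.G (i.divTS J)) ζ hA0 hB0 hZ00 (fun x => i.abs_le_cutSupTS ζ x) hnear hfar hne hdir).trans ?_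
  have hA_le : ((d : ℝ) + 1) * (CH * Real.exp ((1 + 2 * δH) * (1 + 1)) * Real.exp (-(δH * i.tdist y y')) * (i.hqS α ζ + i.cutSupTS ζ) *
      i.supNormTS (.ten J)) ≤ ((d : ℝ) + 1) * (CH * Real.exp ((1 + 2 * δH) * (1 + 1)) * Real.exp (-(min δH δS * i.tdist y y')) *
        (i.hqS α ζ + i.cutSupTS ζ) * i.supNormTS (.ten J)) :=
    mul_le_mul_of_nonneg_left (mul_le_mul_of_nonneg_right (mul_le_mul_of_nonneg_right
      (mul_le_mul_of_nonneg_left hEH (by positivity)) (add_nonneg hZh0 hZ00)) hX0) (by positivity)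
  have hB_le : 2 * (i.cutSupTS ζ * (((d : ℝ) + 1) * (CS * Real.exp ((1 + 2 * δS) * 1) * Real.exp (-(δS * i.tdist y y')) * i.supNormTS (.ten J)))) ≤
      2 * ((i.hqS α ζ + i.cutSupTS ζ) * (((d : ℝ) + 1) * (CS * Real.exp ((1 + 2 * δS) * 1) * Real.exp (-(min δH δS * i.tdist y y')) *
        i.supNormTS (.ten J)))) :=
    mul_le_mul_of_nonneg_left (mul_le_mul (le_add_of_nonneg_left hZh0)
      (mul_le_mul_of_nonneg_left (mul_le_mul_of_nonneg_right (mul_le_mul_of_nonneg_left hES (by positivity)) hX0) (by positivity))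
      (by positivity) (add_nonneg hZh0 hZ00)) (by norm_num)
  calc _ ≤ _ := add_le_add hA_le hB_le
    _ = ((d : ℝ) + 1) * (CH * Real.exp ((1 + 2 * δH) * (1 + 1)) + 2 * (CS * Real.exp ((1 + 2 * δS) * 1))) *
          Real.exp (-(min δH δS * i.tdist y y')) * (i.hqS α ζ + i.cutSupTS ζ) * i.supNormTS (.ten J) := by ring

/-- **the (1.111)₂ clause read on the census setting in the PRINTED QUANTIFIER ORDER** (v1.3): there are `δ₂ > 0` and a constant function `C_α`
(both chosen before the member) such that for every member, every `0 ≤ α < 1`, every family source `J`, cut-off `ζ` and `y, y′`: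
`(settingTS i).h1 (ten J) α ζ ≤ C_α·e^{−δ₂·dist(y,y′)}·cutH α ζ·supNorm (ten J)` — the `ten`-kind instance of `B5.Ineq110_114`'s second conjunct,
as printed (rate `α`-free). [cite: Balaban1984PropagatorsII, Prop. 2.5 p.246; Balaban1984PropagatorsI, Prop. 1.2 (1.111) p.35] -/
theorem ineq111_ten_settingTS (ha₀ : 0 < a₀) (ha₁ : a₀ ≤ a₁) :
    ∃ δ : ℝ, 0 < δ ∧ ∃ Cα : ℝ → ℝ, ∀ (i : TSIdx d L hd hL a₀ a₁) (α : ℝ) (J : Fin i.P.d → BondSpace i.P) (ζ : (settingTS i).Cut)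
      (y y' : (settingTS i).Site), 0 ≤ α → α < 1 → (settingTS i).cutIn ζ y → (settingTS i).suppIn (LocTS.ten J) y' →
      (settingTS i).h1 (LocTS.ten J) α ζ ≤
        Cα α * Real.exp (-(δ * (settingTS i).dist y y')) * (settingTS i).cutH α ζ * (settingTS i).supNorm (LocTS.ten J) := by
  classical
  obtain ⟨δ, hδ, h⟩ := ineq111_ten_TS (d := d) (L := L) (hd := hd) (hL := hL) ha₀ ha₁
  refine ⟨δ, hδ, fun α => if hα : 0 ≤ α ∧ α < 1 then Classical.choose (h α hα.1 hα.2) else 0, ?_⟩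
  intro i α J ζ y y' hα0 hα1 hζ hJ
  have hC : (if hα : 0 ≤ α ∧ α < 1 then Classical.choose (h α hα.1 hα.2) else 0) = Classical.choose (h α hα0 hα1) := dif_pos ⟨hα0, hα1⟩
  change i.h1TS (LocTS.ten J) α ζ ≤ (if hα : 0 ≤ α ∧ α < 1 then Classical.choose (h α hα.1 hα.2) else 0) * Real.exp (-(δ * i.tdist y y')) *
    (i.hqS α ζ + i.cutSupTS ζ) * i.supNormTS (LocTS.ten J)
  rw [hC]
  exact (Classical.choose_spec (h α hα0 hα1)).2 i J ζ y y' hζ hJ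

end ClauseHolderGDiv

/-! ## §14  (v1.3) The (1.111) clause on all source kinds, and its reading on the census setting on every `α`-range `[0, α₀]` -/

section ClauseHolderAll

variable {d L : ℕ} {hd : 1 ≤ d + 1} {hL : Odd L ∧ 1 < L} {a₀ a₁ : ℝ}

open TSIdx

/-- **THE (1.111) CLAUSE FOR THE GENUINE TWO-SCALE FAMILY ON ALL SOURCE KINDS** (v1.3): there is `δ > 0` and for every `0 ≤ α < 1` a `C_α ≥ 0` such
that for EVERY member, every source `J` (any kind) with `supp J ⊂ Δ̃(y′)` and cut-off `ζ` with `supp ζ ⊂ Δ̃(y)`: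
`h1 J α ζ ≤ C_α·e^{−δ(1−α)|y−y′|}·(‖ζ‖_α + |ζ|)·|J|` — `vec`: §12 `ineq111_vec_TS` (rate `δ₂(1−α)`), `ten`: §13 `ineq111_ten_TS` (rate `δ₂ ≥ δ₂(1−α)`),
`ten2`: the entry is `0`.  DIVERGENCE (declared): the common rate `δ(1−α)` degrades as `α → 1` because of the `vec` member (GAPS G-B6-p38-01);
the print has one `δ₂(d, L)`. [cite: Balaban1984PropagatorsII, Prop. 2.5 p.246; Balaban1984PropagatorsI, Prop. 1.2 (1.111) p.35] -/
theorem ineq111_TS (ha₀ : 0 < a₀) (ha₁ : a₀ ≤ a₁) :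
    ∃ δ : ℝ, 0 < δ ∧ ∀ α : ℝ, 0 ≤ α → α < 1 → ∃ C : ℝ, 0 ≤ C ∧
      ∀ (i : TSIdx d L hd hL a₀ a₁) (J : i.LocTS) (ζ : Site i.P 0 → ℝ) (y y' : Site i.P i.j),
      i.cutInTS ζ y → i.suppInTS J y' →
      i.h1TS J α ζ ≤ C * Real.exp (-(δ * (1 - α) * i.tdist y y')) * (i.hqS α ζ + i.cutSupTS ζ) * i.supNormTS J := by
  obtain ⟨δ₁, hδ₁, h₁⟩ := ineq111_vec_TS (d := d) (L := L) (hd := hd) (hL := hL) ha₀ ha₁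
  obtain ⟨δ₂, hδ₂, h₂⟩ := ineq111_ten_TS (d := d) (L := L) (hd := hd) (hL := hL) ha₀ ha₁
  refine ⟨min δ₁ δ₂, lt_min hδ₁ hδ₂, fun α hα0 hα1 => ?_⟩
  obtain ⟨C₁, hC₁, h₁'⟩ := h₁ α hα0 hα1
  obtain ⟨C₂, hC₂, h₂'⟩ := h₂ α hα0 hα1
  refine ⟨max C₁ C₂, le_max_of_le_left hC₁, ?_⟩
  intro i J ζ y y' hζ hJ
  have h1α : 0 ≤ 1 - α := by linarith
  have hmin0 : 0 ≤ min δ₁ δ₂ := (lt_min hδ₁ hδ₂).le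
  have hC0 : 0 ≤ max C₁ C₂ := le_max_of_le_left hC₁
  have hX : 0 ≤ (i.hqS α ζ + i.cutSupTS ζ) * i.supNormTS J :=
    mul_nonneg (add_nonneg (i.hqS_nonneg α ζ) (i.cutSupTS_nonneg ζ)) (i.supNormTS_nonneg J)
  have ht := i.tdist_nonneg y y'
  -- weakening the rate and enlarging the constant
  have mono : ∀ {δ' C' : ℝ}, min δ₁ δ₂ * (1 - α) ≤ δ' → C' ≤ max C₁ C₂ →
      C' * Real.exp (-(δ' * i.tdist y y')) * ((i.hqS α ζ + i.cutSupTS ζ) * i.supNormTS J) ≤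
        max C₁ C₂ * Real.exp (-(min δ₁ δ₂ * (1 - α) * i.tdist y y')) * ((i.hqS α ζ + i.cutSupTS ζ) * i.supNormTS J) := by
    intro δ' C' hδ' hC'
    refine mul_le_mul_of_nonneg_right ?_ hX
    exact mul_le_mul hC' (Real.exp_le_exp.2 (neg_le_neg (mul_le_mul_of_nonneg_right hδ' ht))) (Real.exp_nonneg _) hC0
  have hδv : min δ₁ δ₂ * (1 - α) ≤ δ₁ * (1 - α) := mul_le_mul_of_nonneg_right (min_le_left _ _) h1α
  have hδt : min δ₁ δ₂ * (1 - α) ≤ δ₂ :=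
    calc min δ₁ δ₂ * (1 - α) ≤ min δ₁ δ₂ * 1 := mul_le_mul_of_nonneg_left (by linarith) hmin0
      _ ≤ δ₂ := by rw [mul_one]; exact min_le_right _ _
  cases J with
  | vec J =>
    have h := h₁' i J ζ y y' hζ hJ
    rw [mul_assoc] at h
    rw [mul_assoc]
    exact h.trans (mono hδv (le_max_left _ _))
  | ten J =>
    have h := h₂' i J ζ y y' hζ hJ
    rw [mul_assoc] at h
    rw [mul_assoc]
    exact h.trans (mono hδt (le_max_right _ _))
  | ten2 J =>
    rw [h1TS_ten2, mul_assoc]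
    exact mul_nonneg (mul_nonneg hC0 (Real.exp_nonneg _)) hX

/-- **THE SECOND CONJUNCT OF `B5.Ineq110_114` ON THE CENSUS SETTING, ON EVERY `α`-RANGE `[0, α₀]` WITH `α₀ < 1`** (v1.3): for every `α₀ < 1` there are
`δ > 0` and a constant function `C_α` (both chosen before the member) such that for EVERY member of the genuine two-scale family and ALL source
kinds, `0 ≤ α ≤ α₀`, `supp ζ ⊂ Δ̃(y)`, `supp J ⊂ Δ̃(y′)`: `(settingTS i).h1 J α ζ ≤ C_α·e^{−δ·dist(y,y′)}·cutH α ζ·supNorm J` — verbatim the second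
conjunct of `B5.Ineq110_114 (settingTS i) C Cα Cε Cαε δ` except that `α < 1` is replaced by `α ≤ α₀` (`δ = δ₁(1 − α₀)`).  The printed order (one `δ₂`
for all `α < 1`) is NOT reached (GAPS G-B6-p38-01); for the `ten` kind alone it is (`ineq111_ten_settingTS`).
[cite: Balaban1984PropagatorsII, Prop. 2.5 p.246; Balaban1984PropagatorsI, Prop. 1.2 (1.111) p.35] -/
theorem ineq111_settingTS_upto (ha₀ : 0 < a₀) (ha₁ : a₀ ≤ a₁) {α₀ : ℝ} (hα₀ : α₀ < 1) :
    ∃ δ : ℝ, 0 < δ ∧ ∃ Cα : ℝ → ℝ, ∀ (i : TSIdx d L hd hL a₀ a₁) (α : ℝ) (J : (settingTS i).Loc) (ζ : (settingTS i).Cut)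
      (y y' : (settingTS i).Site), 0 ≤ α → α ≤ α₀ → (settingTS i).cutIn ζ y → (settingTS i).suppIn J y' →
      (settingTS i).h1 J α ζ ≤ Cα α * Real.exp (-(δ * (settingTS i).dist y y')) * (settingTS i).cutH α ζ * (settingTS i).supNorm J := by
  classical
  obtain ⟨δ, hδ, h⟩ := ineq111_TS (d := d) (L := L) (hd := hd) (hL := hL) ha₀ ha₁
  have h1α₀ : 0 < 1 - α₀ := by linarith
  refine ⟨δ * (1 - α₀), mul_pos hδ h1α₀, fun α => if hα : 0 ≤ α ∧ α < 1 then Classical.choose (h α hα.1 hα.2) else 0, ?_⟩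
  intro i α J ζ y y' hα0 hαle hζ hJ
  have hα1 : α < 1 := lt_of_le_of_lt hαle hα₀
  have hC : (if hα : 0 ≤ α ∧ α < 1 then Classical.choose (h α hα.1 hα.2) else 0) = Classical.choose (h α hα0 hα1) := dif_pos ⟨hα0, hα1⟩
  have hspec := Classical.choose_spec (h α hα0 hα1)
  change i.h1TS J α ζ ≤ (if hα : 0 ≤ α ∧ α < 1 then Classical.choose (h α hα.1 hα.2) else 0) * Real.exp (-(δ * (1 - α₀) * i.tdist y y')) *
    (i.hqS α ζ + i.cutSupTS ζ) * i.supNormTS J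
  rw [hC]
  refine (hspec.2 i J ζ y y' hζ hJ).trans ?_
  have hX : 0 ≤ (i.hqS α ζ + i.cutSupTS ζ) * i.supNormTS J :=
    mul_nonneg (add_nonneg (i.hqS_nonneg α ζ) (i.cutSupTS_nonneg ζ)) (i.supNormTS_nonneg J)
  have hE : Real.exp (-(δ * (1 - α) * i.tdist y y')) ≤ Real.exp (-(δ * (1 - α₀) * i.tdist y y')) :=
    Real.exp_le_exp.2 (neg_le_neg (mul_le_mul_of_nonneg_right (mul_le_mul_of_nonneg_left (by linarith) hδ.le) (i.tdist_nonneg y y')))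
  have h2 := mul_le_mul_of_nonneg_right (mul_le_mul_of_nonneg_left hE hspec.1) hX
  simpa only [mul_assoc] using h2

end ClauseHolderAll

/-! ## §15  (v1.4) The (1.111) clause at the printed `α`-free rate (r03's `B6Prop25HolderRateFreeV1`), and the second conjunct of
`B5.Ineq110_114` on the census setting in the printed quantifier order -/

section ClauseHolderRateFree

variable {d L : ℕ} {hd : 1 ≤ d + 1} {hL : Odd L ∧ 1 < L} {a₀ a₁ : ℝ}

open TSIdx
open B6Prop25HolderRateFreeV1 (prop25_ineq111_grad_rateFree)

/-- **THE (1.111)₁ CLAUSE `‖ζ∇G_□J‖_α` ON THE `vec` KIND AT THE PRINTED `α`-FREE RATE** (v1.4): there is `δ₂ > 0` (on `d, L, a₀, a₁`, NOT on `α`)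
and for every `0 ≤ α < 1` a `C_α ≥ 0` such that for EVERY member, every fine bond field `J` with `supp J ⊂ Δ̃(y′)`, every cut-off `ζ` with
`supp ζ ⊂ Δ̃(y)`:  `h1 (vec J) α ζ = max_λ ‖ζ∇_λG_□J‖_α ≤ C_α·e^{−δ₂|y−y′|}·(‖ζ‖_α + |ζ|)·|J|` — §12's clause with r03's
`prop25_ineq111_grad_rateFree` (the `_rateFree` twin of p38's `prop25_ineq111_grad`; the `∇H_j` factor through (2.130) = [4] (1.103) and
[BalabanImbrieJaffe1985] (7.2.2)) for the near pairs `t ≤ 1` (`Z_h = ‖ζ‖_α`, `Z₀ = |ζ|`, `X = |J|`, `r = 1`), p22's `prop25_ineq110_grad` for the sup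
values, assembled over all same-direction pairs by §13's `cut_quotient_le` (far pairs: `t^α ≥ 1`).  This removes the divergence declared in §12/§14:
the rate no longer degrades as `α → 1` («This constant depends on d and L only»).
[cite: Balaban1984PropagatorsII, Prop. 2.5 p.246; Balaban1984PropagatorsI, Prop. 1.2 (1.111) p.35] -/
theorem ineq111_vec_TS_rateFree (ha₀ : 0 < a₀) (ha₁ : a₀ ≤ a₁) :
    ∃ δ : ℝ, 0 < δ ∧ ∀ α : ℝ, 0 ≤ α → α < 1 → ∃ C : ℝ, 0 ≤ C ∧
      ∀ (i : TSIdx d L hd hL a₀ a₁) (J : BondSpace i.P) (ζ : Site i.P 0 → ℝ) (y y' : Site i.P i.j),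
      i.cutInTS ζ y → i.suppInTS (.vec J) y' →
      i.h1TS (.vec J) α ζ ≤ C * Real.exp (-(δ * i.tdist y y')) * (i.hqS α ζ + i.cutSupTS ζ) * i.supNormTS (.vec J) := by
  classical
  obtain ⟨δH, hδH, HH⟩ := prop25_ineq111_grad_rateFree d L hd hL ha₀ ha₁
  obtain ⟨δS, hδS, CS, hCS, hS⟩ := prop25_ineq110_grad d L hd hL ha₀ ha₁
  refine ⟨min δH δS, lt_min hδH hδS, fun α hα0 hα1 => ?_⟩
  obtain ⟨CH, hCH, hH⟩ := HH α hα0 hα1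
  refine ⟨CH * Real.exp ((1 + 2 * δH) * (1 + 1)) + 2 * (CS * Real.exp ((1 + 2 * δS) * 1)), by positivity, ?_⟩
  intro i J ζ y y' hζ hJ
  have hZh0 : 0 ≤ i.hqS α ζ := i.hqS_nonneg α ζ
  have hZ00 : 0 ≤ i.cutSupTS ζ := i.cutSupTS_nonneg ζ
  have hX0 : 0 ≤ i.supNormTS (.vec J) := i.supNormTS_nonneg _
  have ht0 : 0 ≤ i.tdist y y' := i.tdist_nonneg y y'
  have hEH : Real.exp (-(δH * i.tdist y y')) ≤ Real.exp (-(min δH δS * i.tdist y y')) :=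
    Real.exp_le_exp.2 (neg_le_neg (mul_le_mul_of_nonneg_right (min_le_left _ _) ht0))
  have hES : Real.exp (-(δS * i.tdist y y')) ≤ Real.exp (-(min δH δS * i.tdist y y')) :=
    Real.exp_le_exp.2 (neg_le_neg (mul_le_mul_of_nonneg_right (min_le_right _ _) ht0))
  have hRHS : 0 ≤ (CH * Real.exp ((1 + 2 * δH) * (1 + 1)) + 2 * (CS * Real.exp ((1 + 2 * δS) * 1))) *
      Real.exp (-(min δH δS * i.tdist y y')) * (i.hqS α ζ + i.cutSupTS ζ) * i.supNormTS (.vec J) := by positivity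
  rw [h1TS_vec]
  refine LatticeNorms.supNorm_le hRHS fun lam _ => ?_
  rw [Real.norm_eq_abs, abs_of_nonneg (i.hqB_nonneg _ _)]
  -- (a) the near-pair cut bound, from r03's member theorem at `r = 1`
  have hnear : ∀ b₁ b₂ : PBond i.P 0, b₁.src ≠ b₂.src → b₁.dir = b₂.dir → supDist b₁.src b₂.src ≤ L ^ i.j →
      |ζ b₁.src * i.Dl lam (i.G J) b₁ - ζ b₂.src * i.Dl lam (i.G J) b₂| ≤
        (CH * Real.exp ((1 + 2 * δH) * (1 + 1)) * Real.exp (-(δH * i.tdist y y')) * (i.hqS α ζ + i.cutSupTS ζ) * i.supNormTS (.vec J)) *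
          i.fdist b₁.src b₂.src ^ α := by
    intro b₁ b₂ hne hdir hle
    have hζh : |ζ b₁.src - ζ b₂.src| ≤ i.hqS α ζ * (((supDist b₁.src b₂.src : ℕ) : ℝ) / (L : ℝ) ^ i.j) ^ α := by
      rw [← i.fdist_eq b₁.src b₂.src]; exact i.abs_sub_le_hqS α ζ hne
    have h1 := hH i.m i.K i.j i.hc i.hj i.Λ' i.w i.hw0 i.hw1 lam 1 zero_le_one J (i.supNormTS (.vec J)) hX0 y y' hJ
      (fun b' => i.abs_le_supNormTS_vec J b') ζ (i.hqS α ζ) (i.cutSupTS ζ) hZh0 hZ00 hζ (fun x => i.abs_le_cutSupTS ζ x)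
      b₁ b₂ hdir hle hζh
    rw [← i.fdist_eq b₁.src b₂.src] at h1
    rw [Dl_apply, Dl_apply]
    exact h1
  -- (b) the sup values `|(∇_λG_□J)(b)|` where `ζ(b₋) ≠ 0` (p22's (1.110)₂ bound at `r = 1`)
  have hfar : ∀ b : PBond i.P 0, ζ b.src ≠ 0 →
      |i.Dl lam (i.G J) b| ≤ CS * Real.exp ((1 + 2 * δS) * 1) * Real.exp (-(δS * i.tdist y y')) * i.supNormTS (.vec J) := by
    intro b hz
    rw [Dl_apply]
    exact hS i.m i.K i.j i.hc i.hj i.Λ' i.w i.hw0 i.hw1 lam 1 zero_le_one J (i.supNormTS (.vec J)) hX0 y y' hJ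
      (fun b' => i.abs_le_supNormTS_vec J b') b (hζ _ hz)
  -- (c) assembly over all same-direction pairs
  refine i.hqB_le hRHS fun b₁ b₂ hne hdir => ?_
  rw [smulB_apply, smulB_apply]
  have hA0 : 0 ≤ CH * Real.exp ((1 + 2 * δH) * (1 + 1)) * Real.exp (-(δH * i.tdist y y')) * (i.hqS α ζ + i.cutSupTS ζ) *
      i.supNormTS (.vec J) := by positivity
  have hB0 : 0 ≤ CS * Real.exp ((1 + 2 * δS) * 1) * Real.exp (-(δS * i.tdist y y')) * i.supNormTS (.vec J) := by positivity
  refine (i.cut_quotient_le hα0 (i.Dl lam (i.G J)) ζ hA0 hB0 hZ00 (fun x => i.abs_le_cutSupTS ζ x) hnear hfar hne hdir).trans ?_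
  have hA_le : CH * Real.exp ((1 + 2 * δH) * (1 + 1)) * Real.exp (-(δH * i.tdist y y')) * (i.hqS α ζ + i.cutSupTS ζ) * i.supNormTS (.vec J) ≤
      CH * Real.exp ((1 + 2 * δH) * (1 + 1)) * Real.exp (-(min δH δS * i.tdist y y')) * (i.hqS α ζ + i.cutSupTS ζ) * i.supNormTS (.vec J) :=
    mul_le_mul_of_nonneg_right (mul_le_mul_of_nonneg_right (mul_le_mul_of_nonneg_left hEH (by positivity)) (add_nonneg hZh0 hZ00)) hX0
  have hB_le : 2 * (i.cutSupTS ζ * (CS * Real.exp ((1 + 2 * δS) * 1) * Real.exp (-(δS * i.tdist y y')) * i.supNormTS (.vec J))) ≤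
      2 * ((i.hqS α ζ + i.cutSupTS ζ) * (CS * Real.exp ((1 + 2 * δS) * 1) * Real.exp (-(min δH δS * i.tdist y y')) * i.supNormTS (.vec J))) :=
    mul_le_mul_of_nonneg_left (mul_le_mul (le_add_of_nonneg_left hZh0)
      (mul_le_mul_of_nonneg_right (mul_le_mul_of_nonneg_left hES (by positivity)) hX0) (by positivity) (add_nonneg hZh0 hZ00)) (by norm_num)
  calc _ ≤ _ := add_le_add hA_le hB_le
    _ = (CH * Real.exp ((1 + 2 * δH) * (1 + 1)) + 2 * (CS * Real.exp ((1 + 2 * δS) * 1))) *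
          Real.exp (-(min δH δS * i.tdist y y')) * (i.hqS α ζ + i.cutSupTS ζ) * i.supNormTS (.vec J) := by ring

/-- **THE (1.111) CLAUSE FOR THE GENUINE TWO-SCALE FAMILY ON ALL SOURCE KINDS AT AN `α`-FREE RATE** (v1.4): there is `δ > 0` and for every `0 ≤ α < 1`
a `C_α ≥ 0` such that for EVERY member, every source `J` (any kind) with `supp J ⊂ Δ̃(y′)` and cut-off `ζ` with `supp ζ ⊂ Δ̃(y)`:
`h1 J α ζ ≤ C_α·e^{−δ|y−y′|}·(‖ζ‖_α + |ζ|)·|J|` — `vec`: `ineq111_vec_TS_rateFree`, `ten`: §13 `ineq111_ten_TS`, `ten2`: the entry is `0`; common rate the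
minimum, common constant the maximum. [cite: Balaban1984PropagatorsII, Prop. 2.5 p.246; Balaban1984PropagatorsI, Prop. 1.2 (1.111) p.35] -/
theorem ineq111_TS_rateFree (ha₀ : 0 < a₀) (ha₁ : a₀ ≤ a₁) :
    ∃ δ : ℝ, 0 < δ ∧ ∀ α : ℝ, 0 ≤ α → α < 1 → ∃ C : ℝ, 0 ≤ C ∧
      ∀ (i : TSIdx d L hd hL a₀ a₁) (J : i.LocTS) (ζ : Site i.P 0 → ℝ) (y y' : Site i.P i.j),
      i.cutInTS ζ y → i.suppInTS J y' →
      i.h1TS J α ζ ≤ C * Real.exp (-(δ * i.tdist y y')) * (i.hqS α ζ + i.cutSupTS ζ) * i.supNormTS J := by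
  obtain ⟨δ₁, hδ₁, h₁⟩ := ineq111_vec_TS_rateFree (d := d) (L := L) (hd := hd) (hL := hL) ha₀ ha₁
  obtain ⟨δ₂, hδ₂, h₂⟩ := ineq111_ten_TS (d := d) (L := L) (hd := hd) (hL := hL) ha₀ ha₁
  refine ⟨min δ₁ δ₂, lt_min hδ₁ hδ₂, fun α hα0 hα1 => ?_⟩
  obtain ⟨C₁, hC₁, h₁'⟩ := h₁ α hα0 hα1
  obtain ⟨C₂, hC₂, h₂'⟩ := h₂ α hα0 hα1
  refine ⟨max C₁ C₂, le_max_of_le_left hC₁, ?_⟩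
  intro i J ζ y y' hζ hJ
  have hC0 : 0 ≤ max C₁ C₂ := le_max_of_le_left hC₁
  have hX : 0 ≤ (i.hqS α ζ + i.cutSupTS ζ) * i.supNormTS J :=
    mul_nonneg (add_nonneg (i.hqS_nonneg α ζ) (i.cutSupTS_nonneg ζ)) (i.supNormTS_nonneg J)
  have ht := i.tdist_nonneg y y'
  -- weakening the rate and enlarging the constant
  have mono : ∀ {δ' C' : ℝ}, min δ₁ δ₂ ≤ δ' → C' ≤ max C₁ C₂ →
      C' * Real.exp (-(δ' * i.tdist y y')) * ((i.hqS α ζ + i.cutSupTS ζ) * i.supNormTS J) ≤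
        max C₁ C₂ * Real.exp (-(min δ₁ δ₂ * i.tdist y y')) * ((i.hqS α ζ + i.cutSupTS ζ) * i.supNormTS J) := by
    intro δ' C' hδ' hC'
    refine mul_le_mul_of_nonneg_right ?_ hX
    exact mul_le_mul hC' (Real.exp_le_exp.2 (neg_le_neg (mul_le_mul_of_nonneg_right hδ' ht))) (Real.exp_nonneg _) hC0
  cases J with
  | vec J =>
    have h := h₁' i J ζ y y' hζ hJ
    rw [mul_assoc] at h
    rw [mul_assoc]
    exact h.trans (mono (min_le_left _ _) (le_max_left _ _))
  | ten J =>
    have h := h₂' i J ζ y y' hζ hJ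
    rw [mul_assoc] at h
    rw [mul_assoc]
    exact h.trans (mono (min_le_right _ _) (le_max_right _ _))
  | ten2 J =>
    rw [h1TS_ten2, mul_assoc]
    exact mul_nonneg (mul_nonneg hC0 (Real.exp_nonneg _)) hX

/-- **THE SECOND CONJUNCT OF `B5.Ineq110_114` ON THE CENSUS SETTING, VERBATIM, IN THE PRINTED QUANTIFIER ORDER** (v1.4): there are `δ > 0` and a
constant function `C_α` (both chosen before the member) such that for EVERY member of the genuine two-scale family, ALL source kinds, every
`0 ≤ α < 1`, `supp ζ ⊂ Δ̃(y)`, `supp J ⊂ Δ̃(y′)`: `(settingTS i).h1 J α ζ ≤ C_α·e^{−δ·dist(y,y′)}·cutH α ζ·supNorm J` — the second conjunct of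
`B5.Ineq110_114 (settingTS i) C C_α C_ε C_αε δ` («‖ζ∇GJ‖_α, ‖ζG∇*J‖_α ≤ O(1)e^{−δ₀|y−y′|}(‖ζ‖_α + |ζ|)|J| for 0 ≤ α < 1 … with the constant O(1)
depending on d and α»; «with a positive constant δ₂ instead of δ₀. This constant depends on d and L only»). Supersedes §14's `ineq111_settingTS_upto`.
[cite: Balaban1984PropagatorsII, Prop. 2.5 p.246; Balaban1984PropagatorsI, Prop. 1.2 (1.111) p.35] -/
theorem ineq111_settingTS (ha₀ : 0 < a₀) (ha₁ : a₀ ≤ a₁) :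
    ∃ δ : ℝ, 0 < δ ∧ ∃ Cα : ℝ → ℝ, ∀ (i : TSIdx d L hd hL a₀ a₁) (α : ℝ) (J : (settingTS i).Loc) (ζ : (settingTS i).Cut)
      (y y' : (settingTS i).Site), 0 ≤ α → α < 1 → (settingTS i).cutIn ζ y → (settingTS i).suppIn J y' →
      (settingTS i).h1 J α ζ ≤ Cα α * Real.exp (-(δ * (settingTS i).dist y y')) * (settingTS i).cutH α ζ * (settingTS i).supNorm J := by
  classical
  obtain ⟨δ, hδ, h⟩ := ineq111_TS_rateFree (d := d) (L := L) (hd := hd) (hL := hL) ha₀ ha₁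
  refine ⟨δ, hδ, fun α => if hα : 0 ≤ α ∧ α < 1 then Classical.choose (h α hα.1 hα.2) else 0, ?_⟩
  intro i α J ζ y y' hα0 hα1 hζ hJ
  have hC : (if hα : 0 ≤ α ∧ α < 1 then Classical.choose (h α hα.1 hα.2) else 0) = Classical.choose (h α hα0 hα1) := dif_pos ⟨hα0, hα1⟩
  change i.h1TS J α ζ ≤ (if hα : 0 ≤ α ∧ α < 1 then Classical.choose (h α hα.1 hα.2) else 0) * Real.exp (-(δ * i.tdist y y')) *
    (i.hqS α ζ + i.cutSupTS ζ) * i.supNormTS J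
  rw [hC]
  exact (Classical.choose_spec (h α hα0 hα1)).2 i J ζ y y' hζ hJ

end ClauseHolderRateFree

/-! ## §16  (v1.4) The (1.112) clause `|∇G∇*J|` from p38's file M3 (`B6Prop25Eq112TwoScaleV1`), and the third conjunct of `B5.Ineq110_114` on the
census setting in the printed quantifier order -/

namespace TSIdx

variable {d L : ℕ} {hd : 1 ≤ d + 1} {hL : Odd L ∧ 1 < L} {a₀ a₁ : ℝ} (i : TSIdx d L hd hL a₀ a₁)

/-- the (1.112) entry on the `ten` kind (definitional): `max_μ sup_{Δ̃(y)} |∇_μG_□∇*J|`. [cite: Balaban1984PropagatorsI, Prop. 1.2 (1.112) p.36, dictionary] -/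
@[simp] theorem e4TS_ten (J : Fin i.P.d → BondSpace i.P) (y : Site i.P i.j) :
    i.e4TS (.ten J) y = LatticeNorms.supNorm univ (fun lam => i.cubeSup y (i.Dl lam (i.G (i.divTS J)))) := rfl

/-- the (1.112) entry vanishes on the `vec` kind (source-kind device). [cite: Balaban1984PropagatorsI, Prop. 1.2 (1.112) p.36, dictionary] -/
@[simp] theorem e4TS_vec (J : BondSpace i.P) (y : Site i.P i.j) : i.e4TS (.vec J) y = 0 := rfl

/-- the (1.112) entry vanishes on the `ten2` kind (source-kind device). [cite: Balaban1984PropagatorsI, Prop. 1.2 (1.112) p.36, dictionary] -/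
@[simp] theorem e4TS_ten2 (J : Fin i.P.d → Fin i.P.d → BondSpace i.P) (y : Site i.P i.j) : i.e4TS (.ten2 J) y = 0 := rfl

/-- `‖J‖_ε` on the `vec` kind (definitional). [cite: Balaban1984PropagatorsI, (1.109) p.35, dictionary] -/
@[simp] theorem holderTS_vec (ε : ℝ) (J : BondSpace i.P) : i.holderTS ε (.vec J) = i.hqB ε J := rfl

/-- `‖J‖_ε = max_λ ‖J_λ‖_ε` on the `ten` kind (definitional). [cite: Balaban1984PropagatorsI, (1.109) p.35, (1.112) p.36, dictionary] -/
@[simp] theorem holderTS_ten (ε : ℝ) (J : Fin i.P.d → BondSpace i.P) :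
    i.holderTS ε (.ten J) = LatticeNorms.supNorm univ (fun lam => i.hqB ε (J lam)) := rfl

/-- `‖J‖_ε = max_{λμ} ‖J_{λμ}‖_ε` on the `ten2` kind (definitional). [cite: Balaban1984PropagatorsI, (1.109) p.35, dictionary] -/
@[simp] theorem holderTS_ten2 (ε : ℝ) (J : Fin i.P.d → Fin i.P.d → BondSpace i.P) :
    i.holderTS ε (.ten2 J) = LatticeNorms.supNorm univ (fun p : Fin i.P.d × Fin i.P.d => i.hqB ε (J p.1 p.2)) := rfl

/-- `0 ≤ ‖J‖_ε`. [cite: Balaban1984PropagatorsI, (1.109) p.35] -/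
theorem holderTS_nonneg (ε : ℝ) (J : i.LocTS) : 0 ≤ i.holderTS ε J := by
  cases J with
  | vec J => rw [holderTS_vec]; exact i.hqB_nonneg ε J
  | ten J => rw [holderTS_ten]; exact LatticeNorms.supNorm_nonneg _ _
  | ten2 J => rw [holderTS_ten2]; exact LatticeNorms.supNorm_nonneg _ _

/-- `(∇_μG∇*J)(b) = Σ_λ (∇_μG∇_λ*J_λ)(b)` (linearity). [cite: Balaban1984PropagatorsI, (1.112) p.36 («∇G∇*J»), dictionary] -/
theorem Dl_G_divTS_apply (mu : Fin i.P.d) (J : Fin i.P.d → BondSpace i.P) (b : PBond i.P 0) :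
    i.Dl mu (i.G (i.divTS J)) b = ∑ lam, i.Dl mu (i.G (i.Dla lam (J lam))) b := by
  unfold divTS
  rw [map_sum, map_sum, WithLp.ofLp_sum, Finset.sum_apply]

/-- **the Hölder hypothesis of p38's (1.112) member theorem holds with `X_ε = ‖J‖_ε`**: for `ε > 0` and same-direction fine bonds `b, b′`,
`|J_λ(b) − J_λ(b′)| ≤ ‖J‖_ε·(|b₋ − b₋′|_∞/L^j)^ε` (for `b₋ = b₋′` both sides vanish). [cite: Balaban1984PropagatorsI, (1.109) p.35, Prop. 1.2 (1.112) p.36 («‖J‖_ε»)] -/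
theorem abs_sub_le_holderTS_ten {ε : ℝ} (hε : 0 < ε) (J : Fin i.P.d → BondSpace i.P) (lam : Fin i.P.d) (b b' : PBond i.P 0)
    (hdir : b.dir = b'.dir) : |J lam b - J lam b'| ≤ i.holderTS ε (.ten J) * i.fdist b.src b'.src ^ ε := by
  by_cases hs : b.src = b'.src
  · have hbb : b = b' := by
      obtain ⟨s, e⟩ := b
      obtain ⟨s', e'⟩ := b'
      simp only at hs hdir
      subst hs
      subst hdir
      rfl
    subst hbb
    have h0 : i.fdist b.src b.src = 0 := by
      rw [fdist_eq, (B3TorusRadialSums.supDist_eq_zero_iff b.src b.src).2 rfl, Nat.cast_zero, zero_div]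
    rw [sub_self, abs_zero, h0, Real.zero_rpow hε.ne', mul_zero]
  · have hpos : 0 < i.fdist b.src b'.src ^ ε := Real.rpow_pos_of_pos (i.fdist_pos hs) _
    have h1 : ‖(J lam b' - J lam b) / i.fdist b.src b'.src ^ ε‖ ≤ i.hqB ε (J lam) := by
      unfold hqB
      exact LatticeNorms.norm_le_supNorm (fun p : PBond i.P 0 × PBond i.P 0 => (J lam p.2 - J lam p.1) / i.fdist p.1.src p.2.src ^ ε)
        (Finset.mem_filter.2 ⟨Finset.mem_univ (b, b'), hs, hdir⟩)
    have h2 : i.hqB ε (J lam) ≤ i.holderTS ε (.ten J) := by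
      rw [holderTS_ten]
      have h := LatticeNorms.norm_le_supNorm (fun lam => i.hqB ε (J lam)) (Finset.mem_univ lam)
      rwa [Real.norm_eq_abs, abs_of_nonneg (i.hqB_nonneg ε (J lam))] at h
    rw [Real.norm_eq_abs, abs_div, abs_of_pos hpos, div_le_iff₀ hpos, abs_sub_comm] at h1
    exact h1.trans (mul_le_mul_of_nonneg_right h2 hpos.le)

end TSIdx

section ClauseGradDiv

variable {d L : ℕ} {hd : 1 ≤ d + 1} {hL : Odd L ∧ 1 < L} {a₀ a₁ : ℝ}

open TSIdx
open B6Prop25Eq112TwoScaleV1 (prop25_ineq112)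

/-- **THE (1.112) CLAUSE `|∇G_□∇*J|` FOR THE GENUINE TWO-SCALE FAMILY** (v1.4): there is `δ₂ > 0` (on `d, L, a₀, a₁`, NOT on `ε`) and for every
`0 < ε < 1` a `C_ε ≥ 0` such that for EVERY member, every source `J` (any kind; the entry lives on the `ten` kind) with `supp J ⊂ Δ̃(y′)` and every `y`:
`e4 J y = max_μ sup_{Δ̃(y)}|∇_μG_□∇*J| ≤ C_ε·e^{−δ₂|y−y′|}·(‖J‖_ε + |J|)` — p38 g22's `prop25_ineq112` (p333858: one `μ`, one `λ`, radius `r = 1`,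
`X = |J|`, `X_ε = ‖J‖_ε` by `abs_sub_le_holderTS_ten`) summed over the `d + 1` directions `λ` of `∇*J = Σ_λ∇_λ*J_λ` (`Dl_G_divTS_apply`), RATE `ε`-FREE
AS PRINTED. [cite: Balaban1984PropagatorsII, Prop. 2.5 p.246; Balaban1984PropagatorsI, Prop. 1.2 (1.112) p.36] -/
theorem ineq112_TS (ha₀ : 0 < a₀) (ha₁ : a₀ ≤ a₁) :
    ∃ δ : ℝ, 0 < δ ∧ ∀ ε : ℝ, 0 < ε → ε < 1 → ∃ C : ℝ, 0 ≤ C ∧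
      ∀ (i : TSIdx d L hd hL a₀ a₁) (J : i.LocTS) (y y' : Site i.P i.j), i.suppInTS J y' →
      i.e4TS J y ≤ C * Real.exp (-(δ * i.tdist y y')) * (i.holderTS ε J + i.supNormTS J) := by
  classical
  obtain ⟨δ, hδ, HE⟩ := prop25_ineq112 d L hd hL ha₀ ha₁
  refine ⟨δ, hδ, fun ε hε0 hε1 => ?_⟩
  obtain ⟨CE, hCE, hE⟩ := HE ε hε0 hε1
  refine ⟨((d : ℝ) + 1) * (CE * Real.exp ((1 + 2 * δ) * (1 + 3))), by positivity, ?_⟩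
  intro i J y y' hsupp
  have hRHS : 0 ≤ ((d : ℝ) + 1) * (CE * Real.exp ((1 + 2 * δ) * (1 + 3))) * Real.exp (-(δ * i.tdist y y')) * (i.holderTS ε J + i.supNormTS J) :=
    mul_nonneg (by positivity) (add_nonneg (i.holderTS_nonneg ε J) (i.supNormTS_nonneg J))
  cases J with
  | vec J => rw [e4TS_vec]; exact hRHS
  | ten2 J => rw [e4TS_ten2]; exact hRHS
  | ten J =>
    rw [e4TS_ten]
    have hX0 : 0 ≤ i.supNormTS (.ten J) := i.supNormTS_nonneg _
    have hXε0 : 0 ≤ i.holderTS ε (.ten J) := i.holderTS_nonneg ε _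
    refine LatticeNorms.supNorm_le hRHS fun mu _ => ?_
    rw [Real.norm_eq_abs, abs_of_nonneg (show 0 ≤ i.cubeSup y (i.Dl mu (i.G (i.divTS J))) from LatticeNorms.supNorm_nonneg _ _)]
    refine LatticeNorms.supNorm_le hRHS fun b₀ hb₀ => ?_
    rw [Finset.mem_filter] at hb₀
    rw [Real.norm_eq_abs, Dl_G_divTS_apply]
    -- per direction `λ` of `∇*`: p38's member theorem at `r = 1` with `X = |J|`, `X_ε = ‖J‖_ε`
    have hterm : ∀ lam : Fin i.P.d, |i.Dl mu (i.G (i.Dla lam (J lam))) b₀| ≤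
        CE * Real.exp ((1 + 2 * δ) * (1 + 3)) * Real.exp (-(δ * i.tdist y y')) * (i.holderTS ε (.ten J) + i.supNormTS (.ten J)) := by
      intro lam
      have hH : ∀ b b' : PBond i.P 0, b.dir = b'.dir → supDist b.src b'.src ≤ L ^ i.j →
          |J lam b - J lam b'| ≤ i.holderTS ε (.ten J) * (((supDist b.src b'.src : ℕ) : ℝ) / (L : ℝ) ^ i.j) ^ ε := by
        intro b b' hdir _
        rw [← i.fdist_eq b.src b'.src]
        exact i.abs_sub_le_holderTS_ten hε0 J lam b b' hdir
      exact hE i.m i.K i.j i.hc i.hj i.Λ' i.w i.hw0 i.hw1 lam mu 1 zero_le_one (J lam) (i.supNormTS (.ten J)) (i.holderTS ε (.ten J))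
        hX0 hXε0 y y' (hsupp lam) (fun b' => i.abs_le_supNormTS_ten J lam b') hH b₀ hb₀.2
    calc |∑ lam, i.Dl mu (i.G (i.Dla lam (J lam))) b₀|
        ≤ ∑ lam, |i.Dl mu (i.G (i.Dla lam (J lam))) b₀| := Finset.abs_sum_le_sum_abs _ _
      _ ≤ ∑ _lam : Fin i.P.d, CE * Real.exp ((1 + 2 * δ) * (1 + 3)) * Real.exp (-(δ * i.tdist y y')) *
            (i.holderTS ε (.ten J) + i.supNormTS (.ten J)) := Finset.sum_le_sum fun lam _ => hterm lam
      _ = ((d : ℝ) + 1) * (CE * Real.exp ((1 + 2 * δ) * (1 + 3))) * Real.exp (-(δ * i.tdist y y')) *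
            (i.holderTS ε (.ten J) + i.supNormTS (.ten J)) := by
          rw [Finset.sum_const, Finset.card_univ, Fintype.card_fin, nsmul_eq_mul]
          push_cast
          ring

/-- **THE THIRD CONJUNCT OF `B5.Ineq110_114` ON THE CENSUS SETTING, VERBATIM, IN THE PRINTED QUANTIFIER ORDER** (v1.4): there are `δ > 0` and a constant
function `C_ε` (both chosen before the member) such that for EVERY member, ALL source kinds, every `0 < ε < 1`, `supp J ⊂ Δ̃(y′)` and `y`:
`(settingTS i).e4 J y ≤ C_ε·e^{−δ·dist(y,y′)}·(holder ε J + supNorm J)` («|(∇G∇*J)(x)| ≤ O(1)e^{−δ₀|y−y′|}(‖J‖_ε + |J|) for 0 < ε < 1 … with the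
constant O(1) depending on d and ε»). [cite: Balaban1984PropagatorsII, Prop. 2.5 p.246; Balaban1984PropagatorsI, Prop. 1.2 (1.112) p.36] -/
theorem ineq112_settingTS (ha₀ : 0 < a₀) (ha₁ : a₀ ≤ a₁) :
    ∃ δ : ℝ, 0 < δ ∧ ∃ Cε : ℝ → ℝ, ∀ (i : TSIdx d L hd hL a₀ a₁) (ε : ℝ) (J : (settingTS i).Loc) (y y' : (settingTS i).Site),
      0 < ε → ε < 1 → (settingTS i).suppIn J y' →
      (settingTS i).e4 J y ≤ Cε ε * Real.exp (-(δ * (settingTS i).dist y y')) * ((settingTS i).holder ε J + (settingTS i).supNorm J) := by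
  classical
  obtain ⟨δ, hδ, h⟩ := ineq112_TS (d := d) (L := L) (hd := hd) (hL := hL) ha₀ ha₁
  refine ⟨δ, hδ, fun ε => if hε : 0 < ε ∧ ε < 1 then Classical.choose (h ε hε.1 hε.2) else 0, ?_⟩
  intro i ε J y y' hε0 hε1 hJ
  have hC : (if hε : 0 < ε ∧ ε < 1 then Classical.choose (h ε hε.1 hε.2) else 0) = Classical.choose (h ε hε0 hε1) := dif_pos ⟨hε0, hε1⟩
  change i.e4TS J y ≤ (if hε : 0 < ε ∧ ε < 1 then Classical.choose (h ε hε.1 hε.2) else 0) * Real.exp (-(δ * i.tdist y y')) *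
    (i.holderTS ε J + i.supNormTS J)
  rw [hC]
  exact (Classical.choose_spec (h ε hε0 hε1)).2 i J y y' hJ

end ClauseGradDiv

/-! ## §17  (v1.4) Eight clauses of `B5.Ineq110_114` on the census setting with one `δ`: the first conjunct at `n ≤ 2`, the second and third
conjuncts in full, the fifth conjunct at `n ≤ 2` -/

section EightClauses

variable {d L : ℕ} {hd : 1 ≤ d + 1} {hL : Odd L ∧ 1 < L} {a₀ a₁ : ℝ}

open TSIdx

/-- **EIGHT CLAUSES OF `B5.Ineq110_114` ON THE CENSUS SETTING WITH ONE `(δ₂, C, C_α, C_ε)`** (v1.4): for every member of the genuine two-scale family —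
the first conjunct at `n = 0, 1, 2` ((1.110)₁,₂,₃), THE SECOND CONJUNCT ((1.111), all `0 ≤ α < 1`, all source kinds), THE THIRD CONJUNCT ((1.112), all
`0 < ε < 1`), and the fifth conjunct at `n = 0, 1, 2` ((1.114)₁,₂,₃), with one rate `δ > 0` and the constants `C ≥ 0`, `C_α`, `C_ε` chosen BEFORE the
member (§11 `clauses_settingTS_six`, §15 `ineq111_TS_rateFree`, §16 `ineq112_TS`; common rate the minimum).  NOT claimed: the first conjunct at `n = 3`
((1.110)₄), the fourth ((1.113)), the fifth at `n = 3, 4, 5` — hence neither `B5.Ineq110_114 (settingTS i) …` nor `B6.Prop25Printed (locTS …)`.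
[cite: Balaban1984PropagatorsII, Prop. 2.5 p.246; Balaban1984PropagatorsI, Prop. 1.2 (1.110)–(1.112), (1.114) pp.35–36] -/
theorem clauses_settingTS_eight (ha₀ : 0 < a₀) (ha₁ : a₀ ≤ a₁) :
    ∃ δ : ℝ, 0 < δ ∧ ∃ C : ℝ, 0 ≤ C ∧ ∃ Cα Cε : ℝ → ℝ, ∀ i : TSIdx d L hd hL a₀ a₁,
      (∀ n : Fin 4, n.val ≤ 2 → ∀ (J : (settingTS i).Loc) (y y' : (settingTS i).Site), (settingTS i).suppIn J y' →
          (settingTS i).e n J y ≤ C * Real.exp (-(δ * (settingTS i).dist y y')) * (settingTS i).supNorm J) ∧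
      (∀ (α : ℝ) (J : (settingTS i).Loc) (ζ : (settingTS i).Cut) (y y' : (settingTS i).Site), 0 ≤ α → α < 1 →
          (settingTS i).cutIn ζ y → (settingTS i).suppIn J y' →
          (settingTS i).h1 J α ζ ≤ Cα α * Real.exp (-(δ * (settingTS i).dist y y')) * (settingTS i).cutH α ζ * (settingTS i).supNorm J) ∧
      (∀ (ε : ℝ) (J : (settingTS i).Loc) (y y' : (settingTS i).Site), 0 < ε → ε < 1 → (settingTS i).suppIn J y' →
          (settingTS i).e4 J y ≤ Cε ε * Real.exp (-(δ * (settingTS i).dist y y')) * ((settingTS i).holder ε J + (settingTS i).supNorm J)) ∧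
      (∀ n : Fin 6, n.val ≤ 2 → ∀ (J : (settingTS i).Loc) (ζ : (settingTS i).Cut) (y y' : (settingTS i).Site),
          (settingTS i).cutIn ζ y → (settingTS i).suppIn J y' →
          (settingTS i).l2loc n J ζ ≤ C * Real.exp (-(δ * (settingTS i).dist y y')) * (settingTS i).cutSup ζ * (settingTS i).l2Norm J) := by
  classical
  obtain ⟨δ₁, hδ₁, C, hC, h6⟩ := clauses_settingTS_six (d := d) (L := L) (hd := hd) (hL := hL) ha₀ ha₁
  obtain ⟨δ₂, hδ₂, hα⟩ := ineq111_TS_rateFree (d := d) (L := L) (hd := hd) (hL := hL) ha₀ ha₁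
  obtain ⟨δ₃, hδ₃, hε⟩ := ineq112_TS (d := d) (L := L) (hd := hd) (hL := hL) ha₀ ha₁
  set δ := min δ₁ (min δ₂ δ₃) with hδdef
  have hδ0 : 0 < δ := lt_min hδ₁ (lt_min hδ₂ hδ₃)
  have hδ₁' : δ ≤ δ₁ := min_le_left _ _
  have hδ₂' : δ ≤ δ₂ := (min_le_right _ _).trans (min_le_left _ _)
  have hδ₃' : δ ≤ δ₃ := (min_le_right _ _).trans (min_le_right _ _)
  -- weakening the rate at a nonnegative constant
  have wk : ∀ (i : TSIdx d L hd hL a₀ a₁) (y y' : Site i.P i.j) {δ' K X : ℝ}, δ ≤ δ' → 0 ≤ K → 0 ≤ X →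
      K * Real.exp (-(δ' * i.tdist y y')) * X ≤ K * Real.exp (-(δ * i.tdist y y')) * X := by
    intro i y y' δ' K X hδ' hK hX
    exact mul_le_mul_of_nonneg_right (mul_le_mul_of_nonneg_left
      (Real.exp_le_exp.2 (neg_le_neg (mul_le_mul_of_nonneg_right hδ' (i.tdist_nonneg y y')))) hK) hX
  refine ⟨δ, hδ0, C, hC, fun α => if h : 0 ≤ α ∧ α < 1 then Classical.choose (hα α h.1 h.2) else 0,
    fun ε => if h : 0 < ε ∧ ε < 1 then Classical.choose (hε ε h.1 h.2) else 0, fun i => ⟨?_, ?_, ?_, ?_⟩⟩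
  · intro n hn J y y' hJ
    have h := (h6 i).1 n hn J y y' hJ
    change i.eTS n J y ≤ C * Real.exp (-(δ₁ * i.tdist y y')) * i.supNormTS J at h
    change i.eTS n J y ≤ C * Real.exp (-(δ * i.tdist y y')) * i.supNormTS J
    exact h.trans (wk i y y' hδ₁' hC (i.supNormTS_nonneg J))
  · intro α J ζ y y' hα0 hα1 hζ hJ
    have hCdef : (if h : 0 ≤ α ∧ α < 1 then Classical.choose (hα α h.1 h.2) else 0) = Classical.choose (hα α hα0 hα1) := dif_pos ⟨hα0, hα1⟩
    have hspec := Classical.choose_spec (hα α hα0 hα1)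
    change i.h1TS J α ζ ≤ (if h : 0 ≤ α ∧ α < 1 then Classical.choose (hα α h.1 h.2) else 0) * Real.exp (-(δ * i.tdist y y')) *
      (i.hqS α ζ + i.cutSupTS ζ) * i.supNormTS J
    rw [hCdef]
    have h := hspec.2 i J ζ y y' hζ hJ
    have hX : 0 ≤ (i.hqS α ζ + i.cutSupTS ζ) * i.supNormTS J :=
      mul_nonneg (add_nonneg (i.hqS_nonneg α ζ) (i.cutSupTS_nonneg ζ)) (i.supNormTS_nonneg J)
    rw [mul_assoc] at h
    rw [mul_assoc]
    exact h.trans (wk i y y' hδ₂' hspec.1 hX)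
  · intro ε J y y' hε0 hε1 hJ
    have hCdef : (if h : 0 < ε ∧ ε < 1 then Classical.choose (hε ε h.1 h.2) else 0) = Classical.choose (hε ε hε0 hε1) := dif_pos ⟨hε0, hε1⟩
    have hspec := Classical.choose_spec (hε ε hε0 hε1)
    change i.e4TS J y ≤ (if h : 0 < ε ∧ ε < 1 then Classical.choose (hε ε h.1 h.2) else 0) * Real.exp (-(δ * i.tdist y y')) *
      (i.holderTS ε J + i.supNormTS J)
    rw [hCdef]
    exact (hspec.2 i J y y' hJ).trans (wk i y y' hδ₃' hspec.1 (add_nonneg (i.holderTS_nonneg ε J) (i.supNormTS_nonneg J)))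
  · intro n hn J ζ y y' hζ hJ
    have h := (h6 i).2 n hn J ζ y y' hζ hJ
    change i.l2locTS n J ζ ≤ C * Real.exp (-(δ₁ * i.tdist y y')) * i.cutSupTS ζ * i.l2NormTS J at h
    change i.l2locTS n J ζ ≤ C * Real.exp (-(δ * i.tdist y y')) * i.cutSupTS ζ * i.l2NormTS J
    have hX : 0 ≤ i.cutSupTS ζ * i.l2NormTS J := mul_nonneg (i.cutSupTS_nonneg ζ) (i.l2NormTS_nonneg J)
    rw [mul_assoc] at h
    rw [mul_assoc]
    exact h.trans (wk i y y' hδ₁' hC hX)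

end EightClauses

/-! ## §18  (v1.5) The (1.110)₄ clause `|ΔGJ|` from p22's file 22 (`B6Prop25LapDecayTwoScaleV1`), and the FIRST conjunct of `B5.Ineq110_114` on the
census setting in full -/

namespace TSIdx

variable {d L : ℕ} {hd : 1 ≤ d + 1} {hL : Odd L ∧ 1 < L} {a₀ a₁ : ℝ} (i : TSIdx d L hd hL a₀ a₁)

/-- the (1.110)₄ entry on the `vec` kind (definitional): `sup_{Δ̃(y)} |ΔG_□J|`. [cite: Balaban1984PropagatorsI, Prop. 1.2 (1.110) p.35, dictionary] -/
@[simp] theorem eTS_three_vec (J : BondSpace i.P) (y : Site i.P i.j) : i.eTS 3 (.vec J) y = i.cubeSup y (i.lapTS (i.G J)) := rfl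

/-- the (1.110)₄ entry vanishes on the `ten` kind (source-kind device). [cite: Balaban1984PropagatorsI, Prop. 1.2 (1.110) p.35, dictionary] -/
@[simp] theorem eTS_three_ten (J : Fin i.P.d → BondSpace i.P) (y : Site i.P i.j) : i.eTS 3 (.ten J) y = 0 := rfl

/-- **`(ΔA)(b) = Σ_ν n²(2A(b) − A(b − e_ν) − A(b + e_ν))`**, `n = L^j` (p22's `Lap_apply` read on the census operator `lapTS = Σ_ν ∇_ν*∇_ν`).
[cite: Balaban1984PropagatorsI, (1.21) p.21, Prop. 1.2 (1.110) p.35 («ΔGJ»)] -/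
theorem lapTS_apply (A : BondSpace i.P) (b : PBond i.P 0) :
    i.lapTS A b = ∑ ν : Fin i.P.d, ((L : ℝ) ^ i.j) ^ 2 * (2 * A b - A ⟨b.src.unshift ν, b.dir⟩ - A ⟨b.src.shift ν, b.dir⟩) :=
  B6BlockDecayGLapBridgeV1.Lap_apply (P := i.P) ((L : ℝ) ^ i.j) A b

end TSIdx

section ClauseLap

variable {d L : ℕ} {hd : 1 ≤ d + 1} {hL : Odd L ∧ 1 < L} {a₀ a₁ : ℝ}

open TSIdx
open B6Prop25LapDecayTwoScaleV1 (prop25_ineq110_Lap)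

/-- **THE (1.110)₄ CLAUSE `|ΔG_□J|` FOR THE GENUINE TWO-SCALE FAMILY** (v1.5): there are `δ₂ > 0`, `C ≥ 0` (on `d, L, a₀, a₁`) such that for EVERY member,
every source `J` with `supp J ⊂ Δ̃(y′)` and every `y`, `e 3 J y = sup_{Δ̃(y)}|ΔG_□J| ≤ C·e^{−δ₂|y−y′|}·|J|` — p22 g16's `prop25_ineq110_Lap` (p334578) at
`r = 1`, `X = |J|`, through `lapTS_apply`. [cite: Balaban1984PropagatorsII, Prop. 2.5 p.246; Balaban1984PropagatorsI, Prop. 1.2 (1.110) p.35] -/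
theorem ineq110_three_TS (ha₀ : 0 < a₀) (ha₁ : a₀ ≤ a₁) :
    ∃ δ : ℝ, 0 < δ ∧ ∃ C : ℝ, 0 ≤ C ∧ ∀ (i : TSIdx d L hd hL a₀ a₁) (J : i.LocTS) (y y' : Site i.P i.j),
      i.suppInTS J y' → i.eTS 3 J y ≤ C * Real.exp (-(δ * i.tdist y y')) * i.supNormTS J := by
  classical
  obtain ⟨δ, hδ, C, hC, h⟩ := prop25_ineq110_Lap d L hd hL ha₀ ha₁
  refine ⟨δ, hδ, C * Real.exp ((1 + 2 * δ) * 1), by positivity, ?_⟩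
  intro i J y y' hsupp
  have hRHS : 0 ≤ C * Real.exp ((1 + 2 * δ) * 1) * Real.exp (-(δ * i.tdist y y')) * i.supNormTS J :=
    mul_nonneg (by positivity) (i.supNormTS_nonneg J)
  cases J with
  | vec J =>
    rw [eTS_three_vec]
    refine LatticeNorms.supNorm_le hRHS fun b hb => ?_
    rw [Finset.mem_filter] at hb
    rw [Real.norm_eq_abs, lapTS_apply]
    exact h i.m i.K i.j i.hc i.hj i.Λ' i.w i.hw0 i.hw1 1 zero_le_one J (i.supNormTS (.vec J)) (i.supNormTS_nonneg _) y y'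
      hsupp (fun b' => i.abs_le_supNormTS_vec J b') b hb.2
  | ten J => rw [eTS_three_ten]; exact hRHS
  | ten2 J => rw [eTS_ten2]; exact hRHS

/-- **THE FIRST CONJUNCT OF `B5.Ineq110_114` ON THE CENSUS SETTING, VERBATIM (all four members of (1.110))** (v1.5): there are `δ > 0` and `C ≥ 0`
(chosen before the member) such that for EVERY member, every `n : Fin 4`, every source `J` with `supp J ⊂ Δ̃(y′)` and every `y`:
`(settingTS i).e n J y ≤ C·e^{−δ·dist(y,y′)}·supNorm J` («|(GJ)(x)|, |(∇GJ)(x)|, |(G∇*J)(x)|, |(ΔGJ)(x)| ≤ O(1)e^{−δ₀|y−y′|}|J| … with the constant O(1)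
depending on d only») — §7/§9's clauses at `n = 0, 1, 2` and `ineq110_three_TS`, common rate the minimum, common constant the maximum.
[cite: Balaban1984PropagatorsII, Prop. 2.5 p.246; Balaban1984PropagatorsI, Prop. 1.2 (1.110) p.35] -/
theorem ineq110_settingTS (ha₀ : 0 < a₀) (ha₁ : a₀ ≤ a₁) :
    ∃ δ : ℝ, 0 < δ ∧ ∃ C : ℝ, 0 ≤ C ∧ ∀ (i : TSIdx d L hd hL a₀ a₁) (n : Fin 4) (J : (settingTS i).Loc) (y y' : (settingTS i).Site),
      (settingTS i).suppIn J y' → (settingTS i).e n J y ≤ C * Real.exp (-(δ * (settingTS i).dist y y')) * (settingTS i).supNorm J := by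
  obtain ⟨δ₁, hδ₁, C₁, hC₁, h₁⟩ := ineq110_zero_TS (d := d) (L := L) (hd := hd) (hL := hL) ha₀ ha₁
  obtain ⟨δ₂, hδ₂, C₂, hC₂, h₂⟩ := ineq110_one_TS (d := d) (L := L) (hd := hd) (hL := hL) ha₀ ha₁
  obtain ⟨δ₃, hδ₃, C₃, hC₃, h₃⟩ := ineq110_two_TS (d := d) (L := L) (hd := hd) (hL := hL) ha₀ ha₁
  obtain ⟨δ₄, hδ₄, C₄, hC₄, h₄⟩ := ineq110_three_TS (d := d) (L := L) (hd := hd) (hL := hL) ha₀ ha₁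
  set δ := min (min δ₁ δ₂) (min δ₃ δ₄) with hδdef
  set C := max (max C₁ C₂) (max C₃ C₄) with hCdef
  have hδ0 : 0 < δ := lt_min (lt_min hδ₁ hδ₂) (lt_min hδ₃ hδ₄)
  have hC0 : 0 ≤ C := le_max_of_le_left (le_max_of_le_left hC₁)
  have hδ₁' : δ ≤ δ₁ := (min_le_left _ _).trans (min_le_left _ _)
  have hδ₂' : δ ≤ δ₂ := (min_le_left _ _).trans (min_le_right _ _)
  have hδ₃' : δ ≤ δ₃ := (min_le_right _ _).trans (min_le_left _ _)
  have hδ₄' : δ ≤ δ₄ := (min_le_right _ _).trans (min_le_right _ _)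
  have hC₁' : C₁ ≤ C := (le_max_left C₁ C₂).trans (le_max_left _ _)
  have hC₂' : C₂ ≤ C := (le_max_right C₁ C₂).trans (le_max_left _ _)
  have hC₃' : C₃ ≤ C := (le_max_left C₃ C₄).trans (le_max_right _ _)
  have hC₄' : C₄ ≤ C := (le_max_right C₃ C₄).trans (le_max_right _ _)
  -- weakening the rate and enlarging the constant
  have mono : ∀ {δ' C' : ℝ} (_ : δ ≤ δ') (_ : C' ≤ C) {t X : ℝ} (_ : 0 ≤ t) (_ : 0 ≤ X),
      C' * Real.exp (-(δ' * t)) * X ≤ C * Real.exp (-(δ * t)) * X := by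
    intro δ' C' hδ' hC' t X ht hX
    exact mul_le_mul (mul_le_mul hC' (Real.exp_le_exp.2 (neg_le_neg (mul_le_mul_of_nonneg_right hδ' ht))) (Real.exp_nonneg _) hC0)
      le_rfl hX (mul_nonneg hC0 (Real.exp_nonneg _))
  refine ⟨δ, hδ0, C, hC0, fun i n J y y' hJ => ?_⟩
  change i.eTS n J y ≤ C * Real.exp (-(δ * i.tdist y y')) * i.supNormTS J
  have hX := i.supNormTS_nonneg J
  have ht := i.tdist_nonneg y y'
  rcases n with ⟨_ | _ | _ | _ | k, hk⟩
  · exact (h₁ i J y y' hJ).trans (mono hδ₁' hC₁' ht hX)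
  · exact (h₂ i J y y' hJ).trans (mono hδ₂' hC₂' ht hX)
  · exact (h₃ i J y y' hJ).trans (mono hδ₃' hC₃' ht hX)
  · exact (h₄ i J y y' hJ).trans (mono hδ₄' hC₄' ht hX)
  · omega

end ClauseLap

/-! ## §19  (v1.5) The assembly edge: `B6.Prop25Printed locTS` from the two clause families still missing -/

section Assembly

variable {d L : ℕ} {hd : 1 ≤ d + 1} {hL : Odd L ∧ 1 < L} {a₀ a₁ : ℝ}

open TSIdx

/-- **THE ASSEMBLY EDGE FOR PROPOSITION 2.5 ON THE CENSUS CARRIER** (v1.5): `B6.Prop25Printed (fun i => locTS i)` — (2.129) for every member AND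
`B5.Ineq110_114 (settingTS i) C C_α C_ε C_αε δ₂` with ONE `δ₂ > 0`, `C > 0`, `C_α`, `C_ε`, `C_αε` chosen before the member — FOLLOWS from the two
clause families NOT yet in the tree for the genuine two-scale `G_□`, taken here as hypotheses in census language: the FOURTH conjunct ((1.113)
`‖ζ∇G∇*J‖_α`, slot `h2`; p38 g22's M4–M6) and the FIFTH conjunct at `n = 3, 4, 5` ((1.114)₄₋₆, slots `l2loc 3/4/5`; p22 g16).  Everything else is in
the tree: §5 `prop25_first_TS`, §18 `ineq110_settingTS`, §15 `ineq111_settingTS`, §16 `ineq112_settingTS`, §11 `clauses_settingTS_six` (fifth at `n ≤ 2`);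
common rate the minimum, constants enlarged (`max · 0` on the constant functions, `max · 1` on `C`).  An IMPLICATION (reduction edge), not an
inhabitation: `B6.Prop25Printed (locTS …)` is NOT claimed. [cite: Balaban1984PropagatorsII, Prop. 2.5 p.246; Balaban1984PropagatorsI, Prop. 1.2 (1.110)–(1.114) pp.35–36] -/
theorem prop25Printed_locTS_of (ha₀ : 0 < a₀) (ha₁ : a₀ ≤ a₁)
    (h4 : ∃ δ : ℝ, 0 < δ ∧ ∃ Cαε : ℝ → ℝ → ℝ, ∀ (i : TSIdx d L hd hL a₀ a₁) (α ε : ℝ) (J : (settingTS i).Loc) (ζ : (settingTS i).Cut)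
      (y y' : (settingTS i).Site), 0 ≤ α → 0 < ε → α + ε < 1 → (settingTS i).cutIn ζ y → (settingTS i).suppIn J y' →
      (settingTS i).h2 J α ζ ≤ Cαε α ε * Real.exp (-(δ * (settingTS i).dist y y')) * (settingTS i).cutH α ζ *
        ((settingTS i).holder (α + ε) J + (settingTS i).supNorm J))
    (h5 : ∃ δ : ℝ, 0 < δ ∧ ∃ C : ℝ, 0 ≤ C ∧ ∀ (i : TSIdx d L hd hL a₀ a₁) (n : Fin 6), 3 ≤ n.val → ∀ (J : (settingTS i).Loc)
      (ζ : (settingTS i).Cut) (y y' : (settingTS i).Site), (settingTS i).cutIn ζ y → (settingTS i).suppIn J y' →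
      (settingTS i).l2loc n J ζ ≤ C * Real.exp (-(δ * (settingTS i).dist y y')) * (settingTS i).cutSup ζ * (settingTS i).l2Norm J) :
    B6.Prop25Printed (fun i : TSIdx d L hd hL a₀ a₁ => locTS i) := by
  classical
  obtain ⟨δa, hδa, Ca, hCa, ha⟩ := ineq110_settingTS (d := d) (L := L) (hd := hd) (hL := hL) ha₀ ha₁
  obtain ⟨δb, hδb, Cα, hb⟩ := ineq111_settingTS (d := d) (L := L) (hd := hd) (hL := hL) ha₀ ha₁
  obtain ⟨δc, hδc, Cε, hc⟩ := ineq112_settingTS (d := d) (L := L) (hd := hd) (hL := hL) ha₀ ha₁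
  obtain ⟨δd, hδd, Cαε, hd4⟩ := h4
  obtain ⟨δe, hδe, Ce, hCe, he⟩ := clauses_settingTS_six (d := d) (L := L) (hd := hd) (hL := hL) ha₀ ha₁
  obtain ⟨δf, hδf, Cf, hCf, hf⟩ := h5
  set δ := min (min δa (min δb δc)) (min δd (min δe δf)) with hδdef
  have hδ0 : 0 < δ := lt_min (lt_min hδa (lt_min hδb hδc)) (lt_min hδd (lt_min hδe hδf))
  have hδa' : δ ≤ δa := (min_le_left _ _).trans (min_le_left _ _)
  have hδb' : δ ≤ δb := (min_le_left _ _).trans ((min_le_right _ _).trans (min_le_left _ _))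
  have hδc' : δ ≤ δc := (min_le_left _ _).trans ((min_le_right _ _).trans (min_le_right _ _))
  have hδd' : δ ≤ δd := (min_le_right _ _).trans (min_le_left _ _)
  have hδe' : δ ≤ δe := (min_le_right _ _).trans ((min_le_right _ _).trans (min_le_left _ _))
  have hδf' : δ ≤ δf := (min_le_right _ _).trans ((min_le_right _ _).trans (min_le_right _ _))
  set C := max (max Ca (max Ce Cf)) 1 with hCdef
  have hC1 : 0 < C := lt_of_lt_of_le one_pos (le_max_right _ _)
  have hCa' : Ca ≤ C := (le_max_left Ca _).trans (le_max_left _ _)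
  have hCe' : Ce ≤ C := ((le_max_left Ce Cf).trans (le_max_right Ca _)).trans (le_max_left _ _)
  have hCf' : Cf ≤ C := ((le_max_right Ce Cf).trans (le_max_right Ca _)).trans (le_max_left _ _)
  -- weakening the rate and enlarging the constant (nonnegative target constant)
  have wk : ∀ (i : TSIdx d L hd hL a₀ a₁) (y y' : Site i.P i.j) {δ' K K' X : ℝ}, δ ≤ δ' → K ≤ K' → 0 ≤ K' → 0 ≤ X →
      K * Real.exp (-(δ' * i.tdist y y')) * X ≤ K' * Real.exp (-(δ * i.tdist y y')) * X := by
    intro i y y' δ' K K' X hδ' hK hK' hX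
    exact mul_le_mul (mul_le_mul hK (Real.exp_le_exp.2 (neg_le_neg (mul_le_mul_of_nonneg_right hδ' (i.tdist_nonneg y y'))))
      (Real.exp_nonneg _) hK') le_rfl hX (mul_nonneg hK' (Real.exp_nonneg _))
  refine ⟨prop25_first_TS ha₀, δ, C, fun α => max (Cα α) 0, fun ε => max (Cε ε) 0, fun α ε => max (Cαε α ε) 0, hδ0, hC1,
    fun i => ⟨?_, ?_, ?_, ?_, ?_⟩⟩
  · intro n J y y' hJ
    have h := ha i n J y y' hJ
    change i.eTS n J y ≤ Ca * Real.exp (-(δa * i.tdist y y')) * i.supNormTS J at h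
    change i.eTS n J y ≤ C * Real.exp (-(δ * i.tdist y y')) * i.supNormTS J
    exact h.trans (wk i y y' hδa' hCa' hC1.le (i.supNormTS_nonneg J))
  · intro α J ζ y y' hα0 hα1 hζ hJ
    have h := hb i α J ζ y y' hα0 hα1 hζ hJ
    change i.h1TS J α ζ ≤ Cα α * Real.exp (-(δb * i.tdist y y')) * (i.hqS α ζ + i.cutSupTS ζ) * i.supNormTS J at h
    change i.h1TS J α ζ ≤ max (Cα α) 0 * Real.exp (-(δ * i.tdist y y')) * (i.hqS α ζ + i.cutSupTS ζ) * i.supNormTS J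
    have hX : 0 ≤ (i.hqS α ζ + i.cutSupTS ζ) * i.supNormTS J :=
      mul_nonneg (add_nonneg (i.hqS_nonneg α ζ) (i.cutSupTS_nonneg ζ)) (i.supNormTS_nonneg J)
    rw [mul_assoc] at h
    rw [mul_assoc]
    exact h.trans (wk i y y' hδb' (le_max_left _ _) (le_max_right _ _) hX)
  · intro ε J y y' hε0 hε1 hJ
    have h := hc i ε J y y' hε0 hε1 hJ
    change i.e4TS J y ≤ Cε ε * Real.exp (-(δc * i.tdist y y')) * (i.holderTS ε J + i.supNormTS J) at h
    change i.e4TS J y ≤ max (Cε ε) 0 * Real.exp (-(δ * i.tdist y y')) * (i.holderTS ε J + i.supNormTS J)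
    exact h.trans (wk i y y' hδc' (le_max_left _ _) (le_max_right _ _) (add_nonneg (i.holderTS_nonneg ε J) (i.supNormTS_nonneg J)))
  · intro α ε J ζ y y' hα0 hε0 hαε hζ hJ
    have h := hd4 i α ε J ζ y y' hα0 hε0 hαε hζ hJ
    change i.h2TS J α ζ ≤ Cαε α ε * Real.exp (-(δd * i.tdist y y')) * (i.hqS α ζ + i.cutSupTS ζ) * (i.holderTS (α + ε) J + i.supNormTS J) at h
    change i.h2TS J α ζ ≤ max (Cαε α ε) 0 * Real.exp (-(δ * i.tdist y y')) * (i.hqS α ζ + i.cutSupTS ζ) * (i.holderTS (α + ε) J + i.supNormTS J)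
    have hX : 0 ≤ (i.hqS α ζ + i.cutSupTS ζ) * (i.holderTS (α + ε) J + i.supNormTS J) :=
      mul_nonneg (add_nonneg (i.hqS_nonneg α ζ) (i.cutSupTS_nonneg ζ)) (add_nonneg (i.holderTS_nonneg _ J) (i.supNormTS_nonneg J))
    rw [mul_assoc] at h
    rw [mul_assoc]
    exact h.trans (wk i y y' hδd' (le_max_left _ _) (le_max_right _ _) hX)
  · intro n J ζ y y' hζ hJ
    change i.l2locTS n J ζ ≤ C * Real.exp (-(δ * i.tdist y y')) * i.cutSupTS ζ * i.l2NormTS J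
    have hX : 0 ≤ i.cutSupTS ζ * i.l2NormTS J := mul_nonneg (i.cutSupTS_nonneg ζ) (i.l2NormTS_nonneg J)
    rw [mul_assoc]
    by_cases hn : n.val ≤ 2
    · have h := (he i).2 n hn J ζ y y' hζ hJ
      change i.l2locTS n J ζ ≤ Ce * Real.exp (-(δe * i.tdist y y')) * i.cutSupTS ζ * i.l2NormTS J at h
      rw [mul_assoc] at h
      exact h.trans (wk i y y' hδe' hCe' hC1.le hX)
    · have h := hf i n (by omega) J ζ y y' hζ hJ
      change i.l2locTS n J ζ ≤ Cf * Real.exp (-(δf * i.tdist y y')) * i.cutSupTS ζ * i.l2NormTS J at h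
      rw [mul_assoc] at h
      exact h.trans (wk i y y' hδf' hCf' hC1.le hX)

end Assembly

/-! ## §20  (v1.6) The (1.113) clause `‖ζ∇G∇*J‖_α` from p38's file M6 (`B6Prop25Eq113TwoScaleV1`, v1.1 `prop25_ineq113_rateFree`), and the FOURTH
conjunct of `B5.Ineq110_114` on the census setting in the printed quantifier order -/

namespace TSIdx

variable {d L : ℕ} {hd : 1 ≤ d + 1} {hL : Odd L ∧ 1 < L} {a₀ a₁ : ℝ} (i : TSIdx d L hd hL a₀ a₁)

/-- the (1.113) entry on the `ten` kind (definitional): `max_μ ‖ζ∇_μG_□∇*J‖_α`, `∇*J = Σ_λ ∇_λ*J_λ`. [cite: Balaban1984PropagatorsI, Prop. 1.2 (1.113) p.36, dictionary] -/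
@[simp] theorem h2TS_ten (J : Fin i.P.d → BondSpace i.P) (α : ℝ) (ζ : Site i.P 0 → ℝ) :
    i.h2TS (.ten J) α ζ = LatticeNorms.supNorm univ (fun lam => i.hqB α (i.smulB ζ (i.Dl lam (i.G (i.divTS J))))) := rfl

/-- the (1.113) entry vanishes on the `vec` kind (source-kind device). [cite: Balaban1984PropagatorsI, Prop. 1.2 (1.113) p.36, dictionary] -/
@[simp] theorem h2TS_vec (J : BondSpace i.P) (α : ℝ) (ζ : Site i.P 0 → ℝ) : i.h2TS (.vec J) α ζ = 0 := rfl

/-- the (1.113) entry vanishes on the `ten2` kind (source-kind device). [cite: Balaban1984PropagatorsI, Prop. 1.2 (1.113) p.36, dictionary] -/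
@[simp] theorem h2TS_ten2 (J : Fin i.P.d → Fin i.P.d → BondSpace i.P) (α : ℝ) (ζ : Site i.P 0 → ℝ) : i.h2TS (.ten2 J) α ζ = 0 := rfl

/-- `0 ≤ h2 J α ζ`. [cite: Balaban1984PropagatorsI, Prop. 1.2 (1.113) p.36] -/
theorem h2TS_nonneg (J : i.LocTS) (α : ℝ) (ζ : Site i.P 0 → ℝ) : 0 ≤ i.h2TS J α ζ := by
  cases J with
  | vec J => rw [h2TS_vec]
  | ten J => rw [h2TS_ten]; exact LatticeNorms.supNorm_nonneg _ _
  | ten2 J => rw [h2TS_ten2]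

/-- **the Hölder hypothesis of p38's (1.112)/(1.113) member theorems at the exponent `α + ε` holds with `X_θ = ‖J‖_{α+ε}`** (`0 < α + ε`): for every
component `λ` and same-direction fine bonds `b, b′`, `|J_λ(b) − J_λ(b′)| ≤ ‖J‖_{α+ε}·(|b₋ − b₋′|_∞/L^j)^{α+ε}` in p38's units.
[cite: Balaban1984PropagatorsI, (1.109) p.35, Prop. 1.2 (1.113) p.36 («‖J‖_{α+ε}»)] -/
theorem abs_sub_le_holderTS_ten' {θ : ℝ} (hθ : 0 < θ) (J : Fin i.P.d → BondSpace i.P) (lam : Fin i.P.d) (b b' : PBond i.P 0)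
    (hdir : b.dir = b'.dir) : |J lam b - J lam b'| ≤ i.holderTS θ (.ten J) * (((supDist b.src b'.src : ℕ) : ℝ) / (L : ℝ) ^ i.j) ^ θ := by
  rw [← i.fdist_eq b.src b'.src]
  exact i.abs_sub_le_holderTS_ten hθ J lam b b' hdir

end TSIdx

section ClauseHolderGradDiv

variable {d L : ℕ} {hd : 1 ≤ d + 1} {hL : Odd L ∧ 1 < L} {a₀ a₁ : ℝ}

open TSIdx
open B6Prop25Eq113TwoScaleV1 (prop25_ineq113_rateFree)
open B6Prop25Eq112TwoScaleV1 (prop25_ineq112)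

/-- **THE (1.113) CLAUSE `‖ζ∇G_□∇*J‖_α` FOR THE GENUINE TWO-SCALE FAMILY** (v1.6): there is `δ₂ > 0` (on `d, L, a₀, a₁`, NOT on `α, ε`) and for every
`0 ≤ α`, `0 < ε`, `α + ε < 1` a `C_{αε} ≥ 0` such that for EVERY member, every source `J` (any kind; the entry lives on the `ten` kind) with
`supp J ⊂ Δ̃(y′)`, every cut-off `ζ` with `supp ζ ⊂ Δ̃(y)`:
`h2 J α ζ = max_μ ‖ζ∇_μG_□∇*J‖_α ≤ C_{αε}·e^{−δ₂|y−y′|}·(‖ζ‖_α + |ζ|)·(‖J‖_{α+ε} + |J|)` — per pair of directions `(μ, λ)` of `∇_μG_□∇_λ*J_λ`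
(`∇*J = Σ_λ∇_λ*J_λ`, `Dl_G_divTS_apply`; constant `×(d+1)`): the near pairs `t = |x − x′|_∞/L^j ≤ 1` are p38 g22's `prop25_ineq113_rateFree` (file M6
v1.1, p337449: `Z_h = ‖ζ‖_α` by `abs_sub_le_hqS`, `Z₀ = |ζ|`, `X = |J|`, `X_θ = ‖J‖_{α+ε}` by `abs_sub_le_holderTS_ten'`, `r = 1`; ONE `δ` before `∀ α, ε` — the
printed quantifier shape, through r03's `B6HjOneLevelBridgeV1.holderBound_DHj_rateFree` / `B6Prop25HolderRateFreeV1` and p38's M5 v1.1), the sup values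
`|(∇_μG_□∇*J)(b)|` on `supp ζ` are p38's (1.112) member `prop25_ineq112` at the exponent `α + ε` (`r = 1`), assembled over all same-direction pairs by
§13's `cut_quotient_le` (far pairs `t > 1`: `t^α ≥ 1`).  RATE `α`-FREE AS PRINTED («This constant depends on d and L only»).
[cite: Balaban1984PropagatorsII, Prop. 2.5 p.246; Balaban1984PropagatorsI, Prop. 1.2 (1.113) p.36] -/
theorem ineq113_TS (ha₀ : 0 < a₀) (ha₁ : a₀ ≤ a₁) :
    ∃ δ : ℝ, 0 < δ ∧ ∀ α ε : ℝ, 0 ≤ α → 0 < ε → α + ε < 1 → ∃ C : ℝ, 0 ≤ C ∧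
      ∀ (i : TSIdx d L hd hL a₀ a₁) (J : i.LocTS) (ζ : Site i.P 0 → ℝ) (y y' : Site i.P i.j),
      i.cutInTS ζ y → i.suppInTS J y' →
      i.h2TS J α ζ ≤ C * Real.exp (-(δ * i.tdist y y')) * (i.hqS α ζ + i.cutSupTS ζ) * (i.holderTS (α + ε) J + i.supNormTS J) := by
  classical
  obtain ⟨δH, hδH, HH⟩ := prop25_ineq113_rateFree d L hd hL ha₀ ha₁
  obtain ⟨δS, hδS, HS⟩ := prop25_ineq112 d L hd hL ha₀ ha₁
  refine ⟨min δH δS, lt_min hδH hδS, fun α ε hα0 hε0 hαε => ?_⟩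
  have hθ0 : 0 < α + ε := by linarith
  obtain ⟨CH, hCH, hH⟩ := HH α ε hα0 hε0 hαε
  obtain ⟨CS, hCS, hS⟩ := HS (α + ε) hθ0 hαε
  refine ⟨((d : ℝ) + 1) * (CH * Real.exp ((1 + 2 * δH) * (1 + 4)) + 2 * (CS * Real.exp ((1 + 2 * δS) * (1 + 3)))), by positivity, ?_⟩
  intro i J ζ y y' hζ hJ
  have hmin0 : 0 ≤ min δH δS := (lt_min hδH hδS).le
  have hZh0 : 0 ≤ i.hqS α ζ := i.hqS_nonneg α ζ
  have hZ00 : 0 ≤ i.cutSupTS ζ := i.cutSupTS_nonneg ζ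
  have hX0 : 0 ≤ i.supNormTS J := i.supNormTS_nonneg _
  have hXθ0 : 0 ≤ i.holderTS (α + ε) J := i.holderTS_nonneg _ _
  have ht0 : 0 ≤ i.tdist y y' := i.tdist_nonneg y y'
  have hEH : Real.exp (-(δH * i.tdist y y')) ≤ Real.exp (-(min δH δS * i.tdist y y')) :=
    Real.exp_le_exp.2 (neg_le_neg (mul_le_mul_of_nonneg_right (min_le_left _ _) ht0))
  have hES : Real.exp (-(δS * i.tdist y y')) ≤ Real.exp (-(min δH δS * i.tdist y y')) :=
    Real.exp_le_exp.2 (neg_le_neg (mul_le_mul_of_nonneg_right (min_le_right _ _) ht0))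
  have hRHS : 0 ≤ ((d : ℝ) + 1) * (CH * Real.exp ((1 + 2 * δH) * (1 + 4)) + 2 * (CS * Real.exp ((1 + 2 * δS) * (1 + 3)))) *
      Real.exp (-(min δH δS * i.tdist y y')) * (i.hqS α ζ + i.cutSupTS ζ) * (i.holderTS (α + ε) J + i.supNormTS J) := by positivity
  cases J with
  | vec J => rw [h2TS_vec]; exact hRHS
  | ten2 J => rw [h2TS_ten2]; exact hRHS
  | ten J =>
    rw [h2TS_ten]
    refine LatticeNorms.supNorm_le hRHS fun mu _ => ?_
    rw [Real.norm_eq_abs, abs_of_nonneg (i.hqB_nonneg _ _)]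
    -- the Hölder hypothesis on the source at the exponent `α + ε`, with `X_θ = ‖J‖_{α+ε}`
    have hHJ : ∀ (lam : Fin i.P.d) (b b' : PBond i.P 0), b.dir = b'.dir → supDist b.src b'.src ≤ L ^ i.j →
        |J lam b - J lam b'| ≤ i.holderTS (α + ε) (.ten J) * (((supDist b.src b'.src : ℕ) : ℝ) / (L : ℝ) ^ i.j) ^ (α + ε) :=
      fun lam b b' hdir _ => i.abs_sub_le_holderTS_ten' hθ0 J lam b b' hdir
    -- (a) the near-pair cut bound for `∇_μG_□∇*J = Σ_λ ∇_μG_□∇_λ*J_λ`, per `λ` from p38's member theorem at `r = 1`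
    have hnear : ∀ b₁ b₂ : PBond i.P 0, b₁.src ≠ b₂.src → b₁.dir = b₂.dir → supDist b₁.src b₂.src ≤ L ^ i.j →
        |ζ b₁.src * i.Dl mu (i.G (i.divTS J)) b₁ - ζ b₂.src * i.Dl mu (i.G (i.divTS J)) b₂| ≤
          ((d : ℝ) + 1) * (CH * Real.exp ((1 + 2 * δH) * (1 + 4)) * Real.exp (-(δH * i.tdist y y')) * (i.hqS α ζ + i.cutSupTS ζ) *
            (i.holderTS (α + ε) (.ten J) + i.supNormTS (.ten J))) * i.fdist b₁.src b₂.src ^ α := by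
      intro b₁ b₂ hne hdir hle
      have hζh : |ζ b₁.src - ζ b₂.src| ≤ i.hqS α ζ * (((supDist b₁.src b₂.src : ℕ) : ℝ) / (L : ℝ) ^ i.j) ^ α := by
        rw [← i.fdist_eq b₁.src b₂.src]; exact i.abs_sub_le_hqS α ζ hne
      have hterm : ∀ lam : Fin i.P.d, |ζ b₁.src * i.Dl mu (i.G (i.Dla lam (J lam))) b₁ - ζ b₂.src * i.Dl mu (i.G (i.Dla lam (J lam))) b₂| ≤
          CH * Real.exp ((1 + 2 * δH) * (1 + 4)) * Real.exp (-(δH * i.tdist y y')) * (i.hqS α ζ + i.cutSupTS ζ) *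
            (i.holderTS (α + ε) (.ten J) + i.supNormTS (.ten J)) * i.fdist b₁.src b₂.src ^ α := by
        intro lam
        have h1 := hH i.m i.K i.j i.hc i.hj i.Λ' i.w i.hw0 i.hw1 lam mu 1 zero_le_one (J lam) (i.supNormTS (.ten J))
          (i.holderTS (α + ε) (.ten J)) hX0 hXθ0 y y' (hJ lam) (fun b' => i.abs_le_supNormTS_ten J lam b') (hHJ lam) ζ (i.hqS α ζ)
          (i.cutSupTS ζ) hZh0 hZ00 hζ (fun x => i.abs_le_cutSupTS ζ x) b₁ b₂ hdir hle hζh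
        rw [← i.fdist_eq b₁.src b₂.src] at h1
        exact h1
      rw [Dl_G_divTS_apply, Dl_G_divTS_apply, Finset.mul_sum, Finset.mul_sum, ← Finset.sum_sub_distrib]
      refine (Finset.abs_sum_le_sum_abs _ _).trans ?_
      calc ∑ lam, |ζ b₁.src * i.Dl mu (i.G (i.Dla lam (J lam))) b₁ - ζ b₂.src * i.Dl mu (i.G (i.Dla lam (J lam))) b₂|
          ≤ ∑ _lam : Fin i.P.d, CH * Real.exp ((1 + 2 * δH) * (1 + 4)) * Real.exp (-(δH * i.tdist y y')) * (i.hqS α ζ + i.cutSupTS ζ) *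
              (i.holderTS (α + ε) (.ten J) + i.supNormTS (.ten J)) * i.fdist b₁.src b₂.src ^ α := Finset.sum_le_sum fun lam _ => hterm lam
        _ = _ := by
            rw [Finset.sum_const, Finset.card_univ, Fintype.card_fin, nsmul_eq_mul]
            push_cast
            ring
    -- (b) the sup values `|(∇_μG_□∇*J)(b)|` where `ζ(b₋) ≠ 0` (p38's (1.112) member at the exponent `α + ε`, `r = 1`, summed over `λ`)
    have hfar : ∀ b : PBond i.P 0, ζ b.src ≠ 0 →
        |i.Dl mu (i.G (i.divTS J)) b| ≤ ((d : ℝ) + 1) * (CS * Real.exp ((1 + 2 * δS) * (1 + 3)) * Real.exp (-(δS * i.tdist y y')) *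
          (i.holderTS (α + ε) (.ten J) + i.supNormTS (.ten J))) := by
      intro b hz
      rw [Dl_G_divTS_apply]
      refine (Finset.abs_sum_le_sum_abs _ _).trans ?_
      calc ∑ lam, |i.Dl mu (i.G (i.Dla lam (J lam))) b|
          ≤ ∑ _lam : Fin i.P.d, CS * Real.exp ((1 + 2 * δS) * (1 + 3)) * Real.exp (-(δS * i.tdist y y')) *
              (i.holderTS (α + ε) (.ten J) + i.supNormTS (.ten J)) :=
            Finset.sum_le_sum fun lam _ => hS i.m i.K i.j i.hc i.hj i.Λ' i.w i.hw0 i.hw1 lam mu 1 zero_le_one (J lam) (i.supNormTS (.ten J))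
              (i.holderTS (α + ε) (.ten J)) hX0 hXθ0 y y' (hJ lam) (fun b' => i.abs_le_supNormTS_ten J lam b') (hHJ lam) b (hζ _ hz)
        _ = _ := by
            rw [Finset.sum_const, Finset.card_univ, Fintype.card_fin, nsmul_eq_mul]
            push_cast
            ring
    -- (c) assembly over all same-direction pairs
    refine i.hqB_le hRHS fun b₁ b₂ hne hdir => ?_
    rw [smulB_apply, smulB_apply]
    have hA0 : 0 ≤ ((d : ℝ) + 1) * (CH * Real.exp ((1 + 2 * δH) * (1 + 4)) * Real.exp (-(δH * i.tdist y y')) * (i.hqS α ζ + i.cutSupTS ζ) *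
        (i.holderTS (α + ε) (.ten J) + i.supNormTS (.ten J))) := by positivity
    have hB0 : 0 ≤ ((d : ℝ) + 1) * (CS * Real.exp ((1 + 2 * δS) * (1 + 3)) * Real.exp (-(δS * i.tdist y y')) *
        (i.holderTS (α + ε) (.ten J) + i.supNormTS (.ten J))) := by positivity
    refine (i.cut_quotient_le hα0 (i.Dl mu (i.G (i.divTS J))) ζ hA0 hB0 hZ00 (fun x => i.abs_le_cutSupTS ζ x) hnear hfar hne hdir).trans ?_
    have hXX : 0 ≤ i.holderTS (α + ε) (.ten J) + i.supNormTS (.ten J) := add_nonneg hXθ0 hX0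
    have hA_le : ((d : ℝ) + 1) * (CH * Real.exp ((1 + 2 * δH) * (1 + 4)) * Real.exp (-(δH * i.tdist y y')) * (i.hqS α ζ + i.cutSupTS ζ) *
        (i.holderTS (α + ε) (.ten J) + i.supNormTS (.ten J))) ≤ ((d : ℝ) + 1) * (CH * Real.exp ((1 + 2 * δH) * (1 + 4)) *
          Real.exp (-(min δH δS * i.tdist y y')) * (i.hqS α ζ + i.cutSupTS ζ) * (i.holderTS (α + ε) (.ten J) + i.supNormTS (.ten J))) :=
      mul_le_mul_of_nonneg_left (mul_le_mul_of_nonneg_right (mul_le_mul_of_nonneg_right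
        (mul_le_mul_of_nonneg_left hEH (by positivity)) (add_nonneg hZh0 hZ00)) hXX) (by positivity)
    have hB_le : 2 * (i.cutSupTS ζ * (((d : ℝ) + 1) * (CS * Real.exp ((1 + 2 * δS) * (1 + 3)) * Real.exp (-(δS * i.tdist y y')) *
        (i.holderTS (α + ε) (.ten J) + i.supNormTS (.ten J))))) ≤
        2 * ((i.hqS α ζ + i.cutSupTS ζ) * (((d : ℝ) + 1) * (CS * Real.exp ((1 + 2 * δS) * (1 + 3)) * Real.exp (-(min δH δS * i.tdist y y')) *
          (i.holderTS (α + ε) (.ten J) + i.supNormTS (.ten J))))) :=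
      mul_le_mul_of_nonneg_left (mul_le_mul (le_add_of_nonneg_left hZh0)
        (mul_le_mul_of_nonneg_left (mul_le_mul_of_nonneg_right (mul_le_mul_of_nonneg_left hES (by positivity)) hXX) (by positivity))
        (by positivity) (add_nonneg hZh0 hZ00)) (by norm_num)
    calc _ ≤ _ := add_le_add hA_le hB_le
      _ = ((d : ℝ) + 1) * (CH * Real.exp ((1 + 2 * δH) * (1 + 4)) + 2 * (CS * Real.exp ((1 + 2 * δS) * (1 + 3)))) *
            Real.exp (-(min δH δS * i.tdist y y')) * (i.hqS α ζ + i.cutSupTS ζ) * (i.holderTS (α + ε) (.ten J) + i.supNormTS (.ten J)) := by ring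

/-- **THE FOURTH CONJUNCT OF `B5.Ineq110_114` ON THE CENSUS SETTING, VERBATIM, IN THE PRINTED QUANTIFIER ORDER** (v1.6): there are `δ > 0` and a
constant function `C_{αε}` (both chosen before the member) such that for EVERY member of the genuine two-scale family, ALL source kinds, every
`0 ≤ α`, `0 < ε`, `α + ε < 1`, `supp ζ ⊂ Δ̃(y)`, `supp J ⊂ Δ̃(y′)`:
`(settingTS i).h2 J α ζ ≤ C_{αε}·e^{−δ·dist(y,y′)}·cutH α ζ·(holder (α+ε) J + supNorm J)` («‖ζ∇G∇*J‖_α ≤ O(1)e^{−δ₀|y−y′|}(‖ζ‖_α + |ζ|)(‖J‖_{α+ε} + |J|)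
for 0 ≤ α, 0 < ε, α + ε < 1 … with the constant O(1) depending on d, α, ε»; «with a positive constant δ₂ instead of δ₀. This constant depends on d and
L only») — exactly the hypothesis `h4` of §19's `prop25Printed_locTS_of`. [cite: Balaban1984PropagatorsII, Prop. 2.5 p.246; Balaban1984PropagatorsI, Prop. 1.2 (1.113) p.36] -/
theorem ineq113_settingTS (ha₀ : 0 < a₀) (ha₁ : a₀ ≤ a₁) :
    ∃ δ : ℝ, 0 < δ ∧ ∃ Cαε : ℝ → ℝ → ℝ, ∀ (i : TSIdx d L hd hL a₀ a₁) (α ε : ℝ) (J : (settingTS i).Loc) (ζ : (settingTS i).Cut)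
      (y y' : (settingTS i).Site), 0 ≤ α → 0 < ε → α + ε < 1 → (settingTS i).cutIn ζ y → (settingTS i).suppIn J y' →
      (settingTS i).h2 J α ζ ≤ Cαε α ε * Real.exp (-(δ * (settingTS i).dist y y')) * (settingTS i).cutH α ζ *
        ((settingTS i).holder (α + ε) J + (settingTS i).supNorm J) := by
  classical
  obtain ⟨δ, hδ, h⟩ := ineq113_TS (d := d) (L := L) (hd := hd) (hL := hL) ha₀ ha₁
  refine ⟨δ, hδ, fun α ε => if hαε : 0 ≤ α ∧ 0 < ε ∧ α + ε < 1 then Classical.choose (h α ε hαε.1 hαε.2.1 hαε.2.2) else 0, ?_⟩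
  intro i α ε J ζ y y' hα0 hε0 hαε hζ hJ
  have hC : (if hαε : 0 ≤ α ∧ 0 < ε ∧ α + ε < 1 then Classical.choose (h α ε hαε.1 hαε.2.1 hαε.2.2) else 0) =
      Classical.choose (h α ε hα0 hε0 hαε) := dif_pos ⟨hα0, hε0, hαε⟩
  change i.h2TS J α ζ ≤ (if hαε : 0 ≤ α ∧ 0 < ε ∧ α + ε < 1 then Classical.choose (h α ε hαε.1 hαε.2.1 hαε.2.2) else 0) *
    Real.exp (-(δ * i.tdist y y')) * (i.hqS α ζ + i.cutSupTS ζ) * (i.holderTS (α + ε) J + i.supNormTS J)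
  rw [hC]
  exact (Classical.choose_spec (h α ε hα0 hε0 hαε)).2 i J ζ y y' hζ hJ

end ClauseHolderGradDiv

/-! ## §21  (v1.6) Twelve clauses with one `δ`, and the assembly edge with only the (1.114)₄₋₆ clause family left as a hypothesis -/

namespace TSIdx

variable {d L : ℕ} {hd : 1 ≤ d + 1} {hL : Odd L ∧ 1 < L} {a₀ a₁ : ℝ} (i : TSIdx d L hd hL a₀ a₁)

/-- the (1.114)₄ entry on the `ten` kind (definitional): `(Σ_λ‖ζ∇_λG_□∇*J‖²)^{1/2}` — the slot `l2loc 3` the remaining hypothesis `h5` reads.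
[cite: Balaban1984PropagatorsI, Prop. 1.2 (1.114) p.36, dictionary] -/
@[simp] theorem l2locTS_three_ten (J : Fin i.P.d → BondSpace i.P) (ζ : Site i.P 0 → ℝ) :
    i.l2locTS 3 (.ten J) ζ = Real.sqrt (∑ lam, ‖i.smulB ζ (i.Dl lam (i.G (i.divTS J)))‖ ^ 2) := rfl

/-- the (1.114)₄ entry vanishes on the `vec` kind (source-kind device). [cite: Balaban1984PropagatorsI, Prop. 1.2 (1.114) p.36, dictionary] -/
@[simp] theorem l2locTS_three_vec (J : BondSpace i.P) (ζ : Site i.P 0 → ℝ) : i.l2locTS 3 (.vec J) ζ = 0 := rfl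

/-- the (1.114)₄ entry vanishes on the `ten2` kind (source-kind device). [cite: Balaban1984PropagatorsI, Prop. 1.2 (1.114) p.36, dictionary] -/
@[simp] theorem l2locTS_three_ten2 (J : Fin i.P.d → Fin i.P.d → BondSpace i.P) (ζ : Site i.P 0 → ℝ) : i.l2locTS 3 (.ten2 J) ζ = 0 := rfl

/-- the (1.114)₅ entry on the `vec` kind (definitional): `(Σ_{λμ}‖ζ∇_λ∇_μG_□J‖²)^{1/2}` — slot `l2loc 4`. [cite: Balaban1984PropagatorsI, Prop. 1.2 (1.114) p.36, dictionary] -/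
@[simp] theorem l2locTS_four_vec (J : BondSpace i.P) (ζ : Site i.P 0 → ℝ) :
    i.l2locTS 4 (.vec J) ζ = Real.sqrt (∑ lam, ∑ mu, ‖i.smulB ζ (i.Dl lam (i.Dl mu (i.G J)))‖ ^ 2) := rfl

/-- the (1.114)₅ entry vanishes on the `ten` kind (source-kind device). [cite: Balaban1984PropagatorsI, Prop. 1.2 (1.114) p.36, dictionary] -/
@[simp] theorem l2locTS_four_ten (J : Fin i.P.d → BondSpace i.P) (ζ : Site i.P 0 → ℝ) : i.l2locTS 4 (.ten J) ζ = 0 := rfl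

/-- the (1.114)₅ entry vanishes on the `ten2` kind (source-kind device). [cite: Balaban1984PropagatorsI, Prop. 1.2 (1.114) p.36, dictionary] -/
@[simp] theorem l2locTS_four_ten2 (J : Fin i.P.d → Fin i.P.d → BondSpace i.P) (ζ : Site i.P 0 → ℝ) : i.l2locTS 4 (.ten2 J) ζ = 0 := rfl

/-- the (1.114)₆ entry on the `ten2` kind (definitional): `‖ζG_□∇*∇*J‖`, `∇*∇*J = Σ_{λμ}∇_λ*∇_μ*J_{λμ}` — slot `l2loc 5`.
[cite: Balaban1984PropagatorsI, Prop. 1.2 (1.114) p.36, dictionary] -/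
@[simp] theorem l2locTS_five_ten2 (J : Fin i.P.d → Fin i.P.d → BondSpace i.P) (ζ : Site i.P 0 → ℝ) :
    i.l2locTS 5 (.ten2 J) ζ = ‖i.smulB ζ (i.G (i.div2TS J))‖ := rfl

/-- the (1.114)₆ entry vanishes on the `vec` kind (source-kind device). [cite: Balaban1984PropagatorsI, Prop. 1.2 (1.114) p.36, dictionary] -/
@[simp] theorem l2locTS_five_vec (J : BondSpace i.P) (ζ : Site i.P 0 → ℝ) : i.l2locTS 5 (.vec J) ζ = 0 := rfl

/-- the (1.114)₆ entry vanishes on the `ten` kind (source-kind device). [cite: Balaban1984PropagatorsI, Prop. 1.2 (1.114) p.36, dictionary] -/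
@[simp] theorem l2locTS_five_ten (J : Fin i.P.d → BondSpace i.P) (ζ : Site i.P 0 → ℝ) : i.l2locTS 5 (.ten J) ζ = 0 := rfl

/-- `(G∇*∇*J)(b) = Σ_λ Σ_μ (G∇_λ*∇_μ*J_{λμ})(b)` (linearity). [cite: Balaban1984PropagatorsI, (1.89) p.33 («G∇*∇*J»), dictionary] -/
theorem G_div2TS_apply (J : Fin i.P.d → Fin i.P.d → BondSpace i.P) (b : PBond i.P 0) :
    i.G (i.div2TS J) b = ∑ lam, ∑ mu, i.G (i.Dla lam (i.Dla mu (J lam mu))) b := by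
  unfold div2TS
  rw [map_sum, WithLp.ofLp_sum, Finset.sum_apply]
  refine Finset.sum_congr rfl fun lam _ => ?_
  rw [map_sum, WithLp.ofLp_sum, Finset.sum_apply]

end TSIdx

section AssemblyFour

variable {d L : ℕ} {hd : 1 ≤ d + 1} {hL : Odd L ∧ 1 < L} {a₀ a₁ : ℝ}

open TSIdx

/-- **THE FIRST FOUR CONJUNCTS OF `B5.Ineq110_114` ON THE CENSUS SETTING IN FULL, AND THE FIFTH AT `n ≤ 2`, WITH ONE `(δ₂, C, C_α, C_ε, C_{αε})`** (v1.6):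
for every member of the genuine two-scale family — (1.110) all four members (§18 `ineq110_settingTS`), (1.111) both members for all `0 ≤ α < 1`
(§15 `ineq111_settingTS`), (1.112) (§16 `ineq112_settingTS`), (1.113) (§20 `ineq113_settingTS`) and (1.114)₁,₂,₃ (§11 `clauses_settingTS_six`), one rate
`δ > 0` and the constants chosen BEFORE the member (common rate the minimum; `C` enlarged to the maximum).  NOT claimed: the fifth conjunct at
`n = 3, 4, 5` ((1.114)₄₋₆: `(Σ_λ‖ζ∇_λG_□∇*J‖²)^{1/2}`, `(Σ_{λμ}‖ζ∇_λ∇_μG_□J‖²)^{1/2}`, `‖ζG_□∇*∇*J‖` — p22's two-scale files to come; one-level inputs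
`B6L2Block114GEV1` p336105) — hence neither `B5.Ineq110_114 (settingTS i) …` nor `B6.Prop25Printed (locTS …)`.
[cite: Balaban1984PropagatorsII, Prop. 2.5 p.246; Balaban1984PropagatorsI, Prop. 1.2 (1.110)–(1.114) pp.35–36] -/
theorem clauses_settingTS_twelve (ha₀ : 0 < a₀) (ha₁ : a₀ ≤ a₁) :
    ∃ δ : ℝ, 0 < δ ∧ ∃ C : ℝ, 0 < C ∧ ∃ (Cα Cε : ℝ → ℝ) (Cαε : ℝ → ℝ → ℝ), ∀ i : TSIdx d L hd hL a₀ a₁,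
      (∀ (n : Fin 4) (J : (settingTS i).Loc) (y y' : (settingTS i).Site), (settingTS i).suppIn J y' →
          (settingTS i).e n J y ≤ C * Real.exp (-(δ * (settingTS i).dist y y')) * (settingTS i).supNorm J) ∧
      (∀ (α : ℝ) (J : (settingTS i).Loc) (ζ : (settingTS i).Cut) (y y' : (settingTS i).Site), 0 ≤ α → α < 1 →
          (settingTS i).cutIn ζ y → (settingTS i).suppIn J y' →
          (settingTS i).h1 J α ζ ≤ Cα α * Real.exp (-(δ * (settingTS i).dist y y')) * (settingTS i).cutH α ζ * (settingTS i).supNorm J) ∧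
      (∀ (ε : ℝ) (J : (settingTS i).Loc) (y y' : (settingTS i).Site), 0 < ε → ε < 1 → (settingTS i).suppIn J y' →
          (settingTS i).e4 J y ≤ Cε ε * Real.exp (-(δ * (settingTS i).dist y y')) * ((settingTS i).holder ε J + (settingTS i).supNorm J)) ∧
      (∀ (α ε : ℝ) (J : (settingTS i).Loc) (ζ : (settingTS i).Cut) (y y' : (settingTS i).Site), 0 ≤ α → 0 < ε → α + ε < 1 →
          (settingTS i).cutIn ζ y → (settingTS i).suppIn J y' →
          (settingTS i).h2 J α ζ ≤ Cαε α ε * Real.exp (-(δ * (settingTS i).dist y y')) * (settingTS i).cutH α ζ *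
            ((settingTS i).holder (α + ε) J + (settingTS i).supNorm J)) ∧
      (∀ n : Fin 6, n.val ≤ 2 → ∀ (J : (settingTS i).Loc) (ζ : (settingTS i).Cut) (y y' : (settingTS i).Site),
          (settingTS i).cutIn ζ y → (settingTS i).suppIn J y' →
          (settingTS i).l2loc n J ζ ≤ C * Real.exp (-(δ * (settingTS i).dist y y')) * (settingTS i).cutSup ζ * (settingTS i).l2Norm J) := by
  classical
  obtain ⟨δa, hδa, Ca, hCa, ha⟩ := ineq110_settingTS (d := d) (L := L) (hd := hd) (hL := hL) ha₀ ha₁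
  obtain ⟨δb, hδb, Cα, hb⟩ := ineq111_settingTS (d := d) (L := L) (hd := hd) (hL := hL) ha₀ ha₁
  obtain ⟨δc, hδc, Cε, hc⟩ := ineq112_settingTS (d := d) (L := L) (hd := hd) (hL := hL) ha₀ ha₁
  obtain ⟨δd, hδd, Cαε, hd4⟩ := ineq113_settingTS (d := d) (L := L) (hd := hd) (hL := hL) ha₀ ha₁
  obtain ⟨δe, hδe, Ce, hCe, he⟩ := clauses_settingTS_six (d := d) (L := L) (hd := hd) (hL := hL) ha₀ ha₁
  set δ := min (min δa (min δb δc)) (min δd δe) with hδdef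
  have hδ0 : 0 < δ := lt_min (lt_min hδa (lt_min hδb hδc)) (lt_min hδd hδe)
  have hδa' : δ ≤ δa := (min_le_left _ _).trans (min_le_left _ _)
  have hδb' : δ ≤ δb := (min_le_left _ _).trans ((min_le_right _ _).trans (min_le_left _ _))
  have hδc' : δ ≤ δc := (min_le_left _ _).trans ((min_le_right _ _).trans (min_le_right _ _))
  have hδd' : δ ≤ δd := (min_le_right _ _).trans (min_le_left _ _)
  have hδe' : δ ≤ δe := (min_le_right _ _).trans (min_le_right _ _)
  set C := max (max Ca Ce) 1 with hCdef
  have hC1 : 0 < C := lt_of_lt_of_le one_pos (le_max_right _ _)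
  have hCa' : Ca ≤ C := (le_max_left Ca Ce).trans (le_max_left _ _)
  have hCe' : Ce ≤ C := (le_max_right Ca Ce).trans (le_max_left _ _)
  -- weakening the rate and enlarging the constant (nonnegative target constant)
  have wk : ∀ (i : TSIdx d L hd hL a₀ a₁) (y y' : Site i.P i.j) {δ' K K' X : ℝ}, δ ≤ δ' → K ≤ K' → 0 ≤ K' → 0 ≤ X →
      K * Real.exp (-(δ' * i.tdist y y')) * X ≤ K' * Real.exp (-(δ * i.tdist y y')) * X := by
    intro i y y' δ' K K' X hδ' hK hK' hX
    exact mul_le_mul (mul_le_mul hK (Real.exp_le_exp.2 (neg_le_neg (mul_le_mul_of_nonneg_right hδ' (i.tdist_nonneg y y'))))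
      (Real.exp_nonneg _) hK') le_rfl hX (mul_nonneg hK' (Real.exp_nonneg _))
  refine ⟨δ, hδ0, C, hC1, fun α => max (Cα α) 0, fun ε => max (Cε ε) 0, fun α ε => max (Cαε α ε) 0, fun i => ⟨?_, ?_, ?_, ?_, ?_⟩⟩
  · intro n J y y' hJ
    have h := ha i n J y y' hJ
    change i.eTS n J y ≤ Ca * Real.exp (-(δa * i.tdist y y')) * i.supNormTS J at h
    change i.eTS n J y ≤ C * Real.exp (-(δ * i.tdist y y')) * i.supNormTS J
    exact h.trans (wk i y y' hδa' hCa' hC1.le (i.supNormTS_nonneg J))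
  · intro α J ζ y y' hα0 hα1 hζ hJ
    have h := hb i α J ζ y y' hα0 hα1 hζ hJ
    change i.h1TS J α ζ ≤ Cα α * Real.exp (-(δb * i.tdist y y')) * (i.hqS α ζ + i.cutSupTS ζ) * i.supNormTS J at h
    change i.h1TS J α ζ ≤ max (Cα α) 0 * Real.exp (-(δ * i.tdist y y')) * (i.hqS α ζ + i.cutSupTS ζ) * i.supNormTS J
    have hX : 0 ≤ (i.hqS α ζ + i.cutSupTS ζ) * i.supNormTS J :=
      mul_nonneg (add_nonneg (i.hqS_nonneg α ζ) (i.cutSupTS_nonneg ζ)) (i.supNormTS_nonneg J)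
    rw [mul_assoc] at h
    rw [mul_assoc]
    exact h.trans (wk i y y' hδb' (le_max_left _ _) (le_max_right _ _) hX)
  · intro ε J y y' hε0 hε1 hJ
    have h := hc i ε J y y' hε0 hε1 hJ
    change i.e4TS J y ≤ Cε ε * Real.exp (-(δc * i.tdist y y')) * (i.holderTS ε J + i.supNormTS J) at h
    change i.e4TS J y ≤ max (Cε ε) 0 * Real.exp (-(δ * i.tdist y y')) * (i.holderTS ε J + i.supNormTS J)
    exact h.trans (wk i y y' hδc' (le_max_left _ _) (le_max_right _ _) (add_nonneg (i.holderTS_nonneg ε J) (i.supNormTS_nonneg J)))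
  · intro α ε J ζ y y' hα0 hε0 hαε hζ hJ
    have h := hd4 i α ε J ζ y y' hα0 hε0 hαε hζ hJ
    change i.h2TS J α ζ ≤ Cαε α ε * Real.exp (-(δd * i.tdist y y')) * (i.hqS α ζ + i.cutSupTS ζ) * (i.holderTS (α + ε) J + i.supNormTS J) at h
    change i.h2TS J α ζ ≤ max (Cαε α ε) 0 * Real.exp (-(δ * i.tdist y y')) * (i.hqS α ζ + i.cutSupTS ζ) * (i.holderTS (α + ε) J + i.supNormTS J)
    have hX : 0 ≤ (i.hqS α ζ + i.cutSupTS ζ) * (i.holderTS (α + ε) J + i.supNormTS J) :=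
      mul_nonneg (add_nonneg (i.hqS_nonneg α ζ) (i.cutSupTS_nonneg ζ)) (add_nonneg (i.holderTS_nonneg _ J) (i.supNormTS_nonneg J))
    rw [mul_assoc] at h
    rw [mul_assoc]
    exact h.trans (wk i y y' hδd' (le_max_left _ _) (le_max_right _ _) hX)
  · intro n hn J ζ y y' hζ hJ
    have h := (he i).2 n hn J ζ y y' hζ hJ
    change i.l2locTS n J ζ ≤ Ce * Real.exp (-(δe * i.tdist y y')) * i.cutSupTS ζ * i.l2NormTS J at h
    change i.l2locTS n J ζ ≤ C * Real.exp (-(δ * i.tdist y y')) * i.cutSupTS ζ * i.l2NormTS J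
    have hX : 0 ≤ i.cutSupTS ζ * i.l2NormTS J := mul_nonneg (i.cutSupTS_nonneg ζ) (i.l2NormTS_nonneg J)
    rw [mul_assoc] at h
    rw [mul_assoc]
    exact h.trans (wk i y y' hδe' hCe' hC1.le hX)

/-- **THE ASSEMBLY EDGE FOR PROPOSITION 2.5 ON THE CENSUS CARRIER, ONE HYPOTHESIS LEFT** (v1.6): `B6.Prop25Printed (fun i => locTS i)` — (2.129) for every
member AND `B5.Ineq110_114 (settingTS i) C C_α C_ε C_αε δ₂` with the constants chosen before the member — FOLLOWS from the ONE clause family NOT yet in the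
tree for the genuine two-scale `G_□`: the FIFTH conjunct at `n = 3, 4, 5` ((1.114)₄₋₆, slots `l2loc 3/4/5`; p22's two-scale `ℓ²`-block files to come).  The
(1.113) hypothesis `h4` of §19's `prop25Printed_locTS_of` is DISCHARGED by §20's `ineq113_settingTS`.  An IMPLICATION (reduction edge), not an inhabitation:
`B6.Prop25Printed (locTS …)` is NOT claimed. [cite: Balaban1984PropagatorsII, Prop. 2.5 p.246; Balaban1984PropagatorsI, Prop. 1.2 (1.110)–(1.114) pp.35–36] -/
theorem prop25Printed_locTS_of114 (ha₀ : 0 < a₀) (ha₁ : a₀ ≤ a₁)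
    (h5 : ∃ δ : ℝ, 0 < δ ∧ ∃ C : ℝ, 0 ≤ C ∧ ∀ (i : TSIdx d L hd hL a₀ a₁) (n : Fin 6), 3 ≤ n.val → ∀ (J : (settingTS i).Loc)
      (ζ : (settingTS i).Cut) (y y' : (settingTS i).Site), (settingTS i).cutIn ζ y → (settingTS i).suppIn J y' →
      (settingTS i).l2loc n J ζ ≤ C * Real.exp (-(δ * (settingTS i).dist y y')) * (settingTS i).cutSup ζ * (settingTS i).l2Norm J) :
    B6.Prop25Printed (fun i : TSIdx d L hd hL a₀ a₁ => locTS i) :=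
  prop25Printed_locTS_of ha₀ ha₁ (ineq113_settingTS (d := d) (L := L) (hd := hd) (hL := hL) ha₀ ha₁) h5

end AssemblyFour

/-! ## §22  (v1.7) The (1.114)₄,₅,₆ clauses `‖ζ∇G∇*J‖`, `‖ζ∇∇GJ‖`, `‖ζG∇*∇*J‖` from p22's files 27/28b (`B6Prop25Grad2DecayTwoScaleV1`,
`B6Prop25GradGDivDecayTwoScaleV1`), the FIFTH conjunct of `B5.Ineq110_114` on the census setting in full, and PROPOSITION 2.5 ON THE CENSUS CARRIER -/

namespace TSIdx

variable {d L : ℕ} {hd : 1 ≤ d + 1} {hL : Odd L ∧ 1 < L} {a₀ a₁ : ℝ} (i : TSIdx d L hd hL a₀ a₁)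

/-- `‖J_{λμ}‖ ≤ ‖J‖` for a `ten2` source. [cite: Balaban1984PropagatorsI, (1.21) p.21, (1.114) p.36] -/
theorem norm_le_l2NormTS_ten2 (J : Fin i.P.d → Fin i.P.d → BondSpace i.P) (lam mu : Fin i.P.d) : ‖J lam mu‖ ≤ i.l2NormTS (.ten2 J) := by
  show ‖J lam mu‖ ≤ Real.sqrt (∑ lam', ∑ mu', ‖J lam' mu'‖ ^ 2)
  rw [← Real.sqrt_sq (norm_nonneg (J lam mu))]
  refine Real.sqrt_le_sqrt ?_
  calc ‖J lam mu‖ ^ 2 ≤ ∑ mu', ‖J lam mu'‖ ^ 2 := Finset.single_le_sum (fun mu' _ => sq_nonneg ‖J lam mu'‖) (Finset.mem_univ mu)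
    _ ≤ ∑ lam', ∑ mu', ‖J lam' mu'‖ ^ 2 :=
        Finset.single_le_sum (f := fun lam' => ∑ mu', ‖J lam' mu'‖ ^ 2) (fun lam' _ => Finset.sum_nonneg fun mu' _ => sq_nonneg _) (Finset.mem_univ lam)

/-- `‖ζA‖² = Σ_b (ζ(b₋)A(b))²`. [cite: Balaban1984PropagatorsI, (1.114) p.36, dictionary] -/
theorem norm_smulB_sq (ζ : Site i.P 0 → ℝ) (A : BondSpace i.P) : ‖i.smulB ζ A‖ ^ 2 = ∑ b : PBond i.P 0, (ζ b.src * A b) ^ 2 := by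
  rw [norm_smulB, Real.sq_sqrt (Finset.sum_nonneg fun b _ => sq_nonneg _)]

/-- `ζ·∇_μG_□∇*J = Σ_λ ζ·∇_μG_□∇_λ*J_λ` (additivity). [cite: Balaban1984PropagatorsI, (1.114) p.36 («ζ∇G∇*J»), dictionary] -/
theorem smulB_Dl_G_divTS (ζ : Site i.P 0 → ℝ) (mu : Fin i.P.d) (J : Fin i.P.d → BondSpace i.P) :
    i.smulB ζ (i.Dl mu (i.G (i.divTS J))) = ∑ lam, i.smulB ζ (i.Dl mu (i.G (i.Dla lam (J lam)))) := by
  refine PiLp.ext fun b => ?_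
  rw [smulB_apply, Dl_G_divTS_apply, Finset.mul_sum, WithLp.ofLp_sum, Finset.sum_apply]
  rfl

/-- `ζ·G_□∇*∇*J = Σ_λ Σ_μ ζ·G_□∇_λ*∇_μ*J_{λμ}` (additivity). [cite: Balaban1984PropagatorsI, (1.114) p.36 («ζG∇*∇*J»), dictionary] -/
theorem smulB_G_div2TS (ζ : Site i.P 0 → ℝ) (J : Fin i.P.d → Fin i.P.d → BondSpace i.P) :
    i.smulB ζ (i.G (i.div2TS J)) = ∑ lam, ∑ mu, i.smulB ζ (i.G (i.Dla lam (i.Dla mu (J lam mu)))) := by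
  refine PiLp.ext fun b => ?_
  rw [smulB_apply, G_div2TS_apply, Finset.mul_sum, WithLp.ofLp_sum, Finset.sum_apply]
  refine Finset.sum_congr rfl fun lam _ => ?_
  rw [Finset.mul_sum, WithLp.ofLp_sum, Finset.sum_apply]
  rfl

end TSIdx

section ClausesL2Second

variable {d L : ℕ} {hd : 1 ≤ d + 1} {hL : Odd L ∧ 1 < L} {a₀ a₁ : ℝ}

open TSIdx
open B6Prop25Grad2DecayTwoScaleV1 (prop25_ineq114_gradgrad prop25_ineq114_GDadjDadj)
open B6Prop25GradGDivDecayTwoScaleV1 (prop25_ineq114_gradGdiv)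

/-- **THE (1.114)₄ CLAUSE `(Σ_μ‖ζ∇_μG_□∇*J‖²)^{1/2}` FOR THE GENUINE TWO-SCALE FAMILY** (v1.7): there are `δ₂ > 0`, `C ≥ 0` (on `d, L, a₀, a₁`) such that for
EVERY member, every source `J` (any kind; the entry lives on the `ten` kind) with `supp J ⊂ Δ̃(y′)` and every cut-off `ζ` with `supp ζ ⊂ Δ̃(y)`:
`l2loc 3 J ζ ≤ C·e^{−δ₂|y−y′|}·|ζ|·‖J‖` — p22 g16's `prop25_ineq114_gradGdiv` (file 28b: the squared bound for `ζ∇_μG_□∇_λ*J_λ` per `(μ, λ)`, at `r = 1`,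
`Z = |ζ|`), square roots, the triangle inequality over `λ` with `‖J_λ‖ ≤ ‖J‖`, then `Σ_μ` (`√(d+1) ≤ d + 1`).
[cite: Balaban1984PropagatorsII, Prop. 2.5 p.246; Balaban1984PropagatorsI, Prop. 1.2 (1.114) p.36] -/
theorem ineq114_three_TS (ha₀ : 0 < a₀) (ha₁ : a₀ ≤ a₁) :
    ∃ δ : ℝ, 0 < δ ∧ ∃ C : ℝ, 0 ≤ C ∧ ∀ (i : TSIdx d L hd hL a₀ a₁) (J : i.LocTS) (ζ : Site i.P 0 → ℝ) (y y' : Site i.P i.j),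
      i.cutInTS ζ y → i.suppInTS J y' → i.l2locTS 3 J ζ ≤ C * Real.exp (-(δ * i.tdist y y')) * i.cutSupTS ζ * i.l2NormTS J := by
  classical
  obtain ⟨δ, hδ, C, hC, h⟩ := prop25_ineq114_gradGdiv d L hd hL ha₀ ha₁
  refine ⟨δ, hδ, ((d : ℝ) + 1) * (((d : ℝ) + 1) * (C * Real.exp ((1 + 2 * δ) * 1))), by positivity, ?_⟩
  intro i J ζ y y' hζ hsupp
  have hRHS : 0 ≤ ((d : ℝ) + 1) * (((d : ℝ) + 1) * (C * Real.exp ((1 + 2 * δ) * 1))) * Real.exp (-(δ * i.tdist y y')) * i.cutSupTS ζ *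
      i.l2NormTS J := mul_nonneg (mul_nonneg (by positivity) (i.cutSupTS_nonneg ζ)) (i.l2NormTS_nonneg J)
  cases J with
  | vec J => rw [l2locTS_three_vec]; exact hRHS
  | ten2 J => rw [l2locTS_three_ten2]; exact hRHS
  | ten J =>
    rw [l2locTS_three_ten]
    set B : ℝ := C * Real.exp ((1 + 2 * δ) * 1) * Real.exp (-(δ * i.tdist y y')) * i.cutSupTS ζ with hB
    have hB0 : 0 ≤ B := by rw [hB]; exact mul_nonneg (by positivity) (i.cutSupTS_nonneg ζ)
    have hX0 : 0 ≤ i.l2NormTS (.ten J) := i.l2NormTS_nonneg _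
    -- per pair of directions `(μ, λ)`: the square root of p22's squared bound, `Z = |ζ|`, `r = 1`
    have hpair : ∀ mu lam : Fin i.P.d, ‖i.smulB ζ (i.Dl mu (i.G (i.Dla lam (J lam))))‖ ≤ B * i.l2NormTS (.ten J) := by
      intro mu lam
      have h1 := h i.m i.K i.j i.hc i.hj i.Λ' i.w i.hw0 i.hw1 mu lam 1 zero_le_one (J lam) ζ (i.cutSupTS ζ) (i.cutSupTS_nonneg ζ) y y'
        (hsupp lam) hζ (fun x => i.abs_le_cutSupTS ζ x)
      have h2 : ‖i.smulB ζ (i.Dl mu (i.G (i.Dla lam (J lam))))‖ ≤ B * ‖J lam‖ := by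
        rw [← Real.sqrt_sq (norm_nonneg _), norm_smulB_sq]
        exact sqrt_le_of_sq_bound hB0 (norm_nonneg _) h1
      exact h2.trans (mul_le_mul_of_nonneg_left (i.norm_le_l2NormTS_ten J lam) hB0)
    -- per `μ`: the triangle inequality over `λ`
    have hmu : ∀ mu : Fin i.P.d, ‖i.smulB ζ (i.Dl mu (i.G (i.divTS J)))‖ ≤ ((d : ℝ) + 1) * B * i.l2NormTS (.ten J) := by
      intro mu
      rw [smulB_Dl_G_divTS]
      calc ‖∑ lam, i.smulB ζ (i.Dl mu (i.G (i.Dla lam (J lam))))‖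
          ≤ ∑ lam, ‖i.smulB ζ (i.Dl mu (i.G (i.Dla lam (J lam))))‖ := norm_sum_le _ _
        _ ≤ ∑ _lam : Fin i.P.d, B * i.l2NormTS (.ten J) := Finset.sum_le_sum fun lam _ => hpair mu lam
        _ = ((d : ℝ) + 1) * B * i.l2NormTS (.ten J) := by
            rw [Finset.sum_const, Finset.card_univ, Fintype.card_fin, nsmul_eq_mul]
            push_cast
            ring
    have hsum : ∑ mu, ‖i.smulB ζ (i.Dl mu (i.G (i.divTS J)))‖ ^ 2 ≤ (((d : ℝ) + 1) * (((d : ℝ) + 1) * B)) ^ 2 * i.l2NormTS (.ten J) ^ 2 := by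
      have hB1 : 0 ≤ ((d : ℝ) + 1) * B * i.l2NormTS (.ten J) := by positivity
      calc ∑ mu, ‖i.smulB ζ (i.Dl mu (i.G (i.divTS J)))‖ ^ 2
          ≤ ∑ _mu : Fin i.P.d, (((d : ℝ) + 1) * B * i.l2NormTS (.ten J)) ^ 2 :=
            Finset.sum_le_sum fun mu _ => pow_le_pow_left₀ (norm_nonneg _) (hmu mu) 2
        _ = ((d : ℝ) + 1) * (((d : ℝ) + 1) * B * i.l2NormTS (.ten J)) ^ 2 := by
            rw [Finset.sum_const, Finset.card_univ, Fintype.card_fin, nsmul_eq_mul]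
            push_cast
            ring
        _ ≤ ((d : ℝ) + 1) ^ 2 * (((d : ℝ) + 1) * B * i.l2NormTS (.ten J)) ^ 2 := by
            refine mul_le_mul_of_nonneg_right ?_ (by positivity)
            nlinarith [show (0 : ℝ) ≤ (d : ℝ) from Nat.cast_nonneg d]
        _ = (((d : ℝ) + 1) * (((d : ℝ) + 1) * B)) ^ 2 * i.l2NormTS (.ten J) ^ 2 := by ring
    calc Real.sqrt (∑ mu, ‖i.smulB ζ (i.Dl mu (i.G (i.divTS J)))‖ ^ 2)
        ≤ ((d : ℝ) + 1) * (((d : ℝ) + 1) * B) * i.l2NormTS (.ten J) := sqrt_le_of_sq_bound (by positivity) hX0 hsum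
      _ = ((d : ℝ) + 1) * (((d : ℝ) + 1) * (C * Real.exp ((1 + 2 * δ) * 1))) * Real.exp (-(δ * i.tdist y y')) * i.cutSupTS ζ *
            i.l2NormTS (.ten J) := by rw [hB]; ring

/-- **THE (1.114)₅ CLAUSE `(Σ_{λμ}‖ζ∇_λ∇_μG_□J‖²)^{1/2}` FOR THE GENUINE TWO-SCALE FAMILY** (v1.7): for EVERY member, every source `J` (the entry lives on
the `vec` kind) with `supp J ⊂ Δ̃(y′)` and every cut-off `ζ` with `supp ζ ⊂ Δ̃(y)`: `l2loc 4 J ζ ≤ C·e^{−δ₂|y−y′|}·|ζ|·‖J‖` — p22 g16's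
`prop25_ineq114_gradgrad` (file 27, p338193: the squared bound for `ζ∇_λ∇_μG_□J` per `(λ, μ)`, at `r = 1`, `Z = |ζ|`), summed over the `(d+1)²` pairs
(`√((d+1)²) = d + 1`). [cite: Balaban1984PropagatorsII, Prop. 2.5 p.246; Balaban1984PropagatorsI, Prop. 1.2 (1.114) p.36] -/
theorem ineq114_four_TS (ha₀ : 0 < a₀) (ha₁ : a₀ ≤ a₁) :
    ∃ δ : ℝ, 0 < δ ∧ ∃ C : ℝ, 0 ≤ C ∧ ∀ (i : TSIdx d L hd hL a₀ a₁) (J : i.LocTS) (ζ : Site i.P 0 → ℝ) (y y' : Site i.P i.j),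
      i.cutInTS ζ y → i.suppInTS J y' → i.l2locTS 4 J ζ ≤ C * Real.exp (-(δ * i.tdist y y')) * i.cutSupTS ζ * i.l2NormTS J := by
  classical
  obtain ⟨δ, hδ, C, hC, h⟩ := prop25_ineq114_gradgrad d L hd hL ha₀ ha₁
  refine ⟨δ, hδ, ((d : ℝ) + 1) * (C * Real.exp ((1 + 2 * δ) * 1)), by positivity, ?_⟩
  intro i J ζ y y' hζ hsupp
  have hRHS : 0 ≤ ((d : ℝ) + 1) * (C * Real.exp ((1 + 2 * δ) * 1)) * Real.exp (-(δ * i.tdist y y')) * i.cutSupTS ζ * i.l2NormTS J :=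
    mul_nonneg (mul_nonneg (by positivity) (i.cutSupTS_nonneg ζ)) (i.l2NormTS_nonneg J)
  cases J with
  | ten J => rw [l2locTS_four_ten]; exact hRHS
  | ten2 J => rw [l2locTS_four_ten2]; exact hRHS
  | vec J =>
    rw [l2locTS_four_vec]
    set B : ℝ := C * Real.exp ((1 + 2 * δ) * 1) * Real.exp (-(δ * i.tdist y y')) * i.cutSupTS ζ with hB
    have hB0 : 0 ≤ B := by rw [hB]; exact mul_nonneg (by positivity) (i.cutSupTS_nonneg ζ)
    have hterm : ∀ lam mu : Fin i.P.d, ‖i.smulB ζ (i.Dl lam (i.Dl mu (i.G J)))‖ ^ 2 ≤ B ^ 2 * ‖J‖ ^ 2 := by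
      intro lam mu
      rw [norm_smulB_sq]
      exact h i.m i.K i.j i.hc i.hj i.Λ' i.w i.hw0 i.hw1 lam mu 1 zero_le_one J ζ (i.cutSupTS ζ) (i.cutSupTS_nonneg ζ) y y'
        hsupp hζ (fun x => i.abs_le_cutSupTS ζ x)
    have hsum : ∑ lam, ∑ mu, ‖i.smulB ζ (i.Dl lam (i.Dl mu (i.G J)))‖ ^ 2 ≤ (((d : ℝ) + 1) * B) ^ 2 * ‖J‖ ^ 2 := by
      calc ∑ lam, ∑ mu, ‖i.smulB ζ (i.Dl lam (i.Dl mu (i.G J)))‖ ^ 2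
          ≤ ∑ _lam : Fin i.P.d, ∑ _mu : Fin i.P.d, B ^ 2 * ‖J‖ ^ 2 :=
            Finset.sum_le_sum fun lam _ => Finset.sum_le_sum fun mu _ => hterm lam mu
        _ = (((d : ℝ) + 1) * B) ^ 2 * ‖J‖ ^ 2 := by
            rw [Finset.sum_const, Finset.card_univ, Fintype.card_fin, Finset.sum_const, Finset.card_univ, Fintype.card_fin, smul_smul,
              nsmul_eq_mul]
            push_cast
            ring
    calc Real.sqrt (∑ lam, ∑ mu, ‖i.smulB ζ (i.Dl lam (i.Dl mu (i.G J)))‖ ^ 2)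
        ≤ ((d : ℝ) + 1) * B * ‖J‖ := sqrt_le_of_sq_bound (by positivity) (norm_nonneg J) hsum
      _ = ((d : ℝ) + 1) * (C * Real.exp ((1 + 2 * δ) * 1)) * Real.exp (-(δ * i.tdist y y')) * i.cutSupTS ζ * i.l2NormTS (.vec J) := by
          rw [hB]; show _ = _ * ‖J‖; ring

/-- **THE (1.114)₆ CLAUSE `‖ζG_□∇*∇*J‖` FOR THE GENUINE TWO-SCALE FAMILY** (v1.7): for EVERY member, every source `J = (J_{λμ})` (the entry lives on the
`ten2` kind) with `supp J ⊂ Δ̃(y′)` and every cut-off `ζ` with `supp ζ ⊂ Δ̃(y)`: `l2loc 5 J ζ = ‖ζG_□∇*∇*J‖ ≤ C·e^{−δ₂|y−y′|}·|ζ|·‖J‖`,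
`‖J‖ = (Σ_{λμ}‖J_{λμ}‖²)^{1/2}` — p22 g16's `prop25_ineq114_GDadjDadj` (file 27, p338193: the squared bound for `ζG_□∇_λ*∇_μ*J_{λμ}` per `(λ, μ)`, at
`r = 1`, `Z = |ζ|`), square roots, the triangle inequality over the `(d+1)²` pairs and `‖J_{λμ}‖ ≤ ‖J‖`.
[cite: Balaban1984PropagatorsII, Prop. 2.5 p.246; Balaban1984PropagatorsI, Prop. 1.2 (1.114) p.36] -/
theorem ineq114_five_TS (ha₀ : 0 < a₀) (ha₁ : a₀ ≤ a₁) :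
    ∃ δ : ℝ, 0 < δ ∧ ∃ C : ℝ, 0 ≤ C ∧ ∀ (i : TSIdx d L hd hL a₀ a₁) (J : i.LocTS) (ζ : Site i.P 0 → ℝ) (y y' : Site i.P i.j),
      i.cutInTS ζ y → i.suppInTS J y' → i.l2locTS 5 J ζ ≤ C * Real.exp (-(δ * i.tdist y y')) * i.cutSupTS ζ * i.l2NormTS J := by
  classical
  obtain ⟨δ, hδ, C, hC, h⟩ := prop25_ineq114_GDadjDadj d L hd hL ha₀ ha₁
  refine ⟨δ, hδ, ((d : ℝ) + 1) * (((d : ℝ) + 1) * (C * Real.exp ((1 + 2 * δ) * 1))), by positivity, ?_⟩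
  intro i J ζ y y' hζ hsupp
  have hRHS : 0 ≤ ((d : ℝ) + 1) * (((d : ℝ) + 1) * (C * Real.exp ((1 + 2 * δ) * 1))) * Real.exp (-(δ * i.tdist y y')) * i.cutSupTS ζ *
      i.l2NormTS J := mul_nonneg (mul_nonneg (by positivity) (i.cutSupTS_nonneg ζ)) (i.l2NormTS_nonneg J)
  cases J with
  | vec J => rw [l2locTS_five_vec]; exact hRHS
  | ten J => rw [l2locTS_five_ten]; exact hRHS
  | ten2 J =>
    rw [l2locTS_five_ten2, smulB_G_div2TS]
    set B : ℝ := C * Real.exp ((1 + 2 * δ) * 1) * Real.exp (-(δ * i.tdist y y')) * i.cutSupTS ζ with hB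
    have hB0 : 0 ≤ B := by rw [hB]; exact mul_nonneg (by positivity) (i.cutSupTS_nonneg ζ)
    have hX0 : 0 ≤ i.l2NormTS (.ten2 J) := i.l2NormTS_nonneg _
    have hpair : ∀ lam mu : Fin i.P.d, ‖i.smulB ζ (i.G (i.Dla lam (i.Dla mu (J lam mu))))‖ ≤ B * i.l2NormTS (.ten2 J) := by
      intro lam mu
      have h1 := h i.m i.K i.j i.hc i.hj i.Λ' i.w i.hw0 i.hw1 mu lam 1 zero_le_one (J lam mu) ζ (i.cutSupTS ζ) (i.cutSupTS_nonneg ζ) y y'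
        (hsupp lam mu) hζ (fun x => i.abs_le_cutSupTS ζ x)
      have h2 : ‖i.smulB ζ (i.G (i.Dla lam (i.Dla mu (J lam mu))))‖ ≤ B * ‖J lam mu‖ := by
        rw [← Real.sqrt_sq (norm_nonneg _), norm_smulB_sq]
        exact sqrt_le_of_sq_bound hB0 (norm_nonneg _) h1
      exact h2.trans (mul_le_mul_of_nonneg_left (i.norm_le_l2NormTS_ten2 J lam mu) hB0)
    calc ‖∑ lam, ∑ mu, i.smulB ζ (i.G (i.Dla lam (i.Dla mu (J lam mu))))‖
        ≤ ∑ lam, ‖∑ mu, i.smulB ζ (i.G (i.Dla lam (i.Dla mu (J lam mu))))‖ := norm_sum_le _ _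
      _ ≤ ∑ lam, ∑ mu, ‖i.smulB ζ (i.G (i.Dla lam (i.Dla mu (J lam mu))))‖ := Finset.sum_le_sum fun lam _ => norm_sum_le _ _
      _ ≤ ∑ _lam : Fin i.P.d, ∑ _mu : Fin i.P.d, B * i.l2NormTS (.ten2 J) :=
          Finset.sum_le_sum fun lam _ => Finset.sum_le_sum fun mu _ => hpair lam mu
      _ = ((d : ℝ) + 1) * (((d : ℝ) + 1) * (C * Real.exp ((1 + 2 * δ) * 1))) * Real.exp (-(δ * i.tdist y y')) * i.cutSupTS ζ *
            i.l2NormTS (.ten2 J) := by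
          rw [Finset.sum_const, Finset.card_univ, Fintype.card_fin, Finset.sum_const, Finset.card_univ, Fintype.card_fin, smul_smul,
            nsmul_eq_mul, hB]
          push_cast
          ring

/-- **THE FIFTH CONJUNCT OF `B5.Ineq110_114` ON THE CENSUS SETTING, VERBATIM (all six members of (1.114))** (v1.7): there are `δ > 0` and `C ≥ 0`
(chosen before the member) such that for EVERY member, every `n : Fin 6`, every source `J` with `supp J ⊂ Δ̃(y′)`, every cut-off `ζ` with `supp ζ ⊂ Δ̃(y)`:
`(settingTS i).l2loc n J ζ ≤ C·e^{−δ·dist(y,y′)}·cutSup ζ·l2Norm J` («‖ζGJ‖, ‖ζ∇GJ‖, ‖ζG∇*J‖, ‖ζ∇G∇*J‖, ‖ζ∇∇GJ‖, ‖ζG∇*∇*J‖ ≤ O(1)e^{−δ₀|y−y′|}|ζ|‖J‖ …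
with the constant O(1) depending on d only») — §11's clauses at `n ≤ 2` and `ineq114_three/four/five_TS`, common rate the minimum, common constant the
maximum. [cite: Balaban1984PropagatorsII, Prop. 2.5 p.246; Balaban1984PropagatorsI, Prop. 1.2 (1.114) p.36] -/
theorem ineq114_settingTS (ha₀ : 0 < a₀) (ha₁ : a₀ ≤ a₁) :
    ∃ δ : ℝ, 0 < δ ∧ ∃ C : ℝ, 0 ≤ C ∧ ∀ (i : TSIdx d L hd hL a₀ a₁) (n : Fin 6) (J : (settingTS i).Loc) (ζ : (settingTS i).Cut)
      (y y' : (settingTS i).Site), (settingTS i).cutIn ζ y → (settingTS i).suppIn J y' →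
      (settingTS i).l2loc n J ζ ≤ C * Real.exp (-(δ * (settingTS i).dist y y')) * (settingTS i).cutSup ζ * (settingTS i).l2Norm J := by
  obtain ⟨δ₁, hδ₁, C₁, hC₁, h₁⟩ := clauses_settingTS_six (d := d) (L := L) (hd := hd) (hL := hL) ha₀ ha₁
  obtain ⟨δ₃, hδ₃, C₃, hC₃, h₃⟩ := ineq114_three_TS (d := d) (L := L) (hd := hd) (hL := hL) ha₀ ha₁
  obtain ⟨δ₄, hδ₄, C₄, hC₄, h₄⟩ := ineq114_four_TS (d := d) (L := L) (hd := hd) (hL := hL) ha₀ ha₁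
  obtain ⟨δ₅, hδ₅, C₅, hC₅, h₅⟩ := ineq114_five_TS (d := d) (L := L) (hd := hd) (hL := hL) ha₀ ha₁
  set δ := min (min δ₁ δ₃) (min δ₄ δ₅) with hδdef
  set C := max (max C₁ C₃) (max C₄ C₅) with hCdef
  have hδ0 : 0 < δ := lt_min (lt_min hδ₁ hδ₃) (lt_min hδ₄ hδ₅)
  have hC0 : 0 ≤ C := le_max_of_le_left (le_max_of_le_left hC₁)
  have hδ₁' : δ ≤ δ₁ := (min_le_left _ _).trans (min_le_left _ _)
  have hδ₃' : δ ≤ δ₃ := (min_le_left _ _).trans (min_le_right _ _)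
  have hδ₄' : δ ≤ δ₄ := (min_le_right _ _).trans (min_le_left _ _)
  have hδ₅' : δ ≤ δ₅ := (min_le_right _ _).trans (min_le_right _ _)
  have hC₁' : C₁ ≤ C := (le_max_left C₁ C₃).trans (le_max_left _ _)
  have hC₃' : C₃ ≤ C := (le_max_right C₁ C₃).trans (le_max_left _ _)
  have hC₄' : C₄ ≤ C := (le_max_left C₄ C₅).trans (le_max_right _ _)
  have hC₅' : C₅ ≤ C := (le_max_right C₄ C₅).trans (le_max_right _ _)
  -- weakening the rate and enlarging the constant
  have mono : ∀ {δ' C' : ℝ} (_ : δ ≤ δ') (_ : C' ≤ C) {t X : ℝ} (_ : 0 ≤ t) (_ : 0 ≤ X),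
      C' * Real.exp (-(δ' * t)) * X ≤ C * Real.exp (-(δ * t)) * X := by
    intro δ' C' hδ' hC' t X ht hX
    exact mul_le_mul (mul_le_mul hC' (Real.exp_le_exp.2 (neg_le_neg (mul_le_mul_of_nonneg_right hδ' ht))) (Real.exp_nonneg _) hC0)
      le_rfl hX (mul_nonneg hC0 (Real.exp_nonneg _))
  refine ⟨δ, hδ0, C, hC0, fun i n J ζ y y' hζ hJ => ?_⟩
  change i.l2locTS n J ζ ≤ C * Real.exp (-(δ * i.tdist y y')) * i.cutSupTS ζ * i.l2NormTS J
  have hX : 0 ≤ i.cutSupTS ζ * i.l2NormTS J := mul_nonneg (i.cutSupTS_nonneg ζ) (i.l2NormTS_nonneg J)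
  have ht := i.tdist_nonneg y y'
  rw [mul_assoc]
  by_cases hn : n.val ≤ 2
  · have h := (h₁ i).2 n hn J ζ y y' hζ hJ
    change i.l2locTS n J ζ ≤ C₁ * Real.exp (-(δ₁ * i.tdist y y')) * i.cutSupTS ζ * i.l2NormTS J at h
    rw [mul_assoc] at h
    exact h.trans (mono hδ₁' hC₁' ht hX)
  · rcases n with ⟨_ | _ | _ | _ | _ | _ | k, hk⟩
    · simp at hn
    · simp at hn
    · simp at hn
    · have h := h₃ i J ζ y y' hζ hJ
      rw [mul_assoc] at h
      exact h.trans (mono hδ₃' hC₃' ht hX)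
    · have h := h₄ i J ζ y y' hζ hJ
      rw [mul_assoc] at h
      exact h.trans (mono hδ₄' hC₄' ht hX)
    · have h := h₅ i J ζ y y' hζ hJ
      rw [mul_assoc] at h
      exact h.trans (mono hδ₅' hC₅' ht hX)
    · omega

/-- **PROPOSITION 2.5 ON THE CENSUS CARRIER OF THE GENUINE TWO-SCALE FAMILY** (v1.7): `B6.Prop25Printed (fun i => locTS i)` — for EVERY member `G_□` of
(2.90) (p22's `tsV1`, `Λ′ ⊂ T^{(j+1)}` arbitrary, weights in [4]'s window) the representation (2.129) holds AND its census setting satisfies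
`B5.Ineq110_114 (settingTS i) C C_α C_ε C_αε δ₂` — ALL the inequalities (1.110)–(1.114) of [4] Prop. 1.2 — with ONE `δ₂ > 0`, `C > 0`, `C_α`, `C_ε`,
`C_αε` chosen before the member («The operator G_□ defined by (2.90) … has the representation (2.129) and satisfies all the inequalities (1.110)–(1.114)
of the Proposition 1.2 with a positive constant δ₂ instead of δ₀. This constant depends on d and L only»; here on `d, L, a₀, a₁` — print's `a = 1`).
By §21's `prop25Printed_locTS_of114` and `ineq114_settingTS`.  An INHABITATION of the census Prop on the genuine two-scale family (the one-level
instance `B6Prop25OneLevelFamG.prop25Printed_oneLevel_famG` was the previous head instance).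
[cite: Balaban1984PropagatorsII, Prop. 2.5 p.246; Balaban1984PropagatorsI, Prop. 1.2 (1.110)–(1.114) pp.35–36] -/
theorem prop25Printed_TS (ha₀ : 0 < a₀) (ha₁ : a₀ ≤ a₁) : B6.Prop25Printed (fun i : TSIdx d L hd hL a₀ a₁ => locTS i) := by
  obtain ⟨δ, hδ, C, hC, h⟩ := ineq114_settingTS (d := d) (L := L) (hd := hd) (hL := hL) ha₀ ha₁
  exact prop25Printed_locTS_of114 ha₀ ha₁ ⟨δ, hδ, C, hC, fun i n _ J ζ y y' hζ hJ => h i n J ζ y y' hζ hJ⟩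

/-- **`B5.Ineq110_114` ON THE CENSUS SETTING OF EVERY MEMBER, with the constants chosen before the member** (v1.7) — the second conjunct of
`prop25Printed_TS` on its own. [cite: Balaban1984PropagatorsII, Prop. 2.5 p.246; Balaban1984PropagatorsI, Prop. 1.2 (1.110)–(1.114) pp.35–36] -/
theorem ineq110_114_settingTS (ha₀ : 0 < a₀) (ha₁ : a₀ ≤ a₁) :
    ∃ (δ₂ C : ℝ) (Cα Cε : ℝ → ℝ) (Cαε : ℝ → ℝ → ℝ), 0 < δ₂ ∧ 0 < C ∧
      ∀ i : TSIdx d L hd hL a₀ a₁, B5.Ineq110_114 (settingTS i) C Cα Cε Cαε δ₂ :=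
  (prop25Printed_TS (d := d) (L := L) (hd := hd) (hL := hL) ha₀ ha₁).2

end ClausesL2Second

section Prop12Shape

variable {d L : ℕ} {hd : 1 ≤ d + 1} {hL : Odd L ∧ 1 < L} {a₀ a₁ : ℝ}

open TSIdx

/-- **[4]'s Proposition 1.2 predicate on the census settings of the genuine two-scale family** (v1.7): `B5.Prop12Printed (fun i => settingTS i)` with `δ₂`
for `δ₀` — the type-level DAG edge B5 → B6 (`B6.prop12Shape_of_prop25`) applied to `prop25Printed_TS`.
[cite: Balaban1984PropagatorsII, Prop. 2.5 p.246; Balaban1984PropagatorsI, Prop. 1.2 pp.35–36] -/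
theorem prop12Printed_TS (ha₀ : 0 < a₀) (ha₁ : a₀ ≤ a₁) : B5.Prop12Printed (fun i : TSIdx d L hd hL a₀ a₁ => settingTS i) :=
  B6.prop12Shape_of_prop25 _ (prop25Printed_TS (d := d) (L := L) (hd := hd) (hL := hL) ha₀ ha₁)

end Prop12Shape

end Literature.MathematicalPhysics.QuantumFieldTheory.Balaban1983to89.B6Prop25TwoScaleCensus

end
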